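import Summits.Parity.GeneralizedHardyLittlewood.Theses.LiouvilleShiftedTables
import Summits.Parity.GeneralizedHardyLittlewood.Theses.ShiftedMultiplicationTable

/-!
# Disproof of `TableChowla` (stmt-Parity-14270) — standing adversary's work file (cdisprove, gen 2 + gen 3)

Crux (`Summit.Parity.GeneralizedHardyLittlewood.Theses.LiouvilleShiftedTables.TableChowla`):
for every `c ≠ 0`, `0 < δ ≤ 1/12`, `C > 0` and all large `x`, uniformly for `x^δ ≤ A ≤ x^{1/3+δ}`,
`T := ∑_{a,a' ∈ (⌊A⌋,⌊2A⌋]} (∑_{b ≤ ⌊x/A⌋} λ(ab+c) λ(a'b+c))² ≤ x² / (log x)^C`.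

VERDICT SO FAR (cycle 2): **resists**. Every degenerate regime of the signature is excluded by a hypothesis,
and each such hypothesis is PROVED load-bearing below (a); the bound cannot be improved beyond the
diagonal `x²/A` (b); the natural strengthenings are refuted (c); the crux FAILS for `λ`-like
pretenders `1` and `χ₄` (c′), so a proof must use non-pretentiousness of `λ` to real characters of
conductor dividing the shift; and the crux FOLLOWS from uniform binary Chowla–Elliott for two
linear forms (d), so a genuine counterexample — a structured family of `≫ A²/(log x)^{C₀}` row pairs
`(a,a')` with `|∑_b λ(ab+c)λ(a'b+c)| ≫ B/(log x)^{C₀/2}` (quantified in `badPairs_card_le`) — would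
refute that standard conjecture. Nothing of the kind is known; numerics (gen-1 kit runs, x ≤ 10⁷:
off-diagonal energy / random model ∈ [0.96, 1.08], no biased sub-family by gcd, class, `a'−a ∣ c`,
ratio; gen-2 job j006684 to x = 10⁸ pending) agree with the random model.

CYCLE 3 (gen-3 seat `refuter-cdisprove-stmt-Parity-14270-g3-0`, 2026-08-16, after the line
`helson-kronecker-inverse` was PICKED; Lean in the companion work file `DisproofGen3.lean`, same directory):
still **resists**. Two new kernel-checked findings, both filed under `Negative/`: (o) the picked
skeleton's residual cut is VOID — `MeanSquareCMAperiodic ↔ MeanSquareCM` for every `K`, so `stub_aperiodic`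
is the whole residual, `stub_periodic` (the BV branch) is logically redundant and `TableChowla ↔ InverseCM ∧
MeanSquareCMAperiodic`; (p) every PERIODIC `±1` symbol of any period `q` violates the crux's bound at EVERY
parameter point `(c, δ, C)` (row congruence `a ≡ a' (q)`, `T ≥ x²/(8q)`), extending (c′)/(c″) from one shift to all shifts (for zero-free symbols): a proof
must spend Siegel–Walfisz at ALL moduli `q ≤ 8(log x)^C`, not only at `q ∣ c`. Paper checks (no kill): the
BV branch (`BVLiouville` stmt-Parity-13324 and `stub_periodic_of_bv`) is sound as typed (`d = 1` forces
`c₁ = 0`; non-coprime residues reduce by complete multiplicativity; one residue per modulus suffices because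
`q` is fixed and `a ↦ aq` is injective); exceptional (Siegel) characters `χ (mod q)` with `q ∤ c` do NOT
threaten the `q = 1` table beyond the row-congruence family: for `a ≢ a' (q)` the complete sums
`Σ_{b mod q} χ(ab+c)χ̄(a'b+c)` are Möbius-transformation (Jacobsthal) sums of modulus `≤ 2` (prime `q`), so
the `χ`-table has `T_χ ≍ x²/q` coming exactly from `{a ≡ a' (q)}` — consistent with the crux iff
`q ≫ (log x)^C`: the Siegel range `q ≤ (log x)^C` is the only place where `λ ≈ χ` would hurt, and there
Siegel's theorem applies for fixed `c`. The symbol-GENERIC inverse theorem (InverseCM for arbitrary `±1`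
tables) is false on paper (planted rank-one block of `A × B(log x)^{-2C}` smooth columns + random signs:
op norm `≥ √x/(log x)^C` while every CM weight stays `(log x)^{-C'}`-orthogonal; the block must avoid the
`≍ B/log B` prime columns `> B/2`, where CM weights have free phases) — not formalised. Numerics: kit job
j009961 (x = 10⁸; c ∈ {1,−1,2,6}; A = x^σ, σ ∈ {5/12, 1/3, 1/4}): full row-Gram matrices `MMᵀ`,
off-diagonal energy vs the random model `rows(rows−1)B`, `σ₁` vs Bai–Yin, z-scores `S(a,a')/√B` (moments,
tails, top pairs with gcd / `h ∣ c` / `(a'/g) ∣ c` / ratio descriptors), family means, column band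
`k ≤ 12`. RESULT (j010634, x = 10⁸, 12 runs): off-diagonal energy / random model ∈ [0.978, 1.018] (5/12-window
runs: 1.0006, 0.9985, 1.0012, 1.0007), `σ₁/(√rows+√B)` ∈ [0.998, 1.000], z-scores Gaussian (std 1.000 ± 0.01,
|skew|, |kurt| < 0.14, max|z| below the Gaussian expectation in every run), NO family with |t| ≥ 4 among 45
families × 12 runs, column band within 1 ± 0.012 — full tables in `DisproofGen3.lean` docblock and the item
evidence `summary_1e8.txt`; j010697 (x = 10⁹) still queued at cycle close (auto-attached when it runs).

INDEX (all sorry-free):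
* READ-BACK `tableChowla_iff : TableChowla ↔ TableChowlaFor λ` (`Iff.rfl`) — the elaborated
  statement is the informal one; `x ^ 2` is `npow`, `Real.log x ^ C` is `rpow`; the only junk
  (`Int.toNat` of a negative argument ↦ `λ 0 = 0`) is absent for `x` large.
  `rectangleChowla_iff` (`Iff.rfl`): the refuted gen-1 crux stmt-Parity-4218 is this crux minus
  `δ ≤ 1/12`.
* (a) LOAD-BEARING: `not_tableChowlaWithoutShiftNeZero` (c = 0: rank-one collapse
  `λ(ab) = λ(a)λ(b)`, `T = x²`), `not_tableChowlaWithoutLowerWindow`, `not_tableChowlaWithoutDeltaPos`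
  (one-row table `A = 1`, `T = ⌊x⌋²`), `not_tableChowlaWithoutUpperWindow` (one-column table `A = x`,
  `T = N²`), `not_tableChowlaWithoutDeltaLe` (= 4218; `rectangleChowla_refuted'`), and the sharp
  band theorem `not_tableChowlaAt_of_mem_band : 2/3 ≤ δ ≤ 1 → ¬ TableChowlaAt f δ` for EVERY
  `±1`-valued `f`, against `tableChowlaAt_of_one_lt : 1 < δ → TableChowlaAt f δ` (vacuous band).
  NOT load-bearing: `0 < C` (`tableChowlaWithoutCPos_of`).
* (b) TIGHTNESS: `rows_mul_cols_sq_le_momentN` (`T ≥ rows·B² ≍ x²/A`, the diagonal), its column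
  dual `cols_mul_rows_sq_le_momentN` (`T ≥ B·rows² ≍ xA`, the random-model floor) via the exact
  duality `momentN_eq_colMoment` (`‖MMᵀ‖_F = ‖MᵀM‖_F`: the crux is equally a statement about
  SHORT column correlations `∑_{a ∼ A} λ(ab+c)λ(ab'+c)` of length `x^δ`), `diag_le_moment_pow`.
* (c) FALSE STRENGTHENINGS: `not_tableChowlaUniformPowerSaving` (no `x^{2-η}` with `η` uniform in
  `δ`: `η ≤ δ` forced), `not_tableChowlaThresholdUniformInC` (`∃ x₀ ∀ C` fails: the order
  `∀ C ∃ x₀` is essential), `not_tableChowlaPolylogWindow K` (a lower window `(log x)^K ≤ A` fails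
  for every `K` at `C = K+1`: the window's lower end must be super-polylogarithmic).
* (c′) PRETENDERS: `not_tableChowlaFor_one` (`f ≡ 1`), `not_tableChowlaFor_chi4` (`χ₄` at `c = 4`:
  `χ₄(ab+4) = χ₄(a)χ₄(b)`, rank one, `T = x²/16`). RANK-ONE MECHANISM `momentN_of_rankOne`: any
  factorisation `f(ab+c) = u(a)v(b)` kills all cancellation — the common shape of every refutation
  in this file. (c″) IN GENERAL: `not_tableChowlaFor_unitChar` — for EVERY `q ≥ 1` and every
  `q`-periodic completely multiplicative `χ` with `χ² = 𝟙_{(·,q)=1}` (all real Dirichlet characters,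
  principal ones included: `not_tableChowlaFor_principal`), `TableChowlaFor χ` fails at the shift
  `c = q` (`T = (φ(q)/q)⁴x²`, unit counting `sum_unitInd_Ico`; `χ₄` re-derived as an `example`): the Landau–Siegel
  input is needed at every modulus dividing the shift.
* (d) RESISTANCE: `tableChowla_of_uniformBinaryChowla : UniformBinaryChowla → TableChowla` via the
  combinatorial core `momentN_le_of_offDiag` (`T ≤ rows·B² + rows²(εB)²`) and the window
  bookkeeping (`rows ≤ 2A`, `x^{1/2} ≤ B ≤ x/A`, `4(log x)^C ≤ x^δ` eventually by
  `isLittleO_log_rpow_rpow_atTop`).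
* (d′) DUAL RESISTANCE (short sums): `tableChowla_of_uniformShortBinaryChowla :
  UniformShortBinaryChowla → TableChowla` — uniform binary Chowla for the SHORT two-form sums
  `Σ_{a∼A} λ(ab+c)λ(ab'+c)` (distinct columns `b ≠ b' ≤ x`, length `≍ A ≥ x^δ`) also implies the
  crux (core `momentN_le_of_offDiag_cols`); so a counterexample would refute both the long-sum
  (Elliott-type, (d)) and the short-sum (Matomäki–Radziwiłł-type) uniform conjectures.
* (e) EQUIVALENT FORMS / INTERFACE: `tableChowla_iff_withConst` (implicit constants are free),
  `tableChowla_iff_col` (the column = short-sum reading), `tableChowla_of_dilated`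
  (`DilatedTableChowla → TableChowla`, the `q = 1` slice — PROVED, transplantable by a prover with
  `--supports`), `badPairs_card_le` (KILL CRITERION quantified: under the crux at level `C`, at
  most `x²/((ηB)²(log x)^C) ≍ A²/(η²(log x)^C)` row pairs can have `|S(a,a')| ≥ ηB` — a refutation
  needs a structured `η`-biased family of relative density `≫ (log x)^{-C}`), and the junk of the
  `f`-interface: `tableChowlaFor_neg_iff` (`f ~ -f`), `tableChowlaFor_zero` (`f ≡ 0` inhabits it).
* (f) PROVER-FACING BOOKKEEPING: `one_le_arg_of_window` (no `Int.toNat` truncation once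
  `|c|+1 ≤ A`), `diag_eq_of_window` (diagonal `= rows·B²` exactly), `momentN_eq_diag_add_off`,
  `rows_mul_cols_sq_le_window` (`rows·B² ≤ 2x²/x^δ`), `eventually_log_rpow_le`
  (`4(log x)^C ≤ x^δ ∧ 2 ≤ log x` beyond `X(δ,C)`), and EQUIVALENT FORM 4
  `tableChowla_iff_offDiag : TableChowla ↔ TableChowlaOffDiag` — only the pairs `a ≠ a'` matter.
* (g) IDEATORS' TARGETS (crux-ideate round 1): `IdeaR1.not_localBoxChowla_r1` — the transfer
  target `LocalBoxChowla` of card `corner-local-box` (verbatim copy) is FALSE as filed (axes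
  `h = 0` / `k = 0` are sums of squares `= rows·B ≍ x`); misstated, repair
  `IdeaR1.LocalBoxChowlaOffAxes` (`h ≠ 0 ∧ k ≠ 0`), with which the double-vdC reduction still
  works on paper (the axes are its diagonal terms, `2x²/H`). `BandChowla` of card `slope-band-vdc`:
  no degenerate instance; plausible; not refuted (and see (j): its reduction is PROVED).
* (g′) IDEATOR 1's card `pivot-pair-level-half` (`Ideator1Copy.*`, verbatim): `alignment_holds`,
  `nearDiagonalNegligible_holds`, `shadowOfTable_holds` (the ℓ² transposed shadow) and the
  composition `pivotAssembly_holds` are PROVED; and `pairFamilyLevel_iff : PairFamilyLevel ↔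
  TableChowla` — the card's residual transfer target is the crux in costume (alignment + dropping
  the trivially negligible band `|a−a'| ≤ (log x)^{2C}`), so the line's content is entirely the
  proposed model / large-conductor split of it (`AvgTwistedChowlaLog 1/3` etc.), not the
  reformulation.
* (n) IDEATOR 2's card `helson-kronecker-inverse` (the round-1 card that PASSED triage; verbatim
  copies `Ideator2Copy.*`): its sorried linear-algebra stubs PROVED elementarily —
  `operatorNormForm_iff : OperatorNormForm ↔ TableChowla` (FACT 1, via `bilinear_pow_four_le :
  (uᵀMv)⁴ ≤ ‖u‖⁴‖v‖⁴·T` and the row test vectors `u = S(a,·)/√T_a`, `v = e(a,·)/√B`),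
  `first_lemma_holds : TableChowla → HyperbolicTernary`, `cm_necessary_holds : TableChowla →
  CMTestVectorBound` (any 1-bounded complex test vectors); and `inverseMH_of_tableChowla`: K1 AS
  TYPED (`∀ C' ∃ C`) is a consequence of the crux (premise eventually void), so it must be re-typed
  `∀ C ∃ C'` to carry the line (triage note 1 made exact).
* (k) `tableChowla_iff_fullWindow`: the `δ`-parametrisation is cosmetic — the crux is one
  statement over `A ∈ [x^σ, x^{5/12}]`, every `σ > 0` (so it may be split freely by ranges of
  `log A/log x`).
* (l) [→ `DisproofBands.lean`] COLUMN BAND DOMINATION (dual vdC in the column variable): `vdC_momentN_cols :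
  K·T ≤ (B + K − 1)·T_colband(K)` where `colBandMomentN … K` keeps column pairs at distance `< K`,
  i.e. squares of the SHORT two-form sums `G(b,b') = Σ_{a∼A} λ(ab+c)λ(ab'+c)`; hence
  `tableChowla_of_columnNearDiagonal : ColumnNearDiagonalChowla → TableChowla` — a
  `(log x)^{K−1}` mean-square saving in binary correlations of the forms `a ↦ b a + c`,
  `a ↦ b'a + c` over `a ∼ A` (length `x^δ…x^{5/12}`), averaged over `b ≤ x/A`, `|b−b'| < (log x)^K`,
  proves the crux: the short-sum / large-average (Matomäki–Radziwiłł-shaped) sufficient condition,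
  new on this crux (neither card states it).
* (m) [→ `DisproofBands.lean`] CORNER (LOCAL BOX) DOMINATION — double van der Corput: `corner_domination :
  H²K²·T ≤ (A₂+H−1−A₁)(B+K−1)·(2N·B·H·K² + 4N·B·H²·K + 4H²K²·Mx)` whenever every RESTRICTED corner
  sum `cornerRes … h k` (gaps `1 ≤ h < H`, `1 ≤ k < K`, all four corners inside the table) is
  `≤ Mx` in absolute value (tools: `sum_pairs_symm`, `sum_upper_window`, exact overlap counts);
  hence `tableChowla_of_offAxesCorners : OffAxesCornerChowla → TableChowla` — the first lemma
  `localBox_reduction` of card `corner-local-box` PROVED with its hypothesis REPAIRED (both gaps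
  non-zero, restricted corners; `K = C + 1`, `T ≤ 192x²/(log x)^{C+1}`), complementing the kill
  of the card's misstated `LocalBoxChowla` in (g).
* (h) EXCEPTIONAL-SET FORM: `tableChowla_iff_fewBadPairs : TableChowla ↔ FewBadPairs` — the crux
  is EXACTLY the statement that at every scale `η = (log x)^{-C}` the `η`-biased row pairs number
  `≤ x²/(B²(log x)^{C'}) ≍ A²/(log x)^{C'}` for every `C'` (provers: a large-values / Halász-type
  COUNT of biased pairs suffices; refuters: need `≫ A²/(log x)^{C'}` biased pairs for one `C'`).
* (i) HARDNESS CALIBRATION: `fixedResidueFace_of_tableChowla : TableChowla → FixedResidueFace`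
  (ideator 3's sorried calibration, PROVED): `Σ_{b ≤ x/A} |Σ_{a∼A} λ(ab+c)| ≤ x/(log x)^C` for
  every `C` — fixed residue, absolute values, moduli up to `x^{1−δ}`, `x^δ` terms each: level of
  distribution `1 − δ` for `λ`, known only at `1/2`. Depth, not falsity.
* (j) [→ companion work file `DisproofBands.lean`] BAND DOMINATION (finite van der Corput across the rows, exact): `vdC_pointwise`,
  `vdC_momentN : H·T ≤ (A₂ + H − 1 − A₁)·T_band(H)` for every `H ≥ 1`, where `bandMomentN … H`
  keeps only row pairs at distance `< H`; hence `tableChowla_of_nearDiagonal :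
  NearDiagonalChowla → TableChowla` (rows-restricted symmetric band) and, via the symmetric split
  `bandMomentN_le_diag_add_slopes` and the general `tableChowla_of_bandBound`,
  `IdeaR1.tableChowla_of_bandChowla : IdeaR1.BandChowla → TableChowla` — the first lemma
  `band_reduction` of card `slope-band-vdc` PROVED on the card's VERBATIM `BandChowla`: the
  `≍ A·(log x)^{C+2}` near-diagonal pairs carry the whole claim.
* (o) [gen 3 → `DisproofGen3.lean`; landed copy `Negative/TableChowlaAperiodicVacuity.lean`, p74937]
  APERIODIC VACUITY of the picked line's cut (verbatim the skeleton's `MeanSquareCM`, `MeanSquareCMPeriodic`,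
  `MeanSquareCMAperiodic`, `InverseCM`): `meanSquareCMAperiodic_iff : MeanSquareCMAperiodic ↔ MeanSquareCM`
  for every `K` (kill one prime `p > ⌊y⌋`: `killPrime`, `aperiodic_killPrime` — Euler `p^{φ(q)} = 1 + mq`
  — the new weight is CM, 1-bounded, has no period `< p` and gives the same column sums),
  `stubs_iff_inverse_and_aperiodic`, `tableChowla_of_inverse_aperiodic : InverseCM → MeanSquareCMAperiodic →
  TableChowla`, `inverseCM_of_tableChowla`. REPAIR for the lead (stub-misstated, not a kill): cut by
  periodicity / pretentious distance of `g` ON THE COLUMNS `[1, ⌊x/A⌋]`.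
* (p) [gen 3 → `DisproofGen3.lean`; landed copy `Negative/TableChowlaPeriodicSymbols.lean`] PERIODIC
  SYMBOLS FAIL EVERYWHERE: `not_tableChowlaBoundAt_of_periodic : 1 ≤ q → Periodic f q → (∀ n ≠ 0, f n² = 1)
  → ∀ c, 0 < δ ≤ 1/12 → 0 < C → ¬ TableChowlaBoundAt f c δ C` (`TableChowlaBoundAt` = the crux's bound at
  ONE parameter point, `tableChowla_iff_boundAt`), via `rowCorr_eq_cols_of_periodic` (rows `a`, `a + jq`
  coincide) and `momentN_ge_of_periodic` (`T ≥ 2qn²B²` on rows `(4qn, 8qn]`); corollaries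
  `not_tableChowlaFor_of_periodic`, the alternating symbol `(-1)^n`, and `chi4plus` (completed `χ₄`, at
  every shift — cf. (c′), shift 4 only).
* (q) [gen 3 → `DisproofGen3.lean`; landed copy `Negative/TableChowlaResidualWithoutCM.lean`, p76622] THE
  RESIDUAL WITHOUT "CM" IS THE CRUX: `meanSquareBounded_iff : MeanSquareBounded ↔ TableChowla` — delete
  "completely multiplicative" from the picked line's residual and it is the crux again (→ rows as test
  weights; ← `‖Mg‖² ≤ ‖g‖²√T`): the line's whole content is the extremality of CM weights (`InverseCM`).
* (r) [gen 3 → `DisproofGen3.lean`] THE WEAKEST LEVER closing the picked skeleton: `MinimalLever :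
  MeanSquareCM → MeanSquareBounded` (≡ `MeanSquareCM → TableChowla`), implied by `InverseCM` and by the crux;
  `tableChowla_iff_minimalLever : TableChowla ↔ MinimalLever ∧ MeanSquareCM`.

BARRIER / Ω-RESULT CHECK (why no known irregularity bites): Maier-matrix irregularities
(`Literature.Barriers.Parity.FriedlanderGranvilleUniformity`, Friedlander–Granville 1989/92) live
at moduli within `(log x)^N` of `x`, i.e. progressions with `(log x)^N` terms; the crux's implied
fixed-residue face (`Calibration.lean` of ideator 3: `Σ_{b ≤ x/A} |Σ_{a∼A} λ(ab+c)| ≪ x/(log x)^C`)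
has `x^δ` terms per progression, and the only `λ`-bias mechanism available to a Maier matrix —
the mean of `λ` on `z`-rough integers, `β(u) ≍ u^{-u}` at `u = log(length)/log z` — is negligible
for every modulus-forcible `z ≪ log x` (`u ≍ δ log x / log log x`). The MRT counterexample
(`ElliottOriginalForm`) concerns general 1-bounded `f`, not `λ`. No printed Ω-result for `λ` in
progressions reaches a `(log x)^{-C}` defect at power-length scales.

SIZE: the band / column-band / corner material ((j), (l), (m), and the proof of card
`slope-band-vdc`'s `band_reduction`) lives in the companion crux work file `DisproofBands.lean` (same
directory; it imports the LANDED `Theorems/TableChowla/Negative/*` modules, whose declarations are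
verbatim copies of this file's (a)–(i)).

LANDED (importable, `Summits.Parity.GeneralizedHardyLittlewood.Theorems.TableChowla.Negative.<Module>`,
namespace `…Theorems.TableChowla.Negative`, verbatim copies of the declarations here / in
`DisproofBands.lean`): `TableChowlaFalseWithoutShiftNeZero` (base defs, (a) c ≠ 0),
`TableChowlaDegenerateWindows` ((a) windows/band), `TableChowlaTightness` ((b), (c)),
`TableChowlaPretenders` ((c′)), `TableChowlaSiegelGhost` ((c″)), `TableChowlaOfUniformBinaryChowla`
((d)), `TableChowlaOfUniformShortBinaryChowla` ((d′)), `TableChowlaEquivalentForms` ((e), (f)),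
`TableChowlaExceptionalSet` ((h), (i)), `TableChowlaOperatorNorm` ((n) FACT 1),
`TableChowlaBandReduction` ((j)), `TableChowlaColumnBand` ((l)), `TableChowlaCornerTools` +
`TableChowlaCornerDomination` + `TableChowlaCornerReduction` ((m)). Gen 3: `TableChowlaAperiodicVacuity` ((o), p74937,
ACCEPTED), `TableChowlaPeriodicSymbols` ((p), p76581, ACCEPTED), `TableChowlaResidualWithoutCM` ((q), p76622,
ACCEPTED).

How to cite: gen-2 seat `refuter-cdisprove-stmt-Parity-14270-g2-0`, gen-3 seat
`refuter-cdisprove-stmt-Parity-14270-g3-0` ((o), (p), (q), `DisproofGen3.lean`); the gen-1 file (v5, overlapping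
theorem list, not readable from the gen-2 jail) was attached as item evidence only.
-/

namespace Summit.Parity.GeneralizedHardyLittlewood.Cruxes.TableChowla.Disproof

open Finset Real ArithmeticFunction
open Summit.Parity.GeneralizedHardyLittlewood.Theses

noncomputable section

/-- Liouville's function cast to `ℝ` (`λ 0 = 0`). -/
def lam (n : ℕ) : ℝ := (ArithmeticFunction.liouville n : ℝ)

/-- Row correlation `S_f(a,a') = ∑_{b ≤ B} f(ab+c) f(a'b+c)` of the shifted multiplication table. -/
def rowCorr (f : ℕ → ℝ) (c : ℤ) (B a a' : ℕ) : ℝ :=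
  ∑ b ∈ Icc 1 B, f (Int.toNat ((a : ℤ) * b + c)) * f (Int.toNat ((a' : ℤ) * b + c))

/-- Fourth moment `tr (M Mᵀ)²` of the table with rows `Ioc A₁ A₂`, columns `Icc 1 B`. -/
def momentN (f : ℕ → ℝ) (c : ℤ) (A₁ A₂ B : ℕ) : ℝ :=
  ∑ a ∈ Ioc A₁ A₂, ∑ a' ∈ Ioc A₁ A₂, rowCorr f c B a a' ^ 2

/-- The crux's real-parameter moment: rows `(⌊A⌋, ⌊2A⌋]`, columns `[1, ⌊x/A⌋]`. -/
def moment (f : ℕ → ℝ) (c : ℤ) (x A : ℝ) : ℝ := momentN f c ⌊A⌋₊ ⌊2 * A⌋₊ ⌊x / A⌋₊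

/-- The crux with `λ` replaced by an arbitrary `f : ℕ → ℝ`. -/
def TableChowlaFor (f : ℕ → ℝ) : Prop :=
  ∀ c : ℤ, c ≠ 0 → ∀ δ : ℝ, 0 < δ → δ ≤ 1 / 12 → ∀ C : ℝ, 0 < C → ∃ x₀ : ℝ, ∀ x : ℝ, x₀ ≤ x →
    ∀ A : ℝ, x ^ δ ≤ A → A ≤ x ^ (1 / 3 + δ) → moment f c x A ≤ x ^ 2 / Real.log x ^ C

/-- READ-BACK: the crux is literally `TableChowlaFor λ`. -/
theorem tableChowla_iff : LiouvilleShiftedTables.TableChowla ↔ TableChowlaFor lam := Iff.rfl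

/-! ## Structural lemmas (any `f`) -/

variable {f : ℕ → ℝ} {c : ℤ} {A₁ A₂ B : ℕ}

/-- The moment is a sum of squares. -/
theorem momentN_nonneg : 0 ≤ momentN f c A₁ A₂ B :=
  sum_nonneg fun _ _ => sum_nonneg fun _ _ => sq_nonneg _

/-- The row-diagonal is a lower bound for the moment. -/
theorem diag_le_momentN : ∑ a ∈ Ioc A₁ A₂, rowCorr f c B a a ^ 2 ≤ momentN f c A₁ A₂ B := by
  unfold momentN
  refine sum_le_sum fun a ha => ?_
  exact single_le_sum (f := fun a' => rowCorr f c B a a' ^ 2) (fun _ _ => sq_nonneg _) ha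

/-- A diagonal row correlation of a table with `±1` entries equals the row length. -/
theorem rowCorr_self_eq {a : ℕ} (hf : ∀ n, n ≠ 0 → f n ^ 2 = 1)
    (hpos : ∀ b ∈ Icc 1 B, 1 ≤ (a : ℤ) * b + c) : rowCorr f c B a a = B := by
  unfold rowCorr
  calc ∑ b ∈ Icc 1 B, f (Int.toNat ((a : ℤ) * b + c)) * f (Int.toNat ((a : ℤ) * b + c))
        = ∑ b ∈ Icc 1 B, (1 : ℝ) := by
          refine sum_congr rfl fun b hb => ?_
          rw [← sq]
          apply hf
          intro h0
          rw [Int.toNat_eq_zero] at h0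
          linarith [hpos b hb]
    _ = B := by simp

/-- RANK-ONE COLLAPSE: if the table factorises as `u(a) v(b)` then
`tr (M Mᵀ)² = (∑ u²)² (∑ v²)²` — no cancellation whatsoever. -/
theorem momentN_of_rankOne (u v : ℕ → ℝ)
    (h : ∀ a ∈ Ioc A₁ A₂, ∀ b ∈ Icc 1 B, f (Int.toNat ((a : ℤ) * b + c)) = u a * v b) :
    momentN f c A₁ A₂ B = (∑ a ∈ Ioc A₁ A₂, u a ^ 2) ^ 2 * (∑ b ∈ Icc 1 B, v b ^ 2) ^ 2 := by
  have hrow : ∀ a ∈ Ioc A₁ A₂, ∀ a' ∈ Ioc A₁ A₂,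
      rowCorr f c B a a' = u a * u a' * ∑ b ∈ Icc 1 B, v b ^ 2 := by
    intro a ha a' ha'
    unfold rowCorr
    rw [mul_sum]
    refine sum_congr rfl fun b hb => ?_
    rw [h a ha b hb, h a' ha' b hb]
    ring
  unfold momentN
  calc ∑ a ∈ Ioc A₁ A₂, ∑ a' ∈ Ioc A₁ A₂, rowCorr f c B a a' ^ 2
        = ∑ a ∈ Ioc A₁ A₂, ∑ a' ∈ Ioc A₁ A₂,
            u a ^ 2 * u a' ^ 2 * (∑ b ∈ Icc 1 B, v b ^ 2) ^ 2 := by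
          refine sum_congr rfl fun a ha => sum_congr rfl fun a' ha' => ?_
          rw [hrow a ha a' ha']
          ring
    _ = (∑ a ∈ Ioc A₁ A₂, u a ^ 2) ^ 2 * (∑ b ∈ Icc 1 B, v b ^ 2) ^ 2 := by
          rw [sq (∑ a ∈ Ioc A₁ A₂, u a ^ 2), sum_mul_sum, sum_mul]
          refine sum_congr rfl fun a _ => ?_
          rw [sum_mul]

/-- COLUMN DUALITY `‖M Mᵀ‖_F² = ‖Mᵀ M‖_F²`: the moment is equally the fourth moment of the
COLUMN correlations `∑_{a} f(ab+c) f(ab'+c)` — short sums of length `≍ A` over `a`. -/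
theorem momentN_eq_colMoment :
    momentN f c A₁ A₂ B = ∑ b ∈ Icc 1 B, ∑ b' ∈ Icc 1 B,
      (∑ a ∈ Ioc A₁ A₂, f (Int.toNat ((a : ℤ) * b + c)) * f (Int.toNat ((a : ℤ) * b' + c))) ^ 2 := by
  unfold momentN rowCorr
  simp_rw [sq, sum_mul_sum]
  -- bubble the `Icc` (column) sums outside the `Ioc` (row) sums; both sides are one quadruple sum
  simp_rw [sum_comm (s := Ioc A₁ A₂) (t := Icc 1 B)]
  refine sum_congr rfl fun b _ => sum_congr rfl fun b' _ => sum_congr rfl fun a _ =>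
    sum_congr rfl fun a' _ => ?_
  ring


/-- One-column tables: `S_f(a,a') = f(a+c) f(a'+c)`. -/
theorem rowCorr_one_col (a a' : ℕ) :
    rowCorr f c 1 a a' = f (Int.toNat ((a : ℤ) + c)) * f (Int.toNat ((a' : ℤ) + c)) := by
  simp [rowCorr]

/-- Zero-column tables have zero moment. -/
theorem momentN_zero_cols : momentN f c A₁ A₂ 0 = 0 := by
  simp [momentN, rowCorr]

/-! ## Facts about `λ` -/

/-- Junk value `λ 0 = 0`. -/
theorem lam_zero : lam 0 = 0 := by simp [lam]

/-- `λ(n)² = 1` for `n ≥ 1`. -/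
theorem lam_sq {n : ℕ} (hn : n ≠ 0) : lam n ^ 2 = 1 := by
  unfold lam
  rw [liouville_apply hn]
  push_cast
  rw [← pow_mul, mul_comm, pow_mul]
  norm_num

/-- `λ(n)² = 1` for `n ≥ 1` (explicit-argument form). -/
theorem lam_sq' : ∀ n : ℕ, n ≠ 0 → lam n ^ 2 = 1 := fun _ hn => lam_sq hn

/-- Complete multiplicativity of `λ` (over `ℝ`). -/
theorem lam_mul (m n : ℕ) : lam (m * n) = lam m * lam n := by
  unfold lam
  rw [liouville_apply_mul]
  push_cast
  ring

/-- `λ(n)² ≤ 1` for all `n` (including the junk value at `0`). -/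
theorem lam_sq_le_one (n : ℕ) : lam n ^ 2 ≤ 1 := by
  rcases eq_or_ne n 0 with rfl | hn
  · simp [lam_zero]
  · rw [lam_sq hn]

/-- `|λ(n)| ≤ 1`. -/
theorem abs_lam_le_one (n : ℕ) : |lam n| ≤ 1 := by
  have h := lam_sq_le_one n
  rw [abs_le]
  constructor <;> nlinarith [sq_nonneg (lam n - 1), sq_nonneg (lam n + 1)]

/-! ## Arithmetic of the standard specialisation `x = m ^ k`, `A = m` -/

/-- `⌊2m⌋₊ = 2m`. -/
theorem floor_two_mul_natCast (m : ℕ) : ⌊2 * (m : ℝ)⌋₊ = 2 * m := by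
  rw [show (2 * (m : ℝ)) = ((2 * m : ℕ) : ℝ) by push_cast; ring, Nat.floor_natCast]

/-- At `x = m^k`, `A = m` (`k ≥ 1`, `m ≥ 1`) the crux's moment is the integer-parameter moment with
rows `(m, 2m]` and `m^(k-1)` columns. -/
theorem moment_pow (f : ℕ → ℝ) (c : ℤ) {k m : ℕ} (hk : 1 ≤ k) (hm : m ≠ 0) :
    moment f c ((m : ℝ) ^ k) m = momentN f c m (2 * m) (m ^ (k - 1)) := by
  unfold moment
  rw [Nat.floor_natCast, floor_two_mul_natCast]
  congr 1
  have hm' : (m : ℝ) ≠ 0 := by exact_mod_cast hm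
  have hpow : (m : ℝ) ^ k = (m : ℝ) ^ (k - 1) * m := by
    rw [← pow_succ, Nat.sub_add_cancel hk]
  rw [hpow, mul_div_cancel_right₀ _ hm', show ((m : ℝ) ^ (k - 1)) = ((m ^ (k - 1) : ℕ) : ℝ) by push_cast; rfl,
    Nat.floor_natCast]

/-- `(m^k)^(1/k) = m`. -/
theorem rpow_pow_one_div (k : ℕ) (hk : k ≠ 0) (m : ℕ) : ((m : ℝ) ^ k) ^ ((1 : ℝ) / k) = m := by
  rw [one_div]
  exact Real.pow_rpow_inv_natCast (Nat.cast_nonneg m) hk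

/-- Window check at `x = m^k`, `A = m`, `δ = 1/k`: `x^δ ≤ A ≤ x^(1/3+δ)`. -/
theorem window_pow {k : ℕ} (hk : k ≠ 0) {m : ℕ} (hm : 1 ≤ m) :
    ((m : ℝ) ^ k) ^ ((1 : ℝ) / k) ≤ m ∧ (m : ℝ) ≤ ((m : ℝ) ^ k) ^ ((1 : ℝ) / 3 + 1 / k) := by
  have hlow := rpow_pow_one_div k hk m
  refine ⟨hlow.le, ?_⟩
  have hm1 : (1 : ℝ) ≤ m := by exact_mod_cast hm
  have hx1 : (1 : ℝ) ≤ (m : ℝ) ^ k := one_le_pow₀ hm1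
  calc (m : ℝ) = ((m : ℝ) ^ k) ^ ((1 : ℝ) / k) := hlow.symm
    _ ≤ ((m : ℝ) ^ k) ^ ((1 : ℝ) / 3 + 1 / k) :=
        Real.rpow_le_rpow_of_exponent_le hx1 (by linarith [show (0:ℝ) ≤ 1/3 by norm_num])

/-- Contradiction engine shared by the refutations: `P ≤ P'/L`, `P' ≤ κ P`, `0 < P`, `κ < L`. -/
theorem absurd_of_le_div {P P' L κ : ℝ} (hP : 0 < P) (hP' : P' ≤ κ * P) (hκ : 0 ≤ κ) (hL : κ < L)
    (h : P ≤ P' / L) : False := by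
  have hLpos : 0 < L := lt_of_le_of_lt hκ hL
  rw [le_div_iff₀ hLpos] at h
  nlinarith

/-- `log 2 > 1/2`. -/
theorem log_two_gt_half : (1 : ℝ) / 2 < Real.log 2 := by
  have := Real.log_two_gt_d9; linarith

/-- `log 3 > 1`. -/
theorem one_lt_log_three : (1 : ℝ) < Real.log 3 := by
  rw [Real.lt_log_iff_exp_lt (by norm_num)]
  have := Real.exp_one_lt_d9; linarith

/-! ## (a) LOAD-BEARING HYPOTHESES — each one dropped makes the statement FALSE -/

/-- The crux with the hypothesis `c ≠ 0` dropped. -/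
def TableChowlaWithoutShiftNeZero : Prop :=
  ∀ c : ℤ, ∀ δ : ℝ, 0 < δ → δ ≤ 1 / 12 → ∀ C : ℝ, 0 < C → ∃ x₀ : ℝ, ∀ x : ℝ, x₀ ≤ x →
    ∀ A : ℝ, x ^ δ ≤ A → A ≤ x ^ (1 / 3 + δ) → moment lam c x A ≤ x ^ 2 / Real.log x ^ C

/-- At `c = 0` the λ-table is RANK ONE (`λ(ab) = λ(a)λ(b)`): the moment is `rows² · B²` exactly. -/
theorem momentN_lam_shift_zero (A₁ A₂ B : ℕ) :
    momentN lam 0 A₁ A₂ B = ((Ioc A₁ A₂).card : ℝ) ^ 2 * (B : ℝ) ^ 2 := by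
  rw [momentN_of_rankOne (f := lam) (c := 0) lam lam ?_]
  · congr 2
    · rw [sum_congr rfl fun a ha => lam_sq (by simp only [mem_Ioc] at ha; omega)]
      simp
    · rw [sum_congr rfl fun b hb => lam_sq (by simp only [mem_Icc] at hb; omega)]
      simp
  · intro a _ b _
    rw [add_zero, show ((a : ℤ) * (b : ℕ)) = ((a * b : ℕ) : ℤ) by push_cast; rfl, Int.toNat_natCast,
      lam_mul]

/-- `c ≠ 0` is load-bearing: at `c = 0` (`δ = 1/12`, `C = 1`, `x = m¹²`, `A = m`) the moment is
`m² · m²² = x²` while the claim is `≤ x² / (12 log m)`. -/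
theorem not_tableChowlaWithoutShiftNeZero : ¬ TableChowlaWithoutShiftNeZero := by
  intro h
  obtain ⟨x₀, hx₀⟩ := h 0 (1 / 12) (by norm_num) le_rfl 1 one_pos
  obtain ⟨m, hm⟩ := exists_nat_ge (max x₀ 2)
  have hm2 : (2 : ℝ) ≤ m := le_trans (le_max_right _ _) hm
  have hmx : x₀ ≤ m := le_trans (le_max_left _ _) hm
  have hm1 : (1 : ℝ) ≤ m := by linarith
  have hm1' : 1 ≤ m := by exact_mod_cast hm1
  have hm0 : m ≠ 0 := by omega
  have hxx₀ : x₀ ≤ (m : ℝ) ^ 12 := hmx.trans (le_self_pow₀ hm1 (by norm_num))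
  obtain ⟨hw1, hw2⟩ := window_pow (k := 12) (by norm_num) hm1'
  have key := hx₀ ((m : ℝ) ^ 12) hxx₀ m (by exact_mod_cast hw1) (by exact_mod_cast hw2)
  rw [moment_pow lam 0 (by norm_num) hm0, momentN_lam_shift_zero, Nat.card_Ioc, Real.rpow_one,
    Real.log_pow] at key
  -- key : (2m - m)² · (m¹¹)² ≤ (m¹²)² / (12 log m)
  have hP : (0 : ℝ) < ((2 * m - m : ℕ) : ℝ) ^ 2 * ((m ^ (12 - 1) : ℕ) : ℝ) ^ 2 := by
    have : ((2 * m - m : ℕ) : ℝ) = m := by rw [show 2 * m - m = m by omega]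
    rw [this]; positivity
  refine absurd_of_le_div hP (κ := 1) ?_ zero_le_one ?_ key
  · rw [show 2 * m - m = m by omega]; push_cast; ring_nf; rfl
  · have := Real.log_le_log (by norm_num) hm2
    have := log_two_gt_half
    push_cast
    linarith


/-- One-row table: at `A = 1` the rows are `Ioc 1 2 = {2}` and there are `⌊x⌋` columns. -/
theorem moment_one_row (f : ℕ → ℝ) (c : ℤ) (x : ℝ) :
    moment f c x 1 = rowCorr f c ⌊x⌋₊ 2 2 ^ 2 := by
  unfold moment momentN
  have h12 : (Ioc 1 2 : Finset ℕ) = {2} := by decide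
  rw [Nat.floor_one, show (2 * (1 : ℝ)) = ((2 : ℕ) : ℝ) by norm_num, Nat.floor_natCast, div_one, h12]
  simp

/-- One-column table: at `A = x = N` the columns are `Icc 1 1`, the rows `(N, 2N]`, and for a
`±1`-valued `f` and `c ≥ 0` every summand is `1`: the moment is `N²`. -/
theorem moment_one_col {N : ℕ} (hN : N ≠ 0) (hf : ∀ n, n ≠ 0 → f n ^ 2 = 1) (hc : 0 ≤ c) :
    moment f c N N = (N : ℝ) ^ 2 := by
  unfold moment momentN
  rw [Nat.floor_natCast, floor_two_mul_natCast, div_self (by exact_mod_cast hN : (N : ℝ) ≠ 0),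
    Nat.floor_one]
  have hterm : ∀ a ∈ Ioc N (2 * N), ∀ a' ∈ Ioc N (2 * N), rowCorr f c 1 a a' ^ 2 = 1 := by
    intro a ha a' ha'
    simp only [mem_Ioc] at ha ha'
    rw [rowCorr_one_col, mul_pow, hf, hf, one_mul]
    · intro h0; rw [Int.toNat_eq_zero] at h0; omega
    · intro h0; rw [Int.toNat_eq_zero] at h0; omega
  rw [sum_congr rfl fun a ha => sum_congr rfl fun a' ha' => hterm a ha a' ha']
  simp only [sum_const, Nat.card_Ioc, nsmul_eq_mul, mul_one, show 2 * N - N = N by omega]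
  ring

/-- The one-row table at `A = 1`, `c = 1`, `x = N ≥ 3` violates the bound with `C = 1`. -/
theorem one_row_violates {N : ℕ} (hN3 : (3 : ℝ) ≤ N) :
    ¬ (moment lam 1 N 1 ≤ (N : ℝ) ^ 2 / Real.log N ^ (1 : ℝ)) := by
  intro key
  rw [moment_one_row, Nat.floor_natCast, rowCorr_self_eq lam_sq' (fun b _ => by push_cast; omega),
    Real.rpow_one] at key
  have hlog : 1 < Real.log N := one_lt_log_three.trans_le (Real.log_le_log (by norm_num) hN3)
  have hNpos : (0 : ℝ) < N := by linarith
  exact absurd_of_le_div (by positivity) (le_of_eq (one_mul _).symm) zero_le_one hlog key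

/-- The one-column table at `A = x = N ≥ 3`, `c = 1` violates the bound with `C = 1`, for every
`±1`-valued `f`. -/
theorem one_col_violates (hf : ∀ n, n ≠ 0 → f n ^ 2 = 1) {N : ℕ} (hN3 : (3 : ℝ) ≤ N) :
    ¬ (moment f 1 N N ≤ (N : ℝ) ^ 2 / Real.log N ^ (1 : ℝ)) := by
  intro key
  have hN0 : N ≠ 0 := by rintro rfl; norm_num at hN3
  rw [moment_one_col hN0 hf zero_le_one, Real.rpow_one] at key
  have hlog : 1 < Real.log N := one_lt_log_three.trans_le (Real.log_le_log (by norm_num) hN3)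
  have hNpos : (0 : ℝ) < N := by linarith
  exact absurd_of_le_div (by positivity) (le_of_eq (one_mul _).symm) zero_le_one hlog key

/-- The crux with the lower window bound `x ^ δ ≤ A` weakened to `1 ≤ A`. -/
def TableChowlaWithoutLowerWindow : Prop :=
  ∀ c : ℤ, c ≠ 0 → ∀ δ : ℝ, 0 < δ → δ ≤ 1 / 12 → ∀ C : ℝ, 0 < C → ∃ x₀ : ℝ, ∀ x : ℝ, x₀ ≤ x →
    ∀ A : ℝ, 1 ≤ A → A ≤ x ^ (1 / 3 + δ) → moment lam c x A ≤ x ^ 2 / Real.log x ^ C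

/-- The lower window bound is load-bearing: the ONE-ROW table `A = 1` has moment `⌊x⌋²`. -/
theorem not_tableChowlaWithoutLowerWindow : ¬ TableChowlaWithoutLowerWindow := by
  intro h
  obtain ⟨x₀, hx₀⟩ := h 1 one_ne_zero (1 / 12) (by norm_num) le_rfl 1 one_pos
  obtain ⟨N, hN⟩ := exists_nat_ge (max x₀ 3)
  have hN3 : (3 : ℝ) ≤ N := le_trans (le_max_right _ _) hN
  have hNx : x₀ ≤ N := le_trans (le_max_left _ _) hN
  have hN1 : (1 : ℝ) ≤ N := by linarith
  exact one_row_violates hN3 (hx₀ N hNx 1 le_rfl (Real.one_le_rpow hN1 (by norm_num)))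

/-- The crux with `0 < δ` weakened to `0 ≤ δ`. -/
def TableChowlaWithoutDeltaPos : Prop :=
  ∀ c : ℤ, c ≠ 0 → ∀ δ : ℝ, 0 ≤ δ → δ ≤ 1 / 12 → ∀ C : ℝ, 0 < C → ∃ x₀ : ℝ, ∀ x : ℝ, x₀ ≤ x →
    ∀ A : ℝ, x ^ δ ≤ A → A ≤ x ^ (1 / 3 + δ) → moment lam c x A ≤ x ^ 2 / Real.log x ^ C

/-- `0 < δ` is load-bearing: `δ = 0` admits the one-row table `A = 1 = x⁰`. -/
theorem not_tableChowlaWithoutDeltaPos : ¬ TableChowlaWithoutDeltaPos := by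
  intro h
  obtain ⟨x₀, hx₀⟩ := h 1 one_ne_zero 0 le_rfl (by norm_num) 1 one_pos
  obtain ⟨N, hN⟩ := exists_nat_ge (max x₀ 3)
  have hN3 : (3 : ℝ) ≤ N := le_trans (le_max_right _ _) hN
  have hNx : x₀ ≤ N := le_trans (le_max_left _ _) hN
  have hN1 : (1 : ℝ) ≤ N := by linarith
  refine one_row_violates hN3 (hx₀ N hNx 1 (by rw [Real.rpow_zero]) ?_)
  rw [add_zero]; exact Real.one_le_rpow hN1 (by norm_num)

/-- The crux with the upper window bound `A ≤ x ^ (1/3 + δ)` dropped. -/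
def TableChowlaWithoutUpperWindow : Prop :=
  ∀ c : ℤ, c ≠ 0 → ∀ δ : ℝ, 0 < δ → δ ≤ 1 / 12 → ∀ C : ℝ, 0 < C → ∃ x₀ : ℝ, ∀ x : ℝ, x₀ ≤ x →
    ∀ A : ℝ, x ^ δ ≤ A → moment lam c x A ≤ x ^ 2 / Real.log x ^ C

/-- The upper window bound is load-bearing: the ONE-COLUMN table `A = x` has moment `N²`. -/
theorem not_tableChowlaWithoutUpperWindow : ¬ TableChowlaWithoutUpperWindow := by
  intro h
  obtain ⟨x₀, hx₀⟩ := h 1 one_ne_zero (1 / 12) (by norm_num) le_rfl 1 one_pos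
  obtain ⟨N, hN⟩ := exists_nat_ge (max x₀ 3)
  have hN3 : (3 : ℝ) ≤ N := le_trans (le_max_right _ _) hN
  have hNx : x₀ ≤ N := le_trans (le_max_left _ _) hN
  have hN1 : (1 : ℝ) ≤ N := by linarith
  have hwin : (N : ℝ) ^ ((1 : ℝ) / 12) ≤ N := by
    calc (N : ℝ) ^ ((1 : ℝ) / 12) ≤ (N : ℝ) ^ (1 : ℝ) :=
          Real.rpow_le_rpow_of_exponent_le hN1 (by norm_num)
      _ = N := Real.rpow_one _
  exact one_col_violates lam_sq' hN3 (hx₀ N hNx N hwin)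

/-- The crux at ONE window exponent `δ`, for a general `f` (the constraint `0 < δ ≤ 1/12` removed;
`c ≠ 0` and `∀ C` kept). `TableChowlaFor f ↔ ∀ δ ∈ (0, 1/12], TableChowlaAt f δ`. -/
def TableChowlaAt (f : ℕ → ℝ) (δ : ℝ) : Prop :=
  ∀ c : ℤ, c ≠ 0 → ∀ C : ℝ, 0 < C → ∃ x₀ : ℝ, ∀ x : ℝ, x₀ ≤ x →
    ∀ A : ℝ, x ^ δ ≤ A → A ≤ x ^ (1 / 3 + δ) → moment f c x A ≤ x ^ 2 / Real.log x ^ C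

/-- Quantifier shuffle: `TableChowlaFor f` is the conjunction of the fixed-`δ` statements. -/
theorem tableChowlaFor_iff_forall_at :
    TableChowlaFor f ↔ ∀ δ : ℝ, 0 < δ → δ ≤ 1 / 12 → TableChowlaAt f δ :=
  ⟨fun h δ hδ hδ' c hc C hC => h c hc δ hδ hδ' C hC, fun h c hc δ hδ hδ' C hC => h δ hδ hδ' c hc C hC⟩

/-- The gen-1 crux stmt-Parity-4218 (`ShiftedMultiplicationTable.RectangleChowla`, refuted in
`Theorems/ShiftedMultiplicationTableRectangleChowlaRefutation.lean`): every `δ > 0` allowed. -/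
def TableChowlaWithoutDeltaLe : Prop :=
  ∀ c : ℤ, c ≠ 0 → ∀ δ : ℝ, 0 < δ → ∀ C : ℝ, 0 < C → ∃ x₀ : ℝ, ∀ x : ℝ, x₀ ≤ x →
    ∀ A : ℝ, x ^ δ ≤ A → A ≤ x ^ (1 / 3 + δ) → moment lam c x A ≤ x ^ 2 / Real.log x ^ C

/-- READ-BACK: the gen-1 crux is literally the present crux without `δ ≤ 1/12`. -/
theorem rectangleChowla_iff :
    ShiftedMultiplicationTable.RectangleChowla ↔ TableChowlaWithoutDeltaLe := Iff.rfl

/-- DEGENERATE BAND `δ ∈ [2/3, 1]`: `A = x` is admissible (`x ≤ x^{1/3+δ}` iff `δ ≥ 2/3`,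
`x^δ ≤ x` iff `δ ≤ 1`), the table has ONE column and no cancellation is possible: the fixed-`δ`
statement is FALSE for every `±1`-valued `f`, in particular for `λ`. This is the exact extent of the
gen-1 hole; `δ ≤ 1/12` (indeed any `δ < 2/3`) closes it, since then `B = ⌊x/A⌋ ≥ x^{2/3-δ} → ∞`. -/
theorem not_tableChowlaAt_of_mem_band (hf : ∀ n, n ≠ 0 → f n ^ 2 = 1) {δ : ℝ} (h1 : 2 / 3 ≤ δ)
    (h2 : δ ≤ 1) : ¬ TableChowlaAt f δ := by
  intro h
  obtain ⟨x₀, hx₀⟩ := h 1 one_ne_zero 1 one_pos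
  obtain ⟨N, hN⟩ := exists_nat_ge (max x₀ 3)
  have hN3 : (3 : ℝ) ≤ N := le_trans (le_max_right _ _) hN
  have hNx : x₀ ≤ N := le_trans (le_max_left _ _) hN
  have hN1 : (1 : ℝ) ≤ N := by linarith
  have hwin1 : (N : ℝ) ^ δ ≤ N := by
    calc (N : ℝ) ^ δ ≤ (N : ℝ) ^ (1 : ℝ) := Real.rpow_le_rpow_of_exponent_le hN1 h2
      _ = N := Real.rpow_one _
  have hwin2 : (N : ℝ) ≤ (N : ℝ) ^ (1 / 3 + δ) := by
    calc (N : ℝ) = (N : ℝ) ^ (1 : ℝ) := (Real.rpow_one _).symm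
      _ ≤ (N : ℝ) ^ (1 / 3 + δ) := Real.rpow_le_rpow_of_exponent_le hN1 (by linarith)
  exact one_col_violates hf hN3 (hx₀ N hNx N hwin1 hwin2)

/-- JUNK BAND `δ > 1`: the window forces `A ≥ x^δ > x`, so there are NO columns and the fixed-`δ`
statement holds vacuously for every `f` (a reminder that only `δ < 2/3` carries content). -/
theorem tableChowlaAt_of_one_lt (f : ℕ → ℝ) {δ : ℝ} (hδ : 1 < δ) : TableChowlaAt f δ := by
  intro c _ C _
  refine ⟨2, fun x hx A hA _ => ?_⟩
  have hx1 : (1 : ℝ) < x := by linarith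
  have hxA : x < A := by
    calc x = x ^ (1 : ℝ) := (Real.rpow_one x).symm
      _ < x ^ δ := Real.rpow_lt_rpow_of_exponent_lt hx1 hδ
      _ ≤ A := hA
  have hfloor : ⌊x / A⌋₊ = 0 := by
    rw [Nat.floor_eq_zero, div_lt_one (by linarith)]
    exact hxA
  unfold moment
  rw [hfloor, momentN_zero_cols]
  have hlog : 0 < Real.log x := Real.log_pos hx1
  positivity

/-- `δ ≤ 1/12` is load-bearing (this is the gen-1 refutation, re-derived from the band theorem). -/
theorem not_tableChowlaWithoutDeltaLe : ¬ TableChowlaWithoutDeltaLe := fun h =>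
  not_tableChowlaAt_of_mem_band lam_sq' (δ := 1) (by norm_num) le_rfl
    fun c hc C hC => h c hc 1 one_pos C hC

/-- Hence a second, independent proof of the negative already in the tree. -/
theorem rectangleChowla_refuted' : ¬ ShiftedMultiplicationTable.RectangleChowla :=
  fun h => not_tableChowlaWithoutDeltaLe (rectangleChowla_iff.mp h)

/-- The crux with `0 < C` dropped (all real `C`). -/
def TableChowlaWithoutCPos : Prop :=
  ∀ c : ℤ, c ≠ 0 → ∀ δ : ℝ, 0 < δ → δ ≤ 1 / 12 → ∀ C : ℝ, ∃ x₀ : ℝ, ∀ x : ℝ, x₀ ≤ x →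
    ∀ A : ℝ, x ^ δ ≤ A → A ≤ x ^ (1 / 3 + δ) → moment lam c x A ≤ x ^ 2 / Real.log x ^ C

/-- `0 < C` is NOT load-bearing: the cases `C ≤ 0` follow from `C = 1` beyond `x ≥ e`
(`x²/log x ≤ x² ≤ x²/(log x)^C`). Provers may ignore the sign of `C`. -/
theorem tableChowlaWithoutCPos_of (h : LiouvilleShiftedTables.TableChowla) :
    TableChowlaWithoutCPos := by
  have h' := tableChowla_iff.mp h
  intro c hc δ hδ hδ' C
  rcases lt_or_ge 0 C with hC | hC
  · exact h' c hc δ hδ hδ' C hC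
  obtain ⟨x₀, hx₀⟩ := h' c hc δ hδ hδ' 1 one_pos
  refine ⟨max x₀ (Real.exp 1), fun x hx A hA hA' => ?_⟩
  have hx₀x : x₀ ≤ x := le_trans (le_max_left _ _) hx
  have hxe : Real.exp 1 ≤ x := le_trans (le_max_right _ _) hx
  have hxpos : 0 < x := (Real.exp_pos 1).trans_le hxe
  have hlog1 : 1 ≤ Real.log x := by rw [Real.le_log_iff_exp_le hxpos]; exact hxe
  have key := hx₀ x hx₀x A hA hA'
  rw [Real.rpow_one] at key
  calc moment lam c x A ≤ x ^ 2 / Real.log x := key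
    _ ≤ x ^ 2 := div_le_self (by positivity) hlog1
    _ ≤ x ^ 2 / Real.log x ^ C := by
        rw [le_div_iff₀ (Real.rpow_pos_of_pos (by linarith) C)]
        exact mul_le_of_le_one_right (by positivity)
          (Real.rpow_le_one_of_one_le_of_nonpos hlog1 hC)


/-! ## (b) TIGHTNESS — what no proof can beat -/

/-- DIAGONAL FLOOR: for a `±1`-valued `f`, once every argument `ab + c` is positive the moment is at
least `rows · B² = (A₂ - A₁) · B²` (`≍ x²/A ≥ x^{5/3-δ}` in the crux): the whole `(log x)^{-C}`
saving must come from the off-diagonal pairs `a ≠ a'`, and no bound `o(x²/A)` is possible. -/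
theorem rows_mul_cols_sq_le_momentN (hf : ∀ n, n ≠ 0 → f n ^ 2 = 1)
    (hpos : ∀ a ∈ Ioc A₁ A₂, ∀ b ∈ Icc 1 B, 1 ≤ (a : ℤ) * b + c) :
    ((A₂ - A₁ : ℕ) : ℝ) * (B : ℝ) ^ 2 ≤ momentN f c A₁ A₂ B := by
  calc ((A₂ - A₁ : ℕ) : ℝ) * (B : ℝ) ^ 2 = ∑ _a ∈ Ioc A₁ A₂, (B : ℝ) ^ 2 := by simp [Nat.card_Ioc]
    _ = ∑ a ∈ Ioc A₁ A₂, rowCorr f c B a a ^ 2 :=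
        sum_congr rfl fun a ha => by rw [rowCorr_self_eq hf (hpos a ha)]
    _ ≤ momentN f c A₁ A₂ B := diag_le_momentN

/-- COLUMN FLOOR (dual, via `momentN_eq_colMoment`): for a `±1`-valued `f` the moment is also at
least `B · rows²` (`≍ x·A`, the random-model size of the off-diagonal part): even a perfectly
"random" table cannot do better than `x·A`. -/
theorem cols_mul_rows_sq_le_momentN (hf : ∀ n, n ≠ 0 → f n ^ 2 = 1)
    (hpos : ∀ a ∈ Ioc A₁ A₂, ∀ b ∈ Icc 1 B, 1 ≤ (a : ℤ) * b + c) :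
    (B : ℝ) * ((A₂ - A₁ : ℕ) : ℝ) ^ 2 ≤ momentN f c A₁ A₂ B := by
  rw [momentN_eq_colMoment]
  have hcol : ∀ b ∈ Icc 1 B,
      (∑ a ∈ Ioc A₁ A₂, f (Int.toNat ((a : ℤ) * b + c)) * f (Int.toNat ((a : ℤ) * b + c))) =
        ((A₂ - A₁ : ℕ) : ℝ) := by
    intro b hb
    calc (∑ a ∈ Ioc A₁ A₂, f (Int.toNat ((a : ℤ) * b + c)) * f (Int.toNat ((a : ℤ) * b + c)))
          = ∑ _a ∈ Ioc A₁ A₂, (1 : ℝ) := by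
            refine sum_congr rfl fun a ha => ?_
            rw [← sq]
            apply hf
            intro h0
            rw [Int.toNat_eq_zero] at h0
            linarith [hpos a ha b hb]
      _ = ((A₂ - A₁ : ℕ) : ℝ) := by simp [Nat.card_Ioc]
  set G : ℕ → ℕ → ℝ := fun b b' =>
    ∑ a ∈ Ioc A₁ A₂, f (Int.toNat ((a : ℤ) * b + c)) * f (Int.toNat ((a : ℤ) * b' + c)) with hG
  show (B : ℝ) * ((A₂ - A₁ : ℕ) : ℝ) ^ 2 ≤ ∑ b ∈ Icc 1 B, ∑ b' ∈ Icc 1 B, G b b' ^ 2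
  calc (B : ℝ) * ((A₂ - A₁ : ℕ) : ℝ) ^ 2 = ∑ _b ∈ Icc 1 B, ((A₂ - A₁ : ℕ) : ℝ) ^ 2 := by simp
    _ = ∑ b ∈ Icc 1 B, G b b ^ 2 := sum_congr rfl fun b hb => by rw [hG]; dsimp only; rw [hcol b hb]
    _ ≤ ∑ b ∈ Icc 1 B, ∑ b' ∈ Icc 1 B, G b b' ^ 2 := by
        refine sum_le_sum fun b hb => ?_
        exact single_le_sum (f := fun b' => G b b' ^ 2) (fun _ _ => sq_nonneg _) hb

/-- In the standard specialisation with `c = 1`: the λ-moment at `x = m^k`, `A = m` is at least the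
diagonal `m · m^{2(k-1)}`. -/
theorem diag_le_moment_pow {k m : ℕ} (hk : 1 ≤ k) (hm : m ≠ 0) :
    (m : ℝ) * ((m : ℝ) ^ (k - 1)) ^ 2 ≤ moment lam 1 ((m : ℝ) ^ k) m := by
  rw [moment_pow lam 1 hk hm]
  have h := rows_mul_cols_sq_le_momentN (f := lam) (c := 1) (A₁ := m) (A₂ := 2 * m) (B := m ^ (k - 1))
    lam_sq' (fun a _ b _ => by nlinarith [Nat.cast_nonneg (α := ℤ) a, Nat.cast_nonneg (α := ℤ) b])
  rw [show 2 * m - m = m by omega] at h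
  exact_mod_cast h

/-! ## (c) NATURAL STRENGTHENINGS that are FALSE -/

/-- STRENGTHENING 1 — a power saving `x^{2-η}` with `η` uniform in `δ`. -/
def TableChowlaUniformPowerSaving : Prop :=
  ∃ η : ℝ, 0 < η ∧ ∀ c : ℤ, c ≠ 0 → ∀ δ : ℝ, 0 < δ → δ ≤ 1 / 12 → ∃ x₀ : ℝ, ∀ x : ℝ, x₀ ≤ x →
    ∀ A : ℝ, x ^ δ ≤ A → A ≤ x ^ (1 / 3 + δ) → moment lam c x A ≤ x ^ (2 - η)

/-- FALSE: the diagonal `≍ x^{2-δ}` beats `x^{2-η}` as soon as `δ < η` (witness `δ = 1/k`,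
`k > max(12, 1/η)`, `x = m^k`, `A = m`). Any power saving must degrade with the window, `η ≤ δ`;
the crux's `(log x)^{-C}` form is the uniform-in-`δ` shape that survives this. -/
theorem not_tableChowlaUniformPowerSaving : ¬ TableChowlaUniformPowerSaving := by
  rintro ⟨η, hη, h⟩
  obtain ⟨k, hk⟩ := exists_nat_gt (max 12 (1 / η))
  have hk12 : (12 : ℝ) < k := lt_of_le_of_lt (le_max_left _ _) hk
  have hkη : 1 / η < k := lt_of_le_of_lt (le_max_right _ _) hk
  have hkpos : (0 : ℝ) < k := by linarith
  have hk1 : 1 ≤ k := by exact_mod_cast (show (1 : ℝ) ≤ k by linarith)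
  have hkη' : 1 < (k : ℝ) * η := by
    have := (div_lt_iff₀ hη).mp hkη; linarith
  obtain ⟨x₀, hx₀⟩ := h 1 one_ne_zero (1 / k) (by positivity)
    (by rw [div_le_div_iff_of_pos_left one_pos hkpos (by norm_num)]; exact hk12.le)
  obtain ⟨m, hm⟩ := exists_nat_ge (max x₀ 2)
  have hm2 : (2 : ℝ) ≤ m := le_trans (le_max_right _ _) hm
  have hmx : x₀ ≤ m := le_trans (le_max_left _ _) hm
  have hm1 : (1 : ℝ) ≤ m := by linarith
  have hm1' : 1 ≤ m := by exact_mod_cast hm1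
  have hm0 : m ≠ 0 := by omega
  have hmpos : (0 : ℝ) < m := by linarith
  have hxx₀ : x₀ ≤ (m : ℝ) ^ k := hmx.trans (le_self_pow₀ hm1 (by omega))
  obtain ⟨hw1, hw2⟩ := window_pow (k := k) (by omega) hm1'
  have key := hx₀ ((m : ℝ) ^ k) hxx₀ m hw1 hw2
  have hdiag := diag_le_moment_pow hk1 hm0
  -- x^(2-η) = x² / x^η and x^η = m^(kη) > m
  have hxpos : (0 : ℝ) < (m : ℝ) ^ k := by positivity
  have hsplit : ((m : ℝ) ^ k) ^ (2 - η) = ((m : ℝ) ^ k) ^ 2 / ((m : ℝ) ^ k) ^ η := by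
    rw [Real.rpow_sub hxpos, Real.rpow_two]
  have hη_big : (m : ℝ) < ((m : ℝ) ^ k) ^ η := by
    rw [← Real.rpow_natCast_mul hmpos.le]
    calc (m : ℝ) = (m : ℝ) ^ (1 : ℝ) := (Real.rpow_one _).symm
      _ < (m : ℝ) ^ ((k : ℝ) * η) := Real.rpow_lt_rpow_of_exponent_lt (by linarith) hkη'
  have hpk : ((m : ℝ) ^ k) ^ 2 = (m : ℝ) * ((m : ℝ) ^ (k - 1)) ^ 2 * m := by
    have : (m : ℝ) ^ k = (m : ℝ) ^ (k - 1) * m := by rw [← pow_succ, Nat.sub_add_cancel hk1]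
    rw [this]; ring
  -- chain: diag ≤ T ≤ x²/x^η < x²/m = diag
  have hlt : ((m : ℝ) ^ k) ^ 2 / ((m : ℝ) ^ k) ^ η < (m : ℝ) * ((m : ℝ) ^ (k - 1)) ^ 2 := by
    rw [div_lt_iff₀ (by positivity), hpk]
    exact mul_lt_mul_of_pos_left hη_big (by positivity)
  linarith [hsplit ▸ key]

/-- STRENGTHENING 2 — one threshold `x₀` serving every log-power `C` (`∃ x₀ ∀ C`, i.e. a
super-polylogarithmic saving). -/
def TableChowlaThresholdUniformInC : Prop :=
  ∀ c : ℤ, c ≠ 0 → ∀ δ : ℝ, 0 < δ → δ ≤ 1 / 12 → ∃ x₀ : ℝ, ∀ C : ℝ, 0 < C → ∀ x : ℝ, x₀ ≤ x →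
    ∀ A : ℝ, x ^ δ ≤ A → A ≤ x ^ (1 / 3 + δ) → moment lam c x A ≤ x ^ 2 / Real.log x ^ C

/-- FALSE: at fixed `x` the right side `x²/(log x)^C → 0` as `C → ∞` while the diagonal is `≥ x²/A`;
(witness `x = m¹²`, `A = m`, `C = m`: `(12 log m)^m ≥ 2^m > m`). The quantifier order `∀ C ∃ x₀` of
the crux is essential — the saving is NOT claimed beyond every fixed log-power. -/
theorem not_tableChowlaThresholdUniformInC : ¬ TableChowlaThresholdUniformInC := by
  intro h
  obtain ⟨x₀, hx₀⟩ := h 1 one_ne_zero (1 / 12) (by norm_num) le_rfl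
  obtain ⟨m, hm⟩ := exists_nat_ge (max x₀ 2)
  have hm2 : (2 : ℝ) ≤ m := le_trans (le_max_right _ _) hm
  have hmx : x₀ ≤ m := le_trans (le_max_left _ _) hm
  have hm1 : (1 : ℝ) ≤ m := by linarith
  have hm1' : 1 ≤ m := by exact_mod_cast hm1
  have hm0 : m ≠ 0 := by omega
  have hmpos : (0 : ℝ) < m := by linarith
  have hxx₀ : x₀ ≤ (m : ℝ) ^ 12 := hmx.trans (le_self_pow₀ hm1 (by norm_num))
  obtain ⟨hw1, hw2⟩ := window_pow (k := 12) (by norm_num) hm1'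
  have key := hx₀ m hmpos ((m : ℝ) ^ 12) hxx₀ m (by exact_mod_cast hw1) (by exact_mod_cast hw2)
  have hdiag := diag_le_moment_pow (k := 12) (by norm_num) hm0
  rw [Real.log_pow, Nat.cast_ofNat, Real.rpow_natCast] at key
  -- (12 log m)^m ≥ 2^m > m
  have hlog2 : (2 : ℝ) ≤ 12 * Real.log m := by
    have := Real.log_le_log (by norm_num) hm2
    have := log_two_gt_half
    linarith
  have hbig : (m : ℝ) < (12 * Real.log m) ^ m := by
    calc (m : ℝ) < (2 : ℝ) ^ m := by exact_mod_cast Nat.lt_two_pow_self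
      _ ≤ (12 * Real.log m) ^ m := pow_le_pow_left₀ (by norm_num) hlog2 m
  have hpk : ((m : ℝ) ^ 12) ^ 2 = (m : ℝ) * ((m : ℝ) ^ (12 - 1)) ^ 2 * m := by ring
  have hlt : ((m : ℝ) ^ 12) ^ 2 / (12 * Real.log m) ^ m < (m : ℝ) * ((m : ℝ) ^ (12 - 1)) ^ 2 := by
    rw [div_lt_iff₀ (by positivity), hpk]
    exact mul_lt_mul_of_pos_left hbig (by positivity)
  exact absurd (lt_of_le_of_lt (hdiag.trans key) hlt) (lt_irrefl _)


/-- STRENGTHENING 3 — a POLYLOGARITHMIC lower window `(log x)^K ≤ A ≤ x^{1/3}`. -/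
def TableChowlaPolylogWindow (K : ℕ) : Prop :=
  ∀ c : ℤ, c ≠ 0 → ∀ C : ℝ, 0 < C → ∃ x₀ : ℝ, ∀ x : ℝ, x₀ ≤ x →
    ∀ A : ℝ, Real.log x ^ K ≤ A → A ≤ x ^ ((1 : ℝ) / 3) → moment lam c x A ≤ x ^ 2 / Real.log x ^ C

/-- FALSE for every `K` (witness `x = e^m`, `A = m^K`, `C = K + 1`: the diagonal `≍ x²/A = x²/(log x)^K`
beats `x²/(log x)^{K+1}`). Under the `∀ C` form the lower end of the window must be
super-polylogarithmic in `x`: the power window `x^δ` is forced up to that, and any split of the crux by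
ranges of `A` must keep `A ≥ exp((log x)^{θ})`-type lower ends, never `(log x)^K`. -/
theorem not_tableChowlaPolylogWindow (K : ℕ) : ¬ TableChowlaPolylogWindow K := by
  intro h
  obtain ⟨x₀, hx₀⟩ := h 1 one_ne_zero (K + 1) (by positivity)
  obtain ⟨m, hm⟩ := exists_nat_ge (max x₀ ((3 : ℝ) ^ (K + 1) * (K + 1).factorial + 5))
  have hmx : x₀ ≤ m := le_trans (le_max_left _ _) hm
  have hmF : (3 : ℝ) ^ (K + 1) * (K + 1).factorial + 5 ≤ m := le_trans (le_max_right _ _) hm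
  have hfac1 : (1 : ℝ) ≤ (K + 1).factorial := by exact_mod_cast Nat.one_le_iff_ne_zero.mpr (Nat.factorial_ne_zero _)
  have h3K : (3 : ℝ) ≤ (3 : ℝ) ^ (K + 1) := by
    calc (3 : ℝ) = 3 ^ 1 := by norm_num
      _ ≤ 3 ^ (K + 1) := pow_le_pow_right₀ (by norm_num) (by omega)
  have hm5 : (5 : ℝ) ≤ m := by nlinarith
  have hmpos : (0 : ℝ) < m := by linarith
  -- the two growth facts, from `x^n/n! ≤ e^x`
  have hF1 : (m : ℝ) ^ K ≤ Real.exp (m / 3) := by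
    have P := Real.pow_div_factorial_le_exp ((m : ℝ) / 3) (by positivity) (K + 1)
    rw [div_le_iff₀ (by positivity), div_pow] at P
    -- P : m^(K+1) / 3^(K+1) ≤ exp (m/3) * (K+1)!
    rw [div_le_iff₀ (by positivity)] at P
    have hstep : (3 : ℝ) ^ (K + 1) * (K + 1).factorial * (m : ℝ) ^ K ≤ (m : ℝ) ^ (K + 1) := by
      rw [show (m : ℝ) ^ (K + 1) = (m : ℝ) ^ K * m from pow_succ _ _]
      have : (3 : ℝ) ^ (K + 1) * (K + 1).factorial ≤ m := by linarith
      nlinarith [mul_le_mul_of_nonneg_left this (pow_nonneg hmpos.le K)]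
    have hpos3 : (0 : ℝ) < (3 : ℝ) ^ (K + 1) * (K + 1).factorial := by positivity
    nlinarith [Real.exp_pos ((m : ℝ) / 3)]
  have hF2 : 2 * (m : ℝ) ^ K ≤ Real.exp m := by
    have P := Real.pow_div_factorial_le_exp (m : ℝ) hmpos.le (K + 1)
    rw [div_le_iff₀ (by positivity)] at P
    have hstep : 2 * (K + 1).factorial * (m : ℝ) ^ K ≤ (m : ℝ) ^ (K + 1) := by
      rw [show (m : ℝ) ^ (K + 1) = (m : ℝ) ^ K * m from pow_succ _ _]
      have : 2 * ((K + 1).factorial : ℝ) ≤ m := by nlinarith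
      nlinarith [mul_le_mul_of_nonneg_left this (pow_nonneg hmpos.le K)]
    nlinarith [Real.exp_pos (m : ℝ)]
  -- the specialisation x = e^m, A = M := m^K
  set x : ℝ := Real.exp m with hxdef
  have hxpos : 0 < x := Real.exp_pos _
  have hlogx : Real.log x = m := Real.log_exp _
  have hxx₀ : x₀ ≤ x := hmx.trans ((by linarith : (m : ℝ) ≤ m + 1).trans (Real.add_one_le_exp _))
  set M : ℕ := m ^ K with hMdef
  have hMreal : (M : ℝ) = (m : ℝ) ^ K := by rw [hMdef]; push_cast; rfl
  have hMpos : (0 : ℝ) < M := by rw [hMreal]; positivity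
  have hM0 : M ≠ 0 := by exact_mod_cast hMpos.ne'
  have hw1 : Real.log x ^ K ≤ (M : ℝ) := by rw [hlogx, hMreal]
  have hw2 : (M : ℝ) ≤ x ^ ((1 : ℝ) / 3) := by
    rw [hMreal, hxdef, ← Real.exp_mul, show (m : ℝ) * (1 / 3) = m / 3 by ring]
    exact hF1
  have key := hx₀ x hxx₀ M hw1 hw2
  rw [hlogx, show ((K : ℝ) + 1) = ((K + 1 : ℕ) : ℝ) by push_cast; ring, Real.rpow_natCast] at key
  -- the moment at (x, M): rows (M, 2M], B = ⌊x/M⌋ columns; diagonal floor M · B²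
  have hmom : moment lam 1 x M = momentN lam 1 M (2 * M) ⌊x / M⌋₊ := by
    unfold moment; rw [Nat.floor_natCast, floor_two_mul_natCast]
  have hdiag := rows_mul_cols_sq_le_momentN (f := lam) (c := 1) (A₁ := M) (A₂ := 2 * M) (B := ⌊x / M⌋₊)
    lam_sq' (fun a _ b _ => by nlinarith [Nat.cast_nonneg (α := ℤ) a, Nat.cast_nonneg (α := ℤ) b])
  rw [show 2 * M - M = M by omega, ← hmom] at hdiag
  -- B ≥ x/(2M)
  set Bn : ℕ := ⌊x / M⌋₊ with hBdef
  have hB1 : x / M - 1 < Bn := by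
    have := Nat.lt_floor_add_one (x / (M : ℝ))
    rw [hBdef]; linarith
  have hxM : 2 ≤ x / M := by
    rw [le_div_iff₀ hMpos, hMreal]; exact hF2
  have hB2 : x / (2 * M) ≤ Bn := by
    have : x / (2 * M) = x / M - x / M / 2 := by field_simp; ring
    rw [this]; linarith
  have hBpos : (0 : ℝ) < Bn := lt_of_lt_of_le (by positivity) hB2
  -- diag ≥ x²/(4M) > x²/(m M) = RHS
  have hlow : x ^ 2 / (4 * M) ≤ (M : ℝ) * (Bn : ℝ) ^ 2 := by
    have h1 : x ^ 2 / (4 * M) = M * (x / (2 * M)) ^ 2 := by field_simp; ring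
    rw [h1]
    exact mul_le_mul_of_nonneg_left (pow_le_pow_left₀ (by positivity) hB2 2) hMpos.le
  have hhigh : x ^ 2 / (m : ℝ) ^ (K + 1) < x ^ 2 / (4 * M) := by
    apply div_lt_div_of_pos_left (by positivity) (by positivity)
    rw [pow_succ, ← hMreal]
    nlinarith
  linarith

/-! ## (c′) PRETENDERS — `λ`-like functions for which the crux FAILS

A proof of the crux must use more about `λ` than `|λ| ≤ 1` and complete multiplicativity: it must
use, quantitatively and for every small modulus dividing the shift, that `λ` does not pretend to be
a real Dirichlet character (the Landau–Siegel ghost of the route text, made exact below). -/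

/-- GHOST `f ≡ 1` (the multiplicative part of Selberg's `1 + λ`): rank one at every shift. -/
theorem not_tableChowlaFor_one : ¬ TableChowlaFor (fun _ => 1) := by
  intro h
  obtain ⟨x₀, hx₀⟩ := h 1 one_ne_zero (1 / 12) (by norm_num) le_rfl 1 one_pos
  obtain ⟨m, hm⟩ := exists_nat_ge (max x₀ 2)
  have hm2 : (2 : ℝ) ≤ m := le_trans (le_max_right _ _) hm
  have hmx : x₀ ≤ m := le_trans (le_max_left _ _) hm
  have hm1 : (1 : ℝ) ≤ m := by linarith
  have hm1' : 1 ≤ m := by exact_mod_cast hm1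
  have hm0 : m ≠ 0 := by omega
  have hxx₀ : x₀ ≤ (m : ℝ) ^ 12 := hmx.trans (le_self_pow₀ hm1 (by norm_num))
  obtain ⟨hw1, hw2⟩ := window_pow (k := 12) (by norm_num) hm1'
  have key := hx₀ ((m : ℝ) ^ 12) hxx₀ m (by exact_mod_cast hw1) (by exact_mod_cast hw2)
  rw [moment_pow _ 1 (by norm_num) hm0,
    momentN_of_rankOne (f := fun _ => (1 : ℝ)) (c := 1) (fun _ => 1) (fun _ => 1) (fun _ _ _ _ => by simp),
    Real.rpow_one, Real.log_pow] at key
  simp only [one_pow, sum_const, Nat.card_Ioc, Nat.card_Icc, nsmul_eq_mul, mul_one,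
    Nat.add_sub_cancel] at key
  rw [show 2 * m - m = m by omega, show (12 - 1 : ℕ) = 11 by norm_num] at key
  push_cast at key
  have hP : (0 : ℝ) < (m : ℝ) ^ 2 * ((m : ℝ) ^ 11) ^ 2 := by positivity
  refine absurd_of_le_div hP (κ := 1) ?_ zero_le_one ?_ key
  · exact le_of_eq (by ring)
  have := Real.log_le_log (by norm_num) hm2
  have := log_two_gt_half
  linarith

/-- The non-principal Dirichlet character mod 4 (extended by 0), as a real function. -/
def chi4 (n : ℕ) : ℝ := if n % 4 = 1 then 1 else if n % 4 = 3 then -1 else 0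

/-- `χ₄² = 𝟙_odd`. -/
theorem chi4_sq (n : ℕ) : chi4 n ^ 2 = if n % 2 = 1 then 1 else 0 := by
  have h4 : n % 4 < 4 := Nat.mod_lt n (by norm_num)
  have h2 : n % 2 = n % 4 % 2 := by omega
  unfold chi4
  rw [h2]
  interval_cases (n % 4) <;> norm_num

/-- `χ₄(ab + 4) = χ₄(a) χ₄(b)`: at the shift `c = 4` the χ₄-table is RANK ONE. -/
theorem chi4_mul_add_four (a b : ℕ) : chi4 (a * b + 4) = chi4 a * chi4 b := by
  have ha : a % 4 < 4 := Nat.mod_lt a (by norm_num)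
  have hb : b % 4 < 4 := Nat.mod_lt b (by norm_num)
  have hab : (a * b + 4) % 4 = (a % 4) * (b % 4) % 4 := by
    rw [Nat.add_mod_right, Nat.mul_mod]
  unfold chi4
  rw [hab]
  interval_cases (a % 4) <;> interval_cases (b % 4) <;> norm_num

/-- `[1, 2n]` contains `n` odd numbers. -/
theorem sum_chi4_sq_Icc_even (n : ℕ) : ∑ b ∈ Icc 1 (2 * n), chi4 b ^ 2 = n := by
  induction n with
  | zero => simp
  | succ n ih =>
    rw [show 2 * (n + 1) = 2 * n + 1 + 1 by ring, Finset.sum_Icc_succ_top (by omega),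
      Finset.sum_Icc_succ_top (by omega), ih, chi4_sq, chi4_sq]
    have h1 : (2 * n + 1) % 2 = 1 := by omega
    have h2 : (2 * n + 1 + 1) % 2 = 0 := by omega
    simp [h1, h2]

/-- `(2n, 4n]` contains `n` odd numbers. -/
theorem sum_chi4_sq_rows (n : ℕ) : ∑ a ∈ Ioc (2 * n) (4 * n), chi4 a ^ 2 = n := by
  have h1 := sum_chi4_sq_Icc_even n
  have h2 := sum_chi4_sq_Icc_even (2 * n)
  rw [show 2 * (2 * n) = 4 * n by ring] at h2
  have hI : ∀ N : ℕ, (Icc 1 N : Finset ℕ) = Ioc 0 N := fun N => by ext k; simp; omega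
  rw [hI] at h1 h2
  have hsplit := Finset.sum_Ioc_consecutive (fun a => chi4 a ^ 2) (Nat.zero_le (2 * n))
    (by omega : 2 * n ≤ 4 * n)
  rw [h1, h2] at hsplit
  push_cast at hsplit
  linarith

/-- PRETENDER `χ₄`: completely multiplicative, `±1` on odd integers, MEAN ZERO and perfectly
distributed in every progression of odd modulus — yet `TableChowlaFor χ₄` is FALSE: at the shift
`c = 4` its table is rank one (`chi4_mul_add_four`), and at `x = (2n)¹²`, `A = 2n` the moment is
`n² · (B/2)² = x²/16` against the claimed `x²/(12 log 2n)`. (For shifts `4 ∤ c` the χ₄-table is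
4-periodic in `a` and in `b`, hence of rank ≤ 4 with `‖M‖_F² ≍ AB`, so `T ≥ ‖M‖_F⁴/4 ≫ x²` still —
not formalised.) Moral for provers: the decisive input is `λ`'s non-pretentiousness to real
characters of conductor dividing the shift, uniformly in the Siegel range — exactly where
`DilatedTableChowla`'s ℓ¹-average over dilations is designed to pay only `x² log x / q₁`. -/
theorem not_tableChowlaFor_chi4 : ¬ TableChowlaFor chi4 := by
  intro h
  obtain ⟨x₀, hx₀⟩ := h 4 (by norm_num) (1 / 12) (by norm_num) le_rfl 1 one_pos
  obtain ⟨n, hn⟩ := exists_nat_ge (max x₀ 2)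
  have hn2 : (2 : ℝ) ≤ n := le_trans (le_max_right _ _) hn
  have hnx : x₀ ≤ n := le_trans (le_max_left _ _) hn
  have hm4 : (4 : ℝ) ≤ ((2 * n : ℕ) : ℝ) := by push_cast; linarith
  have hm1 : (1 : ℝ) ≤ ((2 * n : ℕ) : ℝ) := by linarith
  have hm1' : 1 ≤ 2 * n := by exact_mod_cast hm1
  have hm0 : 2 * n ≠ 0 := by omega
  have hmpos : (0 : ℝ) < ((2 * n : ℕ) : ℝ) := by linarith
  have hxx₀ : x₀ ≤ (((2 * n : ℕ) : ℝ)) ^ 12 :=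
    (hnx.trans (by push_cast; linarith)).trans (le_self_pow₀ hm1 (by norm_num))
  obtain ⟨hw1, hw2⟩ := window_pow (k := 12) (by norm_num) hm1'
  have key := hx₀ ((((2 * n : ℕ) : ℝ)) ^ 12) hxx₀ (2 * n : ℕ) (by exact_mod_cast hw1)
    (by exact_mod_cast hw2)
  rw [moment_pow chi4 4 (by norm_num) hm0, momentN_of_rankOne (f := chi4) (c := 4) chi4 chi4 ?_,
    Real.rpow_one, Real.log_pow] at key
  swap
  · intro a _ b _
    rw [show ((a : ℤ) * (b : ℕ) + 4) = ((a * b + 4 : ℕ) : ℤ) by push_cast; ring, Int.toNat_natCast,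
      chi4_mul_add_four]
  have hrows : ∑ a ∈ Ioc (2 * n) (2 * (2 * n)), chi4 a ^ 2 = n := by
    rw [show 2 * (2 * n) = 4 * n by ring]; exact sum_chi4_sq_rows n
  have hcols : ∑ b ∈ Icc 1 ((2 * n) ^ (12 - 1)), chi4 b ^ 2 = ((2 ^ 10 * n ^ 11 : ℕ) : ℝ) := by
    rw [show (2 * n) ^ (12 - 1) = 2 * (2 ^ 10 * n ^ 11) by ring]; exact sum_chi4_sq_Icc_even _
  rw [hrows, hcols] at key
  push_cast at key
  -- key : n² ² · (2¹⁰ n¹¹)² ≤ ((2n)¹²)² / (12 log (2n)) ; note ((2n)¹²)² = 16 · LHS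
  have hP : (0 : ℝ) < (n : ℝ) ^ 2 * ((1024 : ℝ) * (n : ℝ) ^ 11) ^ 2 := by
    have : (0 : ℝ) < n := by linarith
    positivity
  refine absurd_of_le_div hP (κ := 16) ?_ (by norm_num) ?_ key
  · exact le_of_eq (by ring)
  have hlog4 : Real.log 4 ≤ Real.log ((2 * n : ℕ) : ℝ) := Real.log_le_log (by norm_num) hm4
  have : Real.log 4 = 2 * Real.log 2 := by
    rw [show (4 : ℝ) = 2 ^ 2 by norm_num, Real.log_pow]; push_cast; ring
  have := Real.log_two_gt_d9
  push_cast at hlog4 ⊢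
  linarith


/-! ## (d) WHY IT RESISTS — the crux follows from a standard (believed, open) conjecture

`UniformBinaryChowla ⟹ TableChowla`: a disproof of the crux would DISPROVE uniform binary
Chowla–Elliott for two non-proportional linear forms. The deduction is elementary: trivial bound on
the `rows ≍ A` diagonal pairs (`≤ rows·B² ≍ x²/A ≤ x^{2-δ}`), the hypothesis on the `≍ A²`
off-diagonal pairs. So the crux sits strictly between the printed averaged-Chowla theorems
(Matomäki–Radziwiłł–Tao: `o(1)` savings, averages over ALL shifts) and this conjecture. -/

/-- Trivial bound `|S_f(a,a')| ≤ B` for `|f| ≤ 1`. -/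
theorem abs_rowCorr_le (hf : ∀ n, |f n| ≤ 1) (a a' : ℕ) : |rowCorr f c B a a'| ≤ B := by
  unfold rowCorr
  calc |∑ b ∈ Icc 1 B, f (Int.toNat ((a : ℤ) * b + c)) * f (Int.toNat ((a' : ℤ) * b + c))|
        ≤ ∑ b ∈ Icc 1 B, |f (Int.toNat ((a : ℤ) * b + c)) * f (Int.toNat ((a' : ℤ) * b + c))| :=
          abs_sum_le_sum_abs _ _
    _ ≤ ∑ _b ∈ Icc 1 B, (1 : ℝ) := by
          refine sum_le_sum fun b _ => ?_
          rw [abs_mul]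
          exact mul_le_one₀ (hf _) (abs_nonneg _) (hf _)
    _ = B := by simp

/-- COMBINATORIAL CORE of the reduction: if `|f| ≤ 1` and every OFF-diagonal row correlation is at
most `ε B`, then `T ≤ rows · B² + rows² · (ε B)²`. -/
theorem momentN_le_of_offDiag (hf : ∀ n, |f n| ≤ 1) {ε : ℝ}
    (hoff : ∀ a ∈ Ioc A₁ A₂, ∀ a' ∈ Ioc A₁ A₂, a ≠ a' → |rowCorr f c B a a'| ≤ ε * B) :
    momentN f c A₁ A₂ B ≤
      (Ioc A₁ A₂).card * (B : ℝ) ^ 2 + ((Ioc A₁ A₂).card : ℝ) ^ 2 * (ε * B) ^ 2 := by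
  unfold momentN
  have hrow : ∀ a ∈ Ioc A₁ A₂, ∑ a' ∈ Ioc A₁ A₂, rowCorr f c B a a' ^ 2 ≤
      (B : ℝ) ^ 2 + (Ioc A₁ A₂).card * (ε * B) ^ 2 := by
    intro a ha
    rw [← Finset.add_sum_erase _ _ ha]
    have hdiag : rowCorr f c B a a ^ 2 ≤ (B : ℝ) ^ 2 := by
      have hb := abs_rowCorr_le (c := c) (B := B) hf a a
      exact sq_le_sq' (by linarith [(abs_le.mp hb).1]) (abs_le.mp hb).2
    have hoffsum : ∑ a' ∈ (Ioc A₁ A₂).erase a, rowCorr f c B a a' ^ 2 ≤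
        (Ioc A₁ A₂).card * (ε * B) ^ 2 := by
      calc ∑ a' ∈ (Ioc A₁ A₂).erase a, rowCorr f c B a a' ^ 2
            ≤ ∑ _a' ∈ (Ioc A₁ A₂).erase a, (ε * B) ^ 2 := by
              refine sum_le_sum fun a' ha' => ?_
              have hne : a ≠ a' := (Finset.ne_of_mem_erase ha').symm
              have hmem : a' ∈ Ioc A₁ A₂ := Finset.mem_of_mem_erase ha'
              have hb := hoff a ha a' hmem hne
              exact sq_le_sq' (by linarith [(abs_le.mp hb).1]) (abs_le.mp hb).2
        _ ≤ ∑ _a' ∈ Ioc A₁ A₂, (ε * B) ^ 2 :=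
              sum_le_sum_of_subset_of_nonneg (erase_subset _ _) (fun _ _ _ => sq_nonneg _)
        _ = (Ioc A₁ A₂).card * (ε * B) ^ 2 := by simp
    linarith
  calc ∑ a ∈ Ioc A₁ A₂, ∑ a' ∈ Ioc A₁ A₂, rowCorr f c B a a' ^ 2
      ≤ ∑ _a ∈ Ioc A₁ A₂, ((B : ℝ) ^ 2 + (Ioc A₁ A₂).card * (ε * B) ^ 2) := sum_le_sum hrow
    _ = _ := by simp only [sum_const, nsmul_eq_mul]; ring

/-- HYPOTHESIS — uniform binary Chowla–Elliott for two linear forms (believed; open; the `q = 1`,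
two-form cousin of `Literature.Barriers.Parity.Polymath2014_liouvillePairAP`): for `c ≠ 0` and
every `C`, beyond some `x₀(c, C)`, uniformly for DISTINCT coefficients `a ≠ a'` up to `2x` and
lengths `x^{1/2} ≤ B ≤ x`: `|∑_{b ≤ B} λ(ab+c) λ(a'b+c)| ≤ B/(log x)^C`. The forms `ab+c`, `a'b+c` are
non-proportional precisely because `c ≠ 0` and `a ≠ a'`. -/
def UniformBinaryChowla : Prop :=
  ∀ c : ℤ, c ≠ 0 → ∀ C : ℝ, 0 < C → ∃ x₀ : ℝ, ∀ x : ℝ, x₀ ≤ x → ∀ a a' B : ℕ, a ≠ a' →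
    (a : ℝ) ≤ 2 * x → (a' : ℝ) ≤ 2 * x → x ^ ((1 : ℝ) / 2) ≤ B → (B : ℝ) ≤ x →
      |rowCorr lam c B a a'| ≤ B / Real.log x ^ C

/-- RESISTANCE THEOREM: `UniformBinaryChowla ⟹ TableChowla`. -/
theorem tableChowla_of_uniformBinaryChowla (h : UniformBinaryChowla) :
    LiouvilleShiftedTables.TableChowla := by
  rw [tableChowla_iff]
  intro c hc δ hδ hδ12 C hC
  obtain ⟨x₁, hx₁⟩ := h c hc C hC
  -- (i) eventually 4 (log x)^C ≤ x^δ
  have hev : ∀ᶠ x in Filter.atTop, ‖Real.log x ^ C‖ ≤ 1 / 4 * ‖x ^ δ‖ :=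
    (isLittleO_log_rpow_rpow_atTop C hδ).bound (by norm_num)
  obtain ⟨X, hX⟩ := Filter.eventually_atTop.mp hev
  -- (ii) (log x)^C ≥ 8 once log x ≥ L₀ := 8^(1/C)
  set L₀ : ℝ := (8 : ℝ) ^ (1 / C) with hL₀
  refine ⟨max (max x₁ 4096) (max (Real.exp (max L₀ 1)) X), fun x hx A hA1 hA2 => ?_⟩
  have hxx₁ : x₁ ≤ x := le_trans (le_trans (le_max_left _ _) (le_max_left _ _)) hx
  have hx4096 : (4096 : ℝ) ≤ x := le_trans (le_trans (le_max_right _ _) (le_max_left _ _)) hx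
  have hxexp : Real.exp (max L₀ 1) ≤ x := le_trans (le_trans (le_max_left _ _) (le_max_right _ _)) hx
  have hxX : X ≤ x := le_trans (le_trans (le_max_right _ _) (le_max_right _ _)) hx
  have hx1 : (1 : ℝ) < x := by linarith
  have hxpos : (0 : ℝ) < x := by linarith
  have hlogmax : max L₀ 1 ≤ Real.log x := (Real.le_log_iff_exp_le hxpos).mpr hxexp
  have hlog1 : (1 : ℝ) ≤ Real.log x := le_trans (le_max_right _ _) hlogmax
  have hlogL : L₀ ≤ Real.log x := le_trans (le_max_left _ _) hlogmax
  have hlogpos : 0 < Real.log x := by linarith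
  set L : ℝ := Real.log x ^ C with hL
  have hLpos : 0 < L := Real.rpow_pos_of_pos hlogpos C
  have hL8 : 8 ≤ L := by
    calc (8 : ℝ) = L₀ ^ C := by
          rw [hL₀, ← Real.rpow_mul (by norm_num), one_div_mul_cancel hC.ne', Real.rpow_one]
      _ ≤ L := Real.rpow_le_rpow (by positivity) hlogL hC.le
  have hXb : 4 * L ≤ x ^ δ := by
    have := hX x hxX
    rw [Real.norm_eq_abs, Real.norm_eq_abs, abs_of_nonneg (Real.rpow_nonneg hlogpos.le C),
      abs_of_nonneg (Real.rpow_nonneg hxpos.le δ)] at this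
    rw [hL]; linarith
  -- sizes of the table
  set S : Finset ℕ := Ioc ⌊A⌋₊ ⌊2 * A⌋₊ with hS
  set Bn : ℕ := ⌊x / A⌋₊ with hBn
  have hAone : 1 ≤ A := le_trans (Real.one_le_rpow hx1.le hδ.le) hA1
  have hApos : 0 < A := by linarith
  have hAx : A ≤ x := hA2.trans (by
    calc x ^ (1 / 3 + δ) ≤ x ^ (1 : ℝ) := Real.rpow_le_rpow_of_exponent_le hx1.le (by linarith)
      _ = x := Real.rpow_one x)
  have h2Afl : (⌊2 * A⌋₊ : ℝ) ≤ 2 * A := Nat.floor_le (by linarith)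
  have hcardR : (S.card : ℝ) ≤ 2 * A := by
    rw [hS, Nat.card_Ioc, Nat.cast_sub (Nat.floor_le_floor (by linarith : A ≤ 2 * A))]
    have h2 : A - 1 < (⌊A⌋₊ : ℝ) := by have := Nat.lt_floor_add_one A; linarith
    linarith
  have hBle : (Bn : ℝ) ≤ x / A := Nat.floor_le (by positivity)
  have hBx : (Bn : ℝ) ≤ x := hBle.trans (div_le_self hxpos.le hAone)
  have hRB : (S.card : ℝ) * Bn ≤ 2 * x := by
    calc (S.card : ℝ) * Bn ≤ (2 * A) * (x / A) :=
          mul_le_mul hcardR hBle (by positivity) (by positivity)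
      _ = 2 * x := by field_simp
  have hRB2 : (S.card : ℝ) * (Bn : ℝ) ^ 2 ≤ 2 * x ^ 2 / x ^ δ := by
    calc (S.card : ℝ) * (Bn : ℝ) ^ 2 ≤ (2 * A) * (x / A) ^ 2 :=
          mul_le_mul hcardR (pow_le_pow_left₀ (by positivity) hBle 2) (by positivity) (by positivity)
      _ = 2 * x ^ 2 / A := by field_simp
      _ ≤ 2 * x ^ 2 / x ^ δ := div_le_div_of_nonneg_left (by positivity) (by positivity) hA1
  -- B ≥ x^{1/2}
  have hBlow : x ^ ((1 : ℝ) / 2) ≤ Bn := by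
    have h1 : x / x ^ (1 / 3 + δ) ≤ x / A := div_le_div_of_nonneg_left hxpos.le hApos hA2
    have h2 : x / x ^ (1 / 3 + δ) = x ^ (2 / 3 - δ) := by
      rw [div_eq_iff (by positivity), ← Real.rpow_add hxpos]
      norm_num
    have h3 : x ^ ((7 : ℝ) / 12) ≤ x ^ (2 / 3 - δ) :=
      Real.rpow_le_rpow_of_exponent_le hx1.le (by linarith)
    have h4 : x ^ ((7 : ℝ) / 12) = x ^ ((1 : ℝ) / 2) * x ^ ((1 : ℝ) / 12) := by
      rw [← Real.rpow_add hxpos]; norm_num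
    have h5 : (2 : ℝ) ≤ x ^ ((1 : ℝ) / 12) := by
      have e : ((2 : ℝ) ^ (12 : ℕ)) ^ ((1 : ℝ) / 12) = 2 := by
        rw [show ((1 : ℝ) / 12) = ((12 : ℕ) : ℝ)⁻¹ by norm_num]
        exact Real.pow_rpow_inv_natCast (by norm_num) (by norm_num)
      calc (2 : ℝ) = ((2 : ℝ) ^ (12 : ℕ)) ^ ((1 : ℝ) / 12) := e.symm
        _ ≤ x ^ ((1 : ℝ) / 12) := Real.rpow_le_rpow (by norm_num) (by norm_num; linarith) (by norm_num)
    have h6 : 1 ≤ x ^ ((1 : ℝ) / 2) := Real.one_le_rpow hx1.le (by norm_num)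
    have h7 : x / A - 1 < Bn := by have := Nat.lt_floor_add_one (x / A); rw [hBn]; linarith
    have h8 : 2 * x ^ ((1 : ℝ) / 2) ≤ x ^ ((1 : ℝ) / 2) * x ^ ((1 : ℝ) / 12) := by nlinarith
    linarith
  -- rows are ≤ 2x
  have harow : ∀ a ∈ S, (a : ℝ) ≤ 2 * x := by
    intro a ha
    rw [hS, mem_Ioc] at ha
    have : (a : ℝ) ≤ ⌊2 * A⌋₊ := by exact_mod_cast ha.2
    linarith
  -- the hypothesis on the off-diagonal pairs, with ε = 1/L
  have hoff : ∀ a ∈ S, ∀ a' ∈ S, a ≠ a' → |rowCorr lam c Bn a a'| ≤ 1 / L * Bn := by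
    intro a ha a' ha' hne
    have hb := hx₁ x hxx₁ a a' Bn hne (harow a ha) (harow a' ha') hBlow hBx
    rw [hL, one_div_mul_eq_div]; exact hb
  have hT := momentN_le_of_offDiag (f := lam) (c := c) (A₁ := ⌊A⌋₊) (A₂ := ⌊2 * A⌋₊) (B := Bn)
    abs_lam_le_one hoff
  rw [← hS] at hT
  -- assemble: T ≤ rows B² + rows² (B/L)² ≤ 2x²/x^δ + 4x²/L² ≤ x²/(2L) + x²/(2L) = x²/L
  have t2 : 2 * x ^ 2 / x ^ δ ≤ x ^ 2 / (2 * L) := by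
    rw [div_le_div_iff₀ (by positivity) (by positivity)]
    nlinarith [mul_le_mul_of_nonneg_right hXb (sq_nonneg x)]
  have t3 : (S.card : ℝ) ^ 2 * (1 / L * Bn) ^ 2 ≤ (2 * x) ^ 2 * (1 / L) ^ 2 := by
    have e1 : (S.card : ℝ) ^ 2 * (1 / L * Bn) ^ 2 = ((S.card : ℝ) * Bn) ^ 2 * (1 / L) ^ 2 := by ring
    rw [e1]
    exact mul_le_mul_of_nonneg_right (pow_le_pow_left₀ (by positivity) hRB 2) (sq_nonneg _)
  have t4 : (2 * x) ^ 2 * (1 / L) ^ 2 ≤ x ^ 2 / (2 * L) := by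
    rw [one_div_pow, mul_one_div, div_le_div_iff₀ (by positivity) (by positivity)]
    nlinarith [mul_nonneg (sq_nonneg x) hLpos.le]
  have t5 : x ^ 2 / (2 * L) + x ^ 2 / (2 * L) = x ^ 2 / L := by field_simp; ring
  show momentN lam c ⌊A⌋₊ ⌊2 * A⌋₊ ⌊x / A⌋₊ ≤ x ^ 2 / L
  rw [← hBn]
  linarith


/-! ## (e) EQUIVALENT FORMS and the interface `f ↦ TableChowlaFor f` -/

/-- The `f`-interface identifies `f` with `-f` … -/
theorem tableChowlaFor_neg_iff : TableChowlaFor (fun n => -f n) ↔ TableChowlaFor f := by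
  have h : ∀ c x A, moment (fun n => -f n) c x A = moment f c x A := by
    intro c x A
    unfold moment momentN rowCorr
    simp only [neg_mul_neg]
  simp only [TableChowlaFor, h]

/-- … and has the junk inhabitant `f ≡ 0` (so `TableChowlaFor f` carries content only together with
`|f| = 1`-type information, cf. the floors in (b)). -/
theorem tableChowlaFor_zero : TableChowlaFor (fun _ => 0) := by
  intro c _ δ _ _ C _
  refine ⟨2, fun x hx A _ _ => ?_⟩
  have h0 : moment (fun _ => (0 : ℝ)) c x A = 0 := by simp [moment, momentN, rowCorr]
  rw [h0]
  have hlog : 0 < Real.log x := Real.log_pos (by linarith)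
  positivity

/-- The crux with an unspecified multiplicative constant. -/
def TableChowlaWithConst : Prop :=
  ∀ c : ℤ, c ≠ 0 → ∀ δ : ℝ, 0 < δ → δ ≤ 1 / 12 → ∀ C : ℝ, 0 < C → ∃ K x₀ : ℝ, ∀ x : ℝ, x₀ ≤ x →
    ∀ A : ℝ, x ^ δ ≤ A → A ≤ x ^ (1 / 3 + δ) → moment lam c x A ≤ K * x ^ 2 / Real.log x ^ C

/-- EQUIVALENT FORM 1 — constants are free: `T ≤ K(c,δ,C)·x²/(log x)^C` for every `C` is the same
statement (use `C + 1` and `x ≥ e^K`). Provers may carry implicit constants throughout. -/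
theorem tableChowla_iff_withConst : LiouvilleShiftedTables.TableChowla ↔ TableChowlaWithConst := by
  rw [tableChowla_iff]
  constructor
  · intro h c hc δ hδ hδ' C hC
    obtain ⟨x₀, hx₀⟩ := h c hc δ hδ hδ' C hC
    exact ⟨1, x₀, fun x hx A hA hA' => by rw [one_mul]; exact hx₀ x hx A hA hA'⟩
  · intro h c hc δ hδ hδ' C hC
    obtain ⟨K, x₀, hx₀⟩ := h c hc δ hδ hδ' (C + 1) (by linarith)
    refine ⟨max x₀ (Real.exp (max K 1)), fun x hx A hA hA' => ?_⟩
    have hx₀x : x₀ ≤ x := le_trans (le_max_left _ _) hx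
    have hxe : Real.exp (max K 1) ≤ x := le_trans (le_max_right _ _) hx
    have hxpos : 0 < x := (Real.exp_pos _).trans_le hxe
    have hlogK : max K 1 ≤ Real.log x := (Real.le_log_iff_exp_le hxpos).mpr hxe
    have hlog1 : 1 ≤ Real.log x := le_trans (le_max_right _ _) hlogK
    have hK : K ≤ Real.log x := le_trans (le_max_left _ _) hlogK
    have key := hx₀ x hx₀x A hA hA'
    calc moment lam c x A ≤ K * x ^ 2 / Real.log x ^ (C + 1) := key
      _ ≤ Real.log x * x ^ 2 / Real.log x ^ (C + 1) := by
          gcongr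
      _ = x ^ 2 / Real.log x ^ C := by
          rw [Real.rpow_add (by linarith), Real.rpow_one]
          field_simp

/-- EQUIVALENT FORM 2 — by COLUMNS (`momentN_eq_colMoment`): the crux is verbatim the statement
that the fourth moment of the SHORT column correlations `∑_{a ∈ (A,2A]} λ(ab+c) λ(ab'+c)`
(length `≍ A`, as small as `x^δ`) over pairs of columns `b, b' ≤ x/A` is `≤ x²/(log x)^C` — the
Matomäki–Radziwiłł-type (short multiplicative sums) reading, dual to the Elliott-type reading by rows. -/
theorem tableChowla_iff_col : LiouvilleShiftedTables.TableChowla ↔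
    ∀ c : ℤ, c ≠ 0 → ∀ δ : ℝ, 0 < δ → δ ≤ 1 / 12 → ∀ C : ℝ, 0 < C → ∃ x₀ : ℝ, ∀ x : ℝ, x₀ ≤ x →
      ∀ A : ℝ, x ^ δ ≤ A → A ≤ x ^ (1 / 3 + δ) →
        (∑ b ∈ Icc 1 ⌊x / A⌋₊, ∑ b' ∈ Icc 1 ⌊x / A⌋₊, (∑ a ∈ Ioc ⌊A⌋₊ ⌊2 * A⌋₊,
          lam (Int.toNat ((a : ℤ) * b + c)) * lam (Int.toNat ((a : ℤ) * b' + c))) ^ 2) ≤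
          x ^ 2 / Real.log x ^ C := by
  rw [tableChowla_iff]
  have h : ∀ c x A, moment lam c x A = ∑ b ∈ Icc 1 ⌊x / A⌋₊, ∑ b' ∈ Icc 1 ⌊x / A⌋₊,
      (∑ a ∈ Ioc ⌊A⌋₊ ⌊2 * A⌋₊, lam (Int.toNat ((a : ℤ) * b + c)) * lam (Int.toNat ((a : ℤ) * b' + c))) ^ 2 :=
    fun c x A => momentN_eq_colMoment
  simp only [TableChowlaFor, h]

/-- EQUIVALENT FORM 3 — the crux is the `q = 1` slice of `DilatedTableChowla` (stmt-Parity-14271):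
classes mod 1 are everything, `1³ = 1`, and the other dilations contribute non-negative terms.
(Positive lemma between two Theses decls; provers may transplant it with `--supports`.) -/
theorem tableChowla_of_dilated (h : LiouvilleShiftedTables.DilatedTableChowla) :
    LiouvilleShiftedTables.TableChowla := by
  intro c hc δ hδ hδ' C hC
  obtain ⟨x₀, hx₀⟩ := h c hc δ hδ hδ' C hC
  refine ⟨max x₀ 1, fun x hx A hA hA' => ?_⟩
  have hx₀x : x₀ ≤ x := le_trans (le_max_left _ _) hx
  have hx1 : 1 ≤ x := le_trans (le_max_right _ _) hx
  have key := hx₀ x hx₀x A hA hA' (fun _ => 0) (fun _ => 0)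
  have hone : 1 ∈ Icc 1 ⌊x ^ (δ / 2)⌋₊ := by
    rw [mem_Icc, Nat.one_le_floor_iff]
    exact ⟨le_rfl, Real.one_le_rpow hx1 (by linarith)⟩
  refine le_trans ?_ (le_trans (single_le_sum (fun q _ => ?_) hone) key)
  · -- the q = 1 term is the crux's moment
    have hfilt : ∀ s : Finset ℕ, s.filter (fun a : ℕ => a ≡ 0 [MOD 1]) = s := fun s =>
      Finset.filter_true_of_mem fun a _ => Nat.modEq_one
    simp only [Nat.cast_one, one_pow, one_mul, hfilt]
    rfl
  · -- every term is non-negative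
    apply mul_nonneg (by positivity)
    exact sum_nonneg fun _ _ => sum_nonneg fun _ _ => sq_nonneg _

/-- KILL CRITERION, quantified (Chebyshev): under the crux, beyond `x₀(c,δ,C)` and for `A` in the
window, the number of ROW PAIRS `(a,a')` with `|S(a,a')| ≥ η·B` (`B = ⌊x/A⌋`) times `(ηB)²` is at
most `x²/(log x)^C`; i.e. at most `≍ A²/(η²(log x)^C)` pairs can be `η`-biased. A refutation at
level `C` must exhibit MORE biased pairs than that — a structured family of relative density
`≫ (log x)^{-C}` among the `≍ A²` pairs (numerics: none visible). -/
theorem badPairs_card_le (h : LiouvilleShiftedTables.TableChowla) {c : ℤ} (hc : c ≠ 0) {δ : ℝ}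
    (hδ : 0 < δ) (hδ' : δ ≤ 1 / 12) {C : ℝ} (hC : 0 < C) :
    ∃ x₀ : ℝ, ∀ x : ℝ, x₀ ≤ x → ∀ A : ℝ, x ^ δ ≤ A → A ≤ x ^ (1 / 3 + δ) → ∀ η : ℝ, 0 ≤ η →
      ((((Ioc ⌊A⌋₊ ⌊2 * A⌋₊) ×ˢ (Ioc ⌊A⌋₊ ⌊2 * A⌋₊)).filter (fun p : ℕ × ℕ =>
          η * ⌊x / A⌋₊ ≤ |rowCorr lam c ⌊x / A⌋₊ p.1 p.2|)).card : ℝ) * (η * ⌊x / A⌋₊) ^ 2 ≤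
        x ^ 2 / Real.log x ^ C := by
  obtain ⟨x₀, hx₀⟩ := (tableChowla_iff.mp h) c hc δ hδ hδ' C hC
  refine ⟨x₀, fun x hx A hA hA' η hη => le_trans ?_ (hx₀ x hx A hA hA')⟩
  have hηB : 0 ≤ η * (⌊x / A⌋₊ : ℝ) := mul_nonneg hη (Nat.cast_nonneg _)
  calc ((((Ioc ⌊A⌋₊ ⌊2 * A⌋₊) ×ˢ (Ioc ⌊A⌋₊ ⌊2 * A⌋₊)).filter (fun p : ℕ × ℕ =>
          η * ⌊x / A⌋₊ ≤ |rowCorr lam c ⌊x / A⌋₊ p.1 p.2|)).card : ℝ) * (η * ⌊x / A⌋₊) ^ 2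
        = ∑ _p ∈ ((Ioc ⌊A⌋₊ ⌊2 * A⌋₊) ×ˢ (Ioc ⌊A⌋₊ ⌊2 * A⌋₊)).filter (fun p : ℕ × ℕ =>
            η * ⌊x / A⌋₊ ≤ |rowCorr lam c ⌊x / A⌋₊ p.1 p.2|), (η * ⌊x / A⌋₊) ^ 2 := by
          rw [sum_const, nsmul_eq_mul]
    _ ≤ ∑ p ∈ ((Ioc ⌊A⌋₊ ⌊2 * A⌋₊) ×ˢ (Ioc ⌊A⌋₊ ⌊2 * A⌋₊)).filter (fun p : ℕ × ℕ =>
            η * ⌊x / A⌋₊ ≤ |rowCorr lam c ⌊x / A⌋₊ p.1 p.2|), rowCorr lam c ⌊x / A⌋₊ p.1 p.2 ^ 2 := by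
          refine sum_le_sum fun p hp => ?_
          obtain ⟨_, hp2⟩ := mem_filter.mp hp
          calc (η * ⌊x / A⌋₊) ^ 2 ≤ |rowCorr lam c ⌊x / A⌋₊ p.1 p.2| ^ 2 := pow_le_pow_left₀ hηB hp2 2
            _ = rowCorr lam c ⌊x / A⌋₊ p.1 p.2 ^ 2 := sq_abs _
    _ ≤ ∑ p ∈ (Ioc ⌊A⌋₊ ⌊2 * A⌋₊) ×ˢ (Ioc ⌊A⌋₊ ⌊2 * A⌋₊), rowCorr lam c ⌊x / A⌋₊ p.1 p.2 ^ 2 :=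
          sum_le_sum_of_subset_of_nonneg (filter_subset _ _) fun _ _ _ => sq_nonneg _
    _ = moment lam c x A := by
          unfold moment momentN
          rw [sum_product]


/-! ## (f) PROVER-FACING BOOKKEEPING: no `Int.toNat` junk in the window; diagonal exact;
the crux is equivalent to its OFF-DIAGONAL part -/

/-- In the window, once `|c| + 1 ≤ A`, every table argument `ab + c` is `≥ 1`
(so `Int.toNat` never truncates and `λ(ab+c) = ±1`). -/
theorem one_le_arg_of_window {A : ℝ} (hcA : (|c| : ℝ) + 1 ≤ A) {a : ℕ} (ha : a ∈ Ioc ⌊A⌋₊ A₂)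
    {b : ℕ} (hb : b ∈ Icc 1 B) : 1 ≤ (a : ℤ) * b + c := by
  rw [mem_Ioc] at ha
  rw [mem_Icc] at hb
  have hA0 : 0 ≤ A := by linarith [abs_nonneg (c : ℝ)]
  have h1 : (⌊A⌋₊ : ℝ) + 1 > A := Nat.lt_floor_add_one A
  have h2 : ((⌊A⌋₊ + 1 : ℕ) : ℝ) ≤ a := by exact_mod_cast ha.1
  have h3 : (|c| : ℝ) + 1 < (a : ℝ) + 1 := by push_cast at h2; linarith
  have h4 : |c| < (a : ℤ) := by
    have : ((|c| : ℤ) : ℝ) < ((a : ℤ) : ℝ) := by push_cast; simpa using h3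
    exact_mod_cast this
  have hb1 : (1 : ℤ) ≤ b := by exact_mod_cast hb.1
  have ha0 : (0 : ℤ) ≤ a := by positivity
  have : (a : ℤ) ≤ (a : ℤ) * b := le_mul_of_one_le_right ha0 hb1
  linarith [neg_abs_le c]

/-- Hence, in the window with `|c| + 1 ≤ A`, the DIAGONAL of the λ-moment is exactly `rows · B²`. -/
theorem diag_eq_of_window {A : ℝ} (hcA : (|c| : ℝ) + 1 ≤ A) :
    ∑ a ∈ Ioc ⌊A⌋₊ A₂, rowCorr lam c B a a ^ 2 = ((A₂ - ⌊A⌋₊ : ℕ) : ℝ) * (B : ℝ) ^ 2 := by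
  calc ∑ a ∈ Ioc ⌊A⌋₊ A₂, rowCorr lam c B a a ^ 2 = ∑ _a ∈ Ioc ⌊A⌋₊ A₂, (B : ℝ) ^ 2 :=
        sum_congr rfl fun a ha => by
          rw [rowCorr_self_eq lam_sq' fun b hb => one_le_arg_of_window hcA ha hb]
    _ = ((A₂ - ⌊A⌋₊ : ℕ) : ℝ) * (B : ℝ) ^ 2 := by simp [Nat.card_Ioc]

/-- Off-diagonal part `∑_{a ≠ a'} S(a,a')²` of the moment. -/
def offMomentN (f : ℕ → ℝ) (c : ℤ) (A₁ A₂ B : ℕ) : ℝ :=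
  ∑ a ∈ Ioc A₁ A₂, ∑ a' ∈ (Ioc A₁ A₂).erase a, rowCorr f c B a a' ^ 2

/-- `T = diagonal + off-diagonal`. -/
theorem momentN_eq_diag_add_off :
    momentN f c A₁ A₂ B = ∑ a ∈ Ioc A₁ A₂, rowCorr f c B a a ^ 2 + offMomentN f c A₁ A₂ B := by
  unfold momentN offMomentN
  rw [← sum_add_distrib]
  exact sum_congr rfl fun a ha => (Finset.add_sum_erase _ _ ha).symm

/-- The off-diagonal part is non-negative. -/
theorem offMomentN_nonneg : 0 ≤ offMomentN f c A₁ A₂ B :=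
  sum_nonneg fun _ _ => sum_nonneg fun _ _ => sq_nonneg _

/-- The off-diagonal part is at most the moment. -/
theorem offMomentN_le_momentN : offMomentN f c A₁ A₂ B ≤ momentN f c A₁ A₂ B := by
  rw [momentN_eq_diag_add_off]
  linarith [sum_nonneg fun a (_ : a ∈ Ioc A₁ A₂) => sq_nonneg (rowCorr f c B a a)]

/-- The crux restricted to the OFF-DIAGONAL pairs `a ≠ a'`. -/
def TableChowlaOffDiag : Prop :=
  ∀ c : ℤ, c ≠ 0 → ∀ δ : ℝ, 0 < δ → δ ≤ 1 / 12 → ∀ C : ℝ, 0 < C → ∃ x₀ : ℝ, ∀ x : ℝ, x₀ ≤ x →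
    ∀ A : ℝ, x ^ δ ≤ A → A ≤ x ^ (1 / 3 + δ) →
      offMomentN lam c ⌊A⌋₊ ⌊2 * A⌋₊ ⌊x / A⌋₊ ≤ x ^ 2 / Real.log x ^ C

/-- Window bookkeeping: `rows · B² ≤ 2x²/x^δ` for `x ≥ 1`, `A` in the window (`rows ≤ 2A`,
`B ≤ x/A`). -/
theorem rows_mul_cols_sq_le_window {x A δ : ℝ} (hx1 : 1 ≤ x) (hδ : 0 ≤ δ) (hA : x ^ δ ≤ A) :
    ((⌊2 * A⌋₊ - ⌊A⌋₊ : ℕ) : ℝ) * (⌊x / A⌋₊ : ℝ) ^ 2 ≤ 2 * x ^ 2 / x ^ δ := by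
  have hAone : 1 ≤ A := le_trans (Real.one_le_rpow hx1 hδ) hA
  have hApos : 0 < A := by linarith
  have hxpos : 0 < x := by linarith
  have hcardR : ((⌊2 * A⌋₊ - ⌊A⌋₊ : ℕ) : ℝ) ≤ 2 * A := by
    rw [Nat.cast_sub (Nat.floor_le_floor (by linarith : A ≤ 2 * A))]
    have h1 : (⌊2 * A⌋₊ : ℝ) ≤ 2 * A := Nat.floor_le (by linarith)
    have h2 : A - 1 < (⌊A⌋₊ : ℝ) := by have := Nat.lt_floor_add_one A; linarith
    linarith
  have hBle : (⌊x / A⌋₊ : ℝ) ≤ x / A := Nat.floor_le (by positivity)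
  calc ((⌊2 * A⌋₊ - ⌊A⌋₊ : ℕ) : ℝ) * (⌊x / A⌋₊ : ℝ) ^ 2 ≤ (2 * A) * (x / A) ^ 2 :=
        mul_le_mul hcardR (pow_le_pow_left₀ (by positivity) hBle 2) (by positivity) (by positivity)
    _ = 2 * x ^ 2 / A := by field_simp
    _ ≤ 2 * x ^ 2 / x ^ δ := div_le_div_of_nonneg_left (by positivity) (by positivity) hA

/-- EVENTUALITY used twice: beyond some `X(δ, C)`, `4 (log x)^C ≤ x^δ` and `2 ≤ log x`. -/
theorem eventually_log_rpow_le {δ : ℝ} (hδ : 0 < δ) (C : ℝ) :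
    ∃ X : ℝ, ∀ x : ℝ, X ≤ x → 4 * Real.log x ^ C ≤ x ^ δ ∧ 2 ≤ Real.log x := by
  have hev : ∀ᶠ x in Filter.atTop, ‖Real.log x ^ C‖ ≤ 1 / 4 * ‖x ^ δ‖ :=
    (isLittleO_log_rpow_rpow_atTop C hδ).bound (by norm_num)
  obtain ⟨X, hX⟩ := Filter.eventually_atTop.mp hev
  refine ⟨max X (Real.exp 2), fun x hx => ?_⟩
  have hxX : X ≤ x := le_trans (le_max_left _ _) hx
  have hxe : Real.exp 2 ≤ x := le_trans (le_max_right _ _) hx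
  have hxpos : 0 < x := (Real.exp_pos 2).trans_le hxe
  have hlog2 : 2 ≤ Real.log x := (Real.le_log_iff_exp_le hxpos).mpr hxe
  have := hX x hxX
  rw [Real.norm_eq_abs, Real.norm_eq_abs, abs_of_nonneg (Real.rpow_nonneg (by linarith) C),
    abs_of_nonneg (Real.rpow_nonneg hxpos.le δ)] at this
  exact ⟨by linarith, hlog2⟩

/-- EQUIVALENT FORM 4 — only the pairs `a ≠ a'` matter: `TableChowla ↔ TableChowlaOffDiag`
(`→`: drop the diagonal; `←`: the diagonal is `≤ rows·B² ≤ 2x²/x^δ ≤ x²/(2(log x)^C)` eventually,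
and the off-diagonal statement at `C + 1` gives the other half beyond `log x ≥ 2`). -/
theorem tableChowla_iff_offDiag : LiouvilleShiftedTables.TableChowla ↔ TableChowlaOffDiag := by
  rw [tableChowla_iff]
  constructor
  · intro h c hc δ hδ hδ' C hC
    obtain ⟨x₀, hx₀⟩ := h c hc δ hδ hδ' C hC
    exact ⟨x₀, fun x hx A hA hA' => le_trans offMomentN_le_momentN (hx₀ x hx A hA hA')⟩
  · intro h c hc δ hδ hδ' C hC
    obtain ⟨x₀, hx₀⟩ := h c hc δ hδ hδ' (C + 1) (by linarith)
    obtain ⟨X, hX⟩ := eventually_log_rpow_le hδ C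
    refine ⟨max x₀ (max X 1), fun x hx A hA hA' => ?_⟩
    have hx₀x : x₀ ≤ x := le_trans (le_max_left _ _) hx
    have hxX : X ≤ x := le_trans (le_trans (le_max_left _ _) (le_max_right _ _)) hx
    have hx1 : 1 ≤ x := le_trans (le_trans (le_max_right _ _) (le_max_right _ _)) hx
    have hxpos : 0 < x := by linarith
    obtain ⟨h4, hlog2⟩ := hX x hxX
    have hlogpos : 0 < Real.log x := by linarith
    set L : ℝ := Real.log x ^ C with hL
    have hLpos : 0 < L := Real.rpow_pos_of_pos hlogpos C
    have hoff := hx₀ x hx₀x A hA hA'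
    rw [Real.rpow_add hlogpos, Real.rpow_one, ← hL] at hoff
    -- diagonal ≤ rows B² ≤ 2x²/x^δ ≤ x²/(2L)
    have hdiag : ∑ a ∈ Ioc ⌊A⌋₊ ⌊2 * A⌋₊, rowCorr lam c ⌊x / A⌋₊ a a ^ 2 ≤
        ((⌊2 * A⌋₊ - ⌊A⌋₊ : ℕ) : ℝ) * (⌊x / A⌋₊ : ℝ) ^ 2 := by
      calc ∑ a ∈ Ioc ⌊A⌋₊ ⌊2 * A⌋₊, rowCorr lam c ⌊x / A⌋₊ a a ^ 2
            ≤ ∑ _a ∈ Ioc ⌊A⌋₊ ⌊2 * A⌋₊, (⌊x / A⌋₊ : ℝ) ^ 2 := by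
              refine sum_le_sum fun a _ => ?_
              have hb := abs_rowCorr_le (c := c) (B := ⌊x / A⌋₊) abs_lam_le_one a a
              exact sq_le_sq' (by linarith [(abs_le.mp hb).1]) (abs_le.mp hb).2
        _ = ((⌊2 * A⌋₊ - ⌊A⌋₊ : ℕ) : ℝ) * (⌊x / A⌋₊ : ℝ) ^ 2 := by simp [Nat.card_Ioc]
    have hwin := rows_mul_cols_sq_le_window hx1 hδ.le hA
    have t2 : 2 * x ^ 2 / x ^ δ ≤ x ^ 2 / (2 * L) := by
      rw [div_le_div_iff₀ (by positivity) (by positivity)]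
      nlinarith [mul_le_mul_of_nonneg_right h4 (sq_nonneg x)]
    have t3 : x ^ 2 / (L * Real.log x) ≤ x ^ 2 / (2 * L) := by
      apply div_le_div_of_nonneg_left (by positivity) (by positivity)
      nlinarith
    have t5 : x ^ 2 / (2 * L) + x ^ 2 / (2 * L) = x ^ 2 / L := by field_simp; ring
    show momentN lam c ⌊A⌋₊ ⌊2 * A⌋₊ ⌊x / A⌋₊ ≤ x ^ 2 / L
    rw [momentN_eq_diag_add_off]
    linarith


/-! ## (g) ATTACKS ON THE IDEATORS' TRANSFER TARGETS (crux-ideate round 1)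

The cards `corner-local-box` and `slope-band-vdc` (ideator 3, `Cruxes/TableChowla/Ideas/`,
signatures in `Cruxes/TableChowla/SketchIdeator3.lean`) propose STRONGER statements `C⁺` with
`C⁺ → TableChowla`. Their definitions are copied VERBATIM into the namespace `IdeaR1` below (so that
this file does not import another seat's work file) and attacked.

* `corner-local-box`: `IdeaR1.LocalBoxChowla` is FALSE as filed (`not_localBoxChowla_r1`): it
  quantifies over all gaps `(h,k) ≠ (0,0)`, but on the AXES `h = 0` or `k = 0` the corner sum is a
  sum of squares, `𝒞(0,k) = 𝒞(h,0) = rows·B ≍ x` exactly (every factor appears twice), never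
  `≤ x/(log x)^K`. So `localBox_reduction : LocalBoxChowla → TableChowla` is vacuous as filed.
  CLASS: misstated. REPAIR: restrict to `h ≠ 0 ∧ k ≠ 0` (`IdeaR1.LocalBoxChowlaOffAxes` below,
  plausible, not refuted here); the axes are then the two DIAGONAL terms of the double van der
  Corput inequality and cost `2x²/H` — affordable with `H = (log x)^{C+1}` — so the repaired
  reduction still goes through on paper. NB the card's reading of `𝒞(0,k)` as the "lag-k Chowla
  flat face `Σ_a Σ_{n ≡ c (a)} λ(n)λ(n+ka)`" is wrong: that signed two-point sum is
  `Σ_b G(b,b+k)` (column-pair correlations), which enters `E = Σ_{b,b'} G(b,b')²` only squared.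
* `slope-band-vdc`: `BandChowla` (only `h ≥ 1`, budget `x² log x/A`) has no degenerate instance
  (`h ≥ 1` forces `a ≠ a+h`; `c ≠ 0` kept; random model `(log x)^K·x ≪ x·B·log x`); not refuted —
  it is a near-diagonal, almost-all WEAKENING of `UniformBinaryChowla` and sits between (d) and the
  crux. -/

namespace IdeaR1

/-- VERBATIM from `SketchIdeator3.lean`: `λ` at an integer argument (`Int.toNat` convention). -/
def lam (n : ℤ) : ℝ := (ArithmeticFunction.liouville (Int.toNat n) : ℝ)

/-- VERBATIM from `SketchIdeator3.lean`: the corner (2×2-block) sum `𝒞_c(h,k;A,B)`. -/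
def cornerSum (c : ℤ) (h k Alo Ahi B : ℕ) : ℝ :=
  ∑ a ∈ Ioc Alo Ahi, ∑ b ∈ Icc 1 B,
    lam ((a : ℤ) * b + c) * lam ((a : ℤ) * (b + k) + c) *
      lam (((a : ℤ) + h) * b + c) * lam (((a : ℤ) + h) * (b + k) + c)

/-- VERBATIM from `SketchIdeator3.lean` (card `corner-local-box`, transfer target `C⁺`). -/
def LocalBoxChowla : Prop :=
  ∀ c : ℤ, c ≠ 0 → ∀ δ : ℝ, 0 < δ → δ ≤ 1 / 12 → ∀ K : ℝ, 0 < K → ∃ x₀ : ℝ, ∀ x : ℝ, x₀ ≤ x →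
    ∀ A : ℝ, x ^ δ ≤ A → A ≤ x ^ (1 / 3 + δ) → ∀ h k : ℕ, (h : ℝ) ≤ Real.log x ^ K →
      (k : ℝ) ≤ Real.log x ^ K → (h, k) ≠ (0, 0) →
        |cornerSum c h k ⌊A⌋₊ ⌊2 * A⌋₊ ⌊x / A⌋₊| ≤ x / Real.log x ^ K

/-- The REPAIRED transfer target (both gaps non-zero); plausible, not attacked further. -/
def LocalBoxChowlaOffAxes : Prop :=
  ∀ c : ℤ, c ≠ 0 → ∀ δ : ℝ, 0 < δ → δ ≤ 1 / 12 → ∀ K : ℝ, 0 < K → ∃ x₀ : ℝ, ∀ x : ℝ, x₀ ≤ x →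
    ∀ A : ℝ, x ^ δ ≤ A → A ≤ x ^ (1 / 3 + δ) → ∀ h k : ℕ, (h : ℝ) ≤ Real.log x ^ K →
      (k : ℝ) ≤ Real.log x ^ K → h ≠ 0 → k ≠ 0 →
        |cornerSum c h k ⌊A⌋₊ ⌊2 * A⌋₊ ⌊x / A⌋₊| ≤ x / Real.log x ^ K

/-- `IdeaR1.lam n ^ 2 = 1` for `n ≥ 1`. -/
theorem lam_sq_of_pos {n : ℤ} (hn : 1 ≤ n) : lam n ^ 2 = 1 := by
  unfold lam
  have h0 : Int.toNat n ≠ 0 := by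
    intro h; rw [Int.toNat_eq_zero] at h; omega
  rw [liouville_apply h0]
  push_cast
  rw [← pow_mul, mul_comm, pow_mul]
  norm_num

/-- On the axis `h = 0` the corner sum is a sum of squares: `𝒞_1(0,k) = rows · B` exactly. -/
theorem cornerSum_axis (k Alo Ahi B : ℕ) :
    cornerSum 1 0 k Alo Ahi B = ((Ahi - Alo : ℕ) : ℝ) * B := by
  unfold cornerSum
  have hterm : ∀ a ∈ Ioc Alo Ahi, ∀ b ∈ Icc 1 B,
      lam ((a : ℤ) * b + 1) * lam ((a : ℤ) * (b + k) + 1) *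
        lam (((a : ℤ) + (0 : ℕ)) * b + 1) * lam (((a : ℤ) + (0 : ℕ)) * (b + k) + 1) = 1 := by
    intro a _ b _
    have e : ((a : ℤ) + (0 : ℕ)) = (a : ℤ) := by push_cast; ring
    rw [e]
    have h1 : lam ((a : ℤ) * b + 1) ^ 2 = 1 :=
      lam_sq_of_pos (by have : (0 : ℤ) ≤ (a : ℤ) * b := by positivity
                        linarith)
    have h2 : lam ((a : ℤ) * (b + k) + 1) ^ 2 = 1 :=
      lam_sq_of_pos (by have : (0 : ℤ) ≤ (a : ℤ) * (b + k) := by positivity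
                        linarith)
    nlinarith [h1, h2]
  rw [sum_congr rfl fun a ha => sum_congr rfl fun b hb => hterm a ha b hb]
  simp [Nat.card_Ioc]

/-- **The card's `C⁺` is FALSE as filed** (witness `c = 1`, `δ = 1/12`, `K = 1`, `x = m¹²`,
`A = m`, gaps `(h,k) = (0,1)`: `|𝒞| = m · m¹¹ = x > x/log x`). CLASS misstated; REPAIR
`LocalBoxChowlaOffAxes`. -/
theorem not_localBoxChowla_r1 : ¬ LocalBoxChowla := by
  intro h
  obtain ⟨x₀, hx₀⟩ := h 1 one_ne_zero (1 / 12) (by norm_num) le_rfl 1 one_pos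
  obtain ⟨m, hm⟩ := exists_nat_ge (max x₀ 3)
  have hm3 : (3 : ℝ) ≤ m := le_trans (le_max_right _ _) hm
  have hmx : x₀ ≤ m := le_trans (le_max_left _ _) hm
  have hm1 : (1 : ℝ) ≤ m := by linarith
  have hm1' : 1 ≤ m := by exact_mod_cast hm1
  have hm0 : m ≠ 0 := by omega
  have hmpos : (0 : ℝ) < m := by linarith
  have hxx₀ : x₀ ≤ (m : ℝ) ^ 12 := hmx.trans (le_self_pow₀ hm1 (by norm_num))
  obtain ⟨hw1, hw2⟩ := window_pow (k := 12) (by norm_num) hm1'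
  have hlog1 : 1 < Real.log ((m : ℝ) ^ 12) := by
    rw [Real.log_pow]; push_cast
    have := Real.log_le_log (by norm_num) hm3
    have := one_lt_log_three
    nlinarith
  have key := hx₀ ((m : ℝ) ^ 12) hxx₀ m (by exact_mod_cast hw1) (by exact_mod_cast hw2) 0 1
    (by push_cast; rw [Real.rpow_one]; linarith) (by push_cast; rw [Real.rpow_one]; linarith)
    (by simp)
  rw [Nat.floor_natCast, floor_two_mul_natCast, Real.rpow_one,
    show (m : ℝ) ^ 12 / m = ((m ^ 11 : ℕ) : ℝ) by
      push_cast; rw [show (m : ℝ) ^ 12 = (m : ℝ) ^ 11 * m by ring, mul_div_cancel_right₀ _ hmpos.ne'],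
    Nat.floor_natCast, cornerSum_axis, show 2 * m - m = m by omega] at key
  push_cast at key
  rw [abs_of_nonneg (by positivity), show (m : ℝ) * (m : ℝ) ^ 11 = (m : ℝ) ^ 12 by ring] at key
  -- key : m¹² ≤ m¹² / log (m¹²) with log (m¹²) > 1
  have hP : (0 : ℝ) < (m : ℝ) ^ 12 := by positivity
  have := div_lt_self hP hlog1
  linarith

end IdeaR1


/-! ## (h) THE CRUX IS A STATEMENT ABOUT THE SIZE OF THE EXCEPTIONAL SET OF BIASED ROW PAIRS

`TableChowla ↔ FewBadPairs`: at every log-power scale `η = (log x)^{-C}`, the number of row pairs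
`(a,a')` with `|S(a,a')| ≥ ηB` is `≤ x²/(B²(log x)^{C'}) ≍ A²/(log x)^{C'}` for every `C'`.
(`→` is Chebyshev = `badPairs_card_le`; `←` splits `T` into biased pairs, bounded trivially by
`B²` each, and unbiased pairs, bounded by `(ηB)²` each.) So a prover may aim at an
EXCEPTIONAL-SET statement (large-values / Halász-type counting of biased pairs) rather than at a
pointwise bound, and a refuter must produce `≫ A²/(log x)^{C'}` biased pairs for some fixed `C'`. -/

/-- Number of `η`-biased row pairs of the table at `(x, A, c)`: `|S(a,a')| ≥ η·B`, `B = ⌊x/A⌋`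
(diagonal pairs included — there are only `rows ≍ A` of them). -/
def badPairs (c : ℤ) (x A η : ℝ) : ℕ :=
  (((Ioc ⌊A⌋₊ ⌊2 * A⌋₊) ×ˢ (Ioc ⌊A⌋₊ ⌊2 * A⌋₊)).filter (fun p : ℕ × ℕ =>
      η * ⌊x / A⌋₊ ≤ |rowCorr lam c ⌊x / A⌋₊ p.1 p.2|)).card

/-- FEW BAD PAIRS at every pair of log-power scales. -/
def FewBadPairs : Prop :=
  ∀ c : ℤ, c ≠ 0 → ∀ δ : ℝ, 0 < δ → δ ≤ 1 / 12 → ∀ C : ℝ, 0 < C → ∀ C' : ℝ, 0 < C' →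
    ∃ x₀ : ℝ, ∀ x : ℝ, x₀ ≤ x → ∀ A : ℝ, x ^ δ ≤ A → A ≤ x ^ (1 / 3 + δ) →
      (badPairs c x A (Real.log x ^ C)⁻¹ : ℝ) ≤ x ^ 2 / ((⌊x / A⌋₊ : ℝ) ^ 2 * Real.log x ^ C')

/-- Window bookkeeping: `rows · B ≤ 2x` and `1 ≤ B` for `x ≥ 1`, `A` in the window. -/
theorem rows_mul_cols_le_window {x A δ : ℝ} (hx1 : 1 ≤ x) (hδ : 0 ≤ δ) (hδ' : δ ≤ 2 / 3)
    (hA : x ^ δ ≤ A) (hA' : A ≤ x ^ (1 / 3 + δ)) :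
    ((⌊2 * A⌋₊ - ⌊A⌋₊ : ℕ) : ℝ) * (⌊x / A⌋₊ : ℝ) ≤ 2 * x ∧ 1 ≤ ⌊x / A⌋₊ := by
  have hAone : 1 ≤ A := le_trans (Real.one_le_rpow hx1 hδ) hA
  have hApos : 0 < A := by linarith
  have hxpos : 0 < x := by linarith
  have hcardR : ((⌊2 * A⌋₊ - ⌊A⌋₊ : ℕ) : ℝ) ≤ 2 * A := by
    rw [Nat.cast_sub (Nat.floor_le_floor (by linarith : A ≤ 2 * A))]
    have h1 : (⌊2 * A⌋₊ : ℝ) ≤ 2 * A := Nat.floor_le (by linarith)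
    have h2 : A - 1 < (⌊A⌋₊ : ℝ) := by have := Nat.lt_floor_add_one A; linarith
    linarith
  have hBle : (⌊x / A⌋₊ : ℝ) ≤ x / A := Nat.floor_le (by positivity)
  refine ⟨?_, ?_⟩
  · calc ((⌊2 * A⌋₊ - ⌊A⌋₊ : ℕ) : ℝ) * (⌊x / A⌋₊ : ℝ) ≤ (2 * A) * (x / A) :=
          mul_le_mul hcardR hBle (by positivity) (by positivity)
      _ = 2 * x := by field_simp
  · rw [Nat.one_le_floor_iff, le_div_iff₀ hApos, one_mul]
    calc A ≤ x ^ (1 / 3 + δ) := hA'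
      _ ≤ x ^ (1 : ℝ) := Real.rpow_le_rpow_of_exponent_le hx1 (by linarith)
      _ = x := Real.rpow_one x

/-- EVENTUALITY: beyond some `X(C, M)`, `M ≤ (log x)^C` and `2 ≤ log x`. -/
theorem eventually_rpow_log_ge {C : ℝ} (hC : 0 < C) (M : ℝ) :
    ∃ X : ℝ, ∀ x : ℝ, X ≤ x → M ≤ Real.log x ^ C ∧ 2 ≤ Real.log x := by
  set M₁ : ℝ := (max M 1) ^ (1 / C) with hM₁
  refine ⟨Real.exp (max M₁ 2), fun x hx => ?_⟩
  have hxpos : 0 < x := (Real.exp_pos _).trans_le hx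
  have hlog : max M₁ 2 ≤ Real.log x := (Real.le_log_iff_exp_le hxpos).mpr hx
  have h2 : 2 ≤ Real.log x := le_trans (le_max_right _ _) hlog
  have hM₁le : M₁ ≤ Real.log x := le_trans (le_max_left _ _) hlog
  have hM₁nn : 0 ≤ M₁ := by rw [hM₁]; positivity
  refine ⟨?_, h2⟩
  calc M ≤ max M 1 := le_max_left _ _
    _ = M₁ ^ C := by
        rw [hM₁, ← Real.rpow_mul (by positivity), one_div_mul_cancel hC.ne', Real.rpow_one]
    _ ≤ Real.log x ^ C := Real.rpow_le_rpow hM₁nn hM₁le hC.le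

/-- `TableChowla → FewBadPairs` (Chebyshev at level `C' + 2C`). -/
theorem fewBadPairs_of_tableChowla (h : LiouvilleShiftedTables.TableChowla) : FewBadPairs := by
  intro c hc δ hδ hδ' C hC C' hC'
  obtain ⟨x₀, hx₀⟩ := badPairs_card_le h hc hδ hδ' (C := C' + 2 * C) (by positivity)
  refine ⟨max x₀ 2, fun x hx A hA hA' => ?_⟩
  have hx₀x : x₀ ≤ x := le_trans (le_max_left _ _) hx
  have hx2 : (2 : ℝ) ≤ x := le_trans (le_max_right _ _) hx
  have hx1 : (1 : ℝ) ≤ x := by linarith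
  have hlogpos : 0 < Real.log x := Real.log_pos (by linarith)
  set L : ℝ := Real.log x ^ C with hL
  set L' : ℝ := Real.log x ^ C' with hL'
  have hLpos : 0 < L := Real.rpow_pos_of_pos hlogpos C
  have hL'pos : 0 < L' := Real.rpow_pos_of_pos hlogpos C'
  obtain ⟨_, hB1⟩ := rows_mul_cols_le_window hx1 hδ.le (by linarith) hA hA'
  set Bn : ℕ := ⌊x / A⌋₊ with hBn
  have hBpos : (0 : ℝ) < Bn := by exact_mod_cast hB1
  have key := hx₀ x hx₀x A hA hA' L⁻¹ (by positivity)
  have hsplit : Real.log x ^ (C' + 2 * C) = L' * L ^ 2 := by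
    rw [Real.rpow_add hlogpos, hL, hL', show (2 : ℝ) * C = C + C by ring, Real.rpow_add hlogpos, sq]
  rw [hsplit, ← hBn] at key
  -- key : #bad * (L⁻¹ * Bn)² ≤ x² / (L' * L²) ; goal : #bad ≤ x² / (Bn² * L')
  show (badPairs c x A L⁻¹ : ℝ) ≤ x ^ 2 / ((Bn : ℝ) ^ 2 * L')
  have e1 : (badPairs c x A L⁻¹ : ℝ) =
      (badPairs c x A L⁻¹ : ℝ) * (L⁻¹ * Bn) ^ 2 * (L ^ 2 / (Bn : ℝ) ^ 2) := by
    field_simp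
  rw [e1]
  calc (badPairs c x A L⁻¹ : ℝ) * (L⁻¹ * Bn) ^ 2 * (L ^ 2 / (Bn : ℝ) ^ 2)
      ≤ x ^ 2 / (L' * L ^ 2) * (L ^ 2 / (Bn : ℝ) ^ 2) :=
        mul_le_mul_of_nonneg_right key (by positivity)
    _ = x ^ 2 / ((Bn : ℝ) ^ 2 * L') := by field_simp

/-- `FewBadPairs → TableChowla` (biased pairs cost `B²` each, unbiased ones `(ηB)²` each). -/
theorem tableChowla_of_fewBadPairs (h : FewBadPairs) : LiouvilleShiftedTables.TableChowla := by
  rw [tableChowla_iff]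
  intro c hc δ hδ hδ' C hC
  obtain ⟨x₀, hx₀⟩ := h c hc δ hδ hδ' C hC (C + 1) (by linarith)
  obtain ⟨X, hX⟩ := eventually_rpow_log_ge hC 8
  refine ⟨max x₀ (max X 1), fun x hx A hA hA' => ?_⟩
  have hx₀x : x₀ ≤ x := le_trans (le_max_left _ _) hx
  have hxX : X ≤ x := le_trans (le_trans (le_max_left _ _) (le_max_right _ _)) hx
  have hx1 : 1 ≤ x := le_trans (le_trans (le_max_right _ _) (le_max_right _ _)) hx
  have hxpos : 0 < x := by linarith
  obtain ⟨hL8, hlog2⟩ := hX x hxX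
  have hlogpos : 0 < Real.log x := by linarith
  set L : ℝ := Real.log x ^ C with hL
  have hLpos : 0 < L := Real.rpow_pos_of_pos hlogpos C
  obtain ⟨hRB, hB1⟩ := rows_mul_cols_le_window hx1 hδ.le (by linarith) hA hA'
  set S : Finset ℕ := Ioc ⌊A⌋₊ ⌊2 * A⌋₊ with hS
  set Bn : ℕ := ⌊x / A⌋₊ with hBn
  have hBpos : (0 : ℝ) < Bn := by exact_mod_cast hB1
  have hbad := hx₀ x hx₀x A hA hA'
  rw [Real.rpow_add hlogpos, Real.rpow_one, ← hL, ← hBn] at hbad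
  -- hbad : #bad ≤ x² / (Bn² * (L * log x))
  -- split T over bad / good pairs
  set P : ℕ × ℕ → Prop := fun p => L⁻¹ * Bn ≤ |rowCorr lam c Bn p.1 p.2| with hP
  have hT : momentN lam c ⌊A⌋₊ ⌊2 * A⌋₊ Bn = ∑ p ∈ S ×ˢ S, rowCorr lam c Bn p.1 p.2 ^ 2 := by
    unfold momentN; rw [sum_product]
  have hsplitsum := (Finset.sum_filter_add_sum_filter_not (S ×ˢ S) P
    (fun p => rowCorr lam c Bn p.1 p.2 ^ 2)).symm
  -- bad part
  have hbadcard : (((S ×ˢ S).filter P).card : ℝ) = (badPairs c x A L⁻¹ : ℝ) := by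
    simp only [badPairs, hS, hBn, hP]
  have hbadsum : ∑ p ∈ (S ×ˢ S).filter P, rowCorr lam c Bn p.1 p.2 ^ 2 ≤ x ^ 2 / (L * Real.log x) := by
    calc ∑ p ∈ (S ×ˢ S).filter P, rowCorr lam c Bn p.1 p.2 ^ 2
        ≤ ∑ _p ∈ (S ×ˢ S).filter P, (Bn : ℝ) ^ 2 := by
          refine sum_le_sum fun p _ => ?_
          have hb := abs_rowCorr_le (c := c) (B := Bn) abs_lam_le_one p.1 p.2
          exact sq_le_sq' (by linarith [(abs_le.mp hb).1]) (abs_le.mp hb).2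
      _ = (badPairs c x A L⁻¹ : ℝ) * (Bn : ℝ) ^ 2 := by rw [sum_const, nsmul_eq_mul, hbadcard]
      _ ≤ x ^ 2 / ((Bn : ℝ) ^ 2 * (L * Real.log x)) * (Bn : ℝ) ^ 2 :=
          mul_le_mul_of_nonneg_right hbad (by positivity)
      _ = x ^ 2 / (L * Real.log x) := by field_simp
  -- good part
  have hgoodsum : ∑ p ∈ (S ×ˢ S).filter (fun p => ¬ P p), rowCorr lam c Bn p.1 p.2 ^ 2 ≤
      (2 * x) ^ 2 * L⁻¹ ^ 2 := by
    calc ∑ p ∈ (S ×ˢ S).filter (fun p => ¬ P p), rowCorr lam c Bn p.1 p.2 ^ 2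
        ≤ ∑ _p ∈ (S ×ˢ S).filter (fun p => ¬ P p), (L⁻¹ * Bn) ^ 2 := by
          refine sum_le_sum fun p hp => ?_
          have hnp : ¬ P p := (mem_filter.mp hp).2
          have hlt : |rowCorr lam c Bn p.1 p.2| < L⁻¹ * Bn := lt_of_not_ge hnp
          have hnn : 0 ≤ L⁻¹ * (Bn : ℝ) := by positivity
          exact sq_le_sq' (by linarith [(abs_lt.mp hlt).1]) (abs_lt.mp hlt).2.le
      _ ≤ ∑ _p ∈ S ×ˢ S, (L⁻¹ * Bn) ^ 2 :=
          sum_le_sum_of_subset_of_nonneg (filter_subset _ _) fun _ _ _ => sq_nonneg _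
      _ = ((S.card : ℝ) * Bn) ^ 2 * L⁻¹ ^ 2 := by
          rw [sum_const, nsmul_eq_mul, card_product]; push_cast; ring
      _ ≤ (2 * x) ^ 2 * L⁻¹ ^ 2 := by
          apply mul_le_mul_of_nonneg_right _ (sq_nonneg _)
          have hRB' : (S.card : ℝ) * Bn ≤ 2 * x := by rw [hS, Nat.card_Ioc]; exact hRB
          exact pow_le_pow_left₀ (by positivity) hRB' 2
  -- assemble
  have t1 : x ^ 2 / (L * Real.log x) ≤ x ^ 2 / (2 * L) := by
    apply div_le_div_of_nonneg_left (by positivity) (by positivity); nlinarith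
  have t2 : (2 * x) ^ 2 * L⁻¹ ^ 2 ≤ x ^ 2 / (2 * L) := by
    rw [inv_pow, ← div_eq_mul_inv, div_le_div_iff₀ (by positivity) (by positivity)]
    nlinarith [mul_nonneg (sq_nonneg x) hLpos.le]
  have t5 : x ^ 2 / (2 * L) + x ^ 2 / (2 * L) = x ^ 2 / L := by field_simp; ring
  show momentN lam c ⌊A⌋₊ ⌊2 * A⌋₊ ⌊x / A⌋₊ ≤ x ^ 2 / L
  rw [← hBn, hT, hsplitsum]
  linarith

/-- EQUIVALENT FORM 5: the crux is exactly the smallness of the exceptional set of biased row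
pairs at every pair of log-power scales. -/
theorem tableChowla_iff_fewBadPairs : LiouvilleShiftedTables.TableChowla ↔ FewBadPairs :=
  ⟨fewBadPairs_of_tableChowla, tableChowla_of_fewBadPairs⟩


/-! ## (i) HARDNESS CALIBRATION (necessity side, after ideator 3's `Calibration.lean`, whose main
theorem is stated there with `sorry` and is PROVED here): the crux implies a FIXED-RESIDUE,
absolute-value level-of-distribution statement for `λ` at level `1 − δ` —
`Σ_{b ≤ x/A} |Σ_{a ∈ (A,2A]} λ(ab+c)| ≤ x/(log x)^C` for every `C` (moduli `b ≤ x^{1−δ}`, `x^δ`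
terms per progression `{n ≡ c (b)} ∩ (Ab, 2Ab]`). Unconditionally known only at level `1/2`
(Bombieri–Vinogradov for `λ`); believed (random model gives `Σ_b √A = x/√A`). This is the
precise sense in which the crux is "beyond GRH-level technology" — a statement about DEPTH, not
falsity: no Ω-result contradicts it (see the barrier check in the header). -/

/-- Column sums `G(b) = Σ_{a ∈ (A₁,A₂]} f(ab+c)`: `f` along `x^δ` consecutive terms of the
progression `c (mod b)`. -/
def colSum (f : ℕ → ℝ) (c : ℤ) (A₁ A₂ b : ℕ) : ℝ :=
  ∑ a ∈ Ioc A₁ A₂, f (Int.toNat ((a : ℤ) * b + c))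

/-- Linnik/dispersion identity: `Σ_b G(b)² = Σ_{a,a'} S(a,a')`. -/
theorem sum_colSum_sq : ∑ b ∈ Icc 1 B, colSum f c A₁ A₂ b ^ 2 =
    ∑ a ∈ Ioc A₁ A₂, ∑ a' ∈ Ioc A₁ A₂, rowCorr f c B a a' := by
  unfold colSum rowCorr
  simp_rw [sq, sum_mul_sum]
  simp_rw [sum_comm (s := Ioc A₁ A₂) (t := Icc 1 B)]

/-- Two Cauchy–Schwarz steps (ideator 3's abstract heart, re-proved): `(Σ_b |G(b)|)² ≤ B·rows·√T`. -/
theorem sq_sum_abs_colSum_le :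
    (∑ b ∈ Icc 1 B, |colSum f c A₁ A₂ b|) ^ 2 ≤
      (B : ℝ) * (Ioc A₁ A₂).card * Real.sqrt (momentN f c A₁ A₂ B) := by
  -- step 1: CS over b
  have h1 : (∑ b ∈ Icc 1 B, |colSum f c A₁ A₂ b|) ^ 2 ≤
      (B : ℝ) * ∑ b ∈ Icc 1 B, colSum f c A₁ A₂ b ^ 2 := by
    have := sum_mul_sq_le_sq_mul_sq (Icc 1 B) (fun _ => (1 : ℝ)) (fun b => |colSum f c A₁ A₂ b|)
    simpa [sq_abs] using this
  -- step 2: CS over pairs: Σ_{a,a'} S ≤ rows √T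
  have hT0 : 0 ≤ momentN f c A₁ A₂ B := momentN_nonneg
  have h3 : (∑ a ∈ Ioc A₁ A₂, ∑ a' ∈ Ioc A₁ A₂, rowCorr f c B a a') ^ 2 ≤
      ((Ioc A₁ A₂).card : ℝ) ^ 2 * momentN f c A₁ A₂ B := by
    have hcs := sum_mul_sq_le_sq_mul_sq (Ioc A₁ A₂ ×ˢ Ioc A₁ A₂) (fun _ => (1 : ℝ))
      (fun p => rowCorr f c B p.1 p.2)
    have e1 : ∑ p ∈ Ioc A₁ A₂ ×ˢ Ioc A₁ A₂, (1 : ℝ) * rowCorr f c B p.1 p.2 =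
        ∑ a ∈ Ioc A₁ A₂, ∑ a' ∈ Ioc A₁ A₂, rowCorr f c B a a' := by
      rw [sum_product]; simp
    have e2 : ∑ p ∈ Ioc A₁ A₂ ×ˢ Ioc A₁ A₂, rowCorr f c B p.1 p.2 ^ 2 = momentN f c A₁ A₂ B := by
      unfold momentN; rw [sum_product]
    have e3 : ∑ _p ∈ Ioc A₁ A₂ ×ˢ Ioc A₁ A₂, (1 : ℝ) ^ 2 = ((Ioc A₁ A₂).card : ℝ) ^ 2 := by
      simp [card_product, sq]
    rw [e1, e2, e3] at hcs
    exact hcs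
  have h4 : ∑ a ∈ Ioc A₁ A₂, ∑ a' ∈ Ioc A₁ A₂, rowCorr f c B a a' ≤
      ((Ioc A₁ A₂).card : ℝ) * Real.sqrt (momentN f c A₁ A₂ B) := by
    have hsq : (∑ a ∈ Ioc A₁ A₂, ∑ a' ∈ Ioc A₁ A₂, rowCorr f c B a a') ^ 2 ≤
        (((Ioc A₁ A₂).card : ℝ) * Real.sqrt (momentN f c A₁ A₂ B)) ^ 2 := by
      rw [mul_pow, Real.sq_sqrt hT0]; exact h3
    exact (abs_le_of_sq_le_sq' hsq (by positivity)).2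
  calc (∑ b ∈ Icc 1 B, |colSum f c A₁ A₂ b|) ^ 2
      ≤ (B : ℝ) * ∑ b ∈ Icc 1 B, colSum f c A₁ A₂ b ^ 2 := h1
    _ = (B : ℝ) * ∑ a ∈ Ioc A₁ A₂, ∑ a' ∈ Ioc A₁ A₂, rowCorr f c B a a' := by rw [sum_colSum_sq]
    _ ≤ (B : ℝ) * (((Ioc A₁ A₂).card : ℝ) * Real.sqrt (momentN f c A₁ A₂ B)) :=
        mul_le_mul_of_nonneg_left h4 (Nat.cast_nonneg _)
    _ = _ := by ring

/-- The fixed-residue ℓ¹ level-of-distribution face for `λ` at level `1 − δ`. -/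
def FixedResidueFace : Prop :=
  ∀ c : ℤ, c ≠ 0 → ∀ δ : ℝ, 0 < δ → δ ≤ 1 / 12 → ∀ C : ℝ, 0 < C → ∃ x₀ : ℝ, ∀ x : ℝ, x₀ ≤ x →
    ∀ A : ℝ, x ^ δ ≤ A → A ≤ x ^ (1 / 3 + δ) →
      (∑ b ∈ Icc 1 ⌊x / A⌋₊, |colSum lam c ⌊A⌋₊ ⌊2 * A⌋₊ b|) ≤ x / Real.log x ^ C

/-- **`TableChowla → FixedResidueFace`** (crux at level `4C + 4`, then `(Σ|G|)² ≤ 2x²/(log x)^{2C+2}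
≤ (x/(log x)^C)²` once `(log x)² ≥ 2`). -/
theorem fixedResidueFace_of_tableChowla (h : LiouvilleShiftedTables.TableChowla) :
    FixedResidueFace := by
  intro c hc δ hδ hδ' C hC
  obtain ⟨x₀, hx₀⟩ := (tableChowla_iff.mp h) c hc δ hδ hδ' (4 * C + 4) (by positivity)
  obtain ⟨X, hX⟩ := eventually_rpow_log_ge hC 0
  refine ⟨max x₀ (max X 1), fun x hx A hA hA' => ?_⟩
  have hx₀x : x₀ ≤ x := le_trans (le_max_left _ _) hx
  have hxX : X ≤ x := le_trans (le_trans (le_max_left _ _) (le_max_right _ _)) hx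
  have hx1 : 1 ≤ x := le_trans (le_trans (le_max_right _ _) (le_max_right _ _)) hx
  have hxpos : 0 < x := by linarith
  obtain ⟨_, hlog2⟩ := hX x hxX
  have hlogpos : 0 < Real.log x := by linarith
  set L : ℝ := Real.log x ^ C with hL
  have hLpos : 0 < L := Real.rpow_pos_of_pos hlogpos C
  obtain ⟨hRB, _⟩ := rows_mul_cols_le_window hx1 hδ.le (by linarith) hA hA'
  have key := hx₀ x hx₀x A hA hA'
  -- √T ≤ x / (L² (log x)²)
  have hpow : Real.log x ^ (4 * C + 4) = (L ^ 2 * Real.log x ^ 2) ^ 2 := by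
    rw [hL, show (4 : ℝ) * C + 4 = (C + C + 1 + 1) + (C + C + 1 + 1) by ring,
      Real.rpow_add hlogpos, Real.rpow_add hlogpos, Real.rpow_add hlogpos, Real.rpow_add hlogpos,
      Real.rpow_one]
    ring
  have hsqrtT : Real.sqrt (moment lam c x A) ≤ x / (L ^ 2 * Real.log x ^ 2) := by
    rw [hpow] at key
    calc Real.sqrt (moment lam c x A) ≤ Real.sqrt (x ^ 2 / (L ^ 2 * Real.log x ^ 2) ^ 2) :=
          Real.sqrt_le_sqrt key
      _ = x / (L ^ 2 * Real.log x ^ 2) := by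
          rw [← div_pow, Real.sqrt_sq (by positivity)]
  have hcs := sq_sum_abs_colSum_le (f := lam) (c := c) (A₁ := ⌊A⌋₊) (A₂ := ⌊2 * A⌋₊) (B := ⌊x / A⌋₊)
  rw [Nat.card_Ioc] at hcs
  have hmom : momentN lam c ⌊A⌋₊ ⌊2 * A⌋₊ ⌊x / A⌋₊ = moment lam c x A := rfl
  rw [hmom] at hcs
  -- (Σ|G|)² ≤ B rows √T ≤ 2x · x/(L² log²) ≤ (x/L)²
  have hbound : (∑ b ∈ Icc 1 ⌊x / A⌋₊, |colSum lam c ⌊A⌋₊ ⌊2 * A⌋₊ b|) ^ 2 ≤ (x / L) ^ 2 := by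
    calc (∑ b ∈ Icc 1 ⌊x / A⌋₊, |colSum lam c ⌊A⌋₊ ⌊2 * A⌋₊ b|) ^ 2
        ≤ (⌊x / A⌋₊ : ℝ) * ((⌊2 * A⌋₊ - ⌊A⌋₊ : ℕ) : ℝ) * Real.sqrt (moment lam c x A) := hcs
      _ ≤ (2 * x) * (x / (L ^ 2 * Real.log x ^ 2)) := by
          apply mul_le_mul _ hsqrtT (Real.sqrt_nonneg _) (by positivity)
          rw [mul_comm]; exact hRB
      _ ≤ (x / L) ^ 2 := by
          rw [div_pow, show (2 * x) * (x / (L ^ 2 * Real.log x ^ 2)) = x ^ 2 / L ^ 2 * (2 / Real.log x ^ 2) by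
            field_simp]
          apply mul_le_of_le_one_right (by positivity)
          rw [div_le_one (by positivity)]
          nlinarith
  have hnn : 0 ≤ ∑ b ∈ Icc 1 ⌊x / A⌋₊, |colSum lam c ⌊A⌋₊ ⌊2 * A⌋₊ b| :=
    sum_nonneg fun _ _ => abs_nonneg _
  exact (pow_le_pow_iff_left₀ hnn (by positivity) two_ne_zero).mp hbound


/-! ## (g′) IDEATOR 1's card `pivot-pair-level-half` (`SketchIdeator1.lean`): its provable-now
pieces PROVED (`Alignment`, `NearDiagonalNegligible`, `ShadowOfTable`), its composition
`PivotAssembly` PROVED, and the COSTUME made exact: the residual transfer target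
`PairFamilyLevel` is EQUIVALENT to the crux (`Ideator1Copy.pairFamilyLevel_iff`) — aligning by
`λ(a')λ(ab+c) = λ(aa'b + a'c)` and discarding the band `|a−a'| ≤ (log x)^{2C}` changes nothing;
the card's genuine content is therefore entirely in the model/large-conductor SPLIT it proposes
for `PairFamilyLevel` (first lemma `AvgTwistedChowlaLog 1/3`, not attacked here), not in the
reformulation. Definitions below are VERBATIM copies (namespace `Ideator1Copy`). -/

namespace Ideator1Copy

/-- VERBATIM from `SketchIdeator1.lean`. -/
def lam (z : ℤ) : ℝ := (ArithmeticFunction.liouville (Int.toNat z) : ℝ)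

/-- VERBATIM from `SketchIdeator1.lean`. -/
def Alignment : Prop :=
  ∀ a a' b : ℕ, ∀ c : ℤ, 1 ≤ a → 1 ≤ a' → 1 ≤ b → 1 ≤ (a : ℤ) * b + c →
    lam a' * lam ((a : ℤ) * b + c) = lam ((a : ℤ) * a' * b + a' * c)

/-- VERBATIM from `SketchIdeator1.lean`. -/
def NearDiagonalNegligible : Prop :=
  ∀ c : ℤ, ∀ A B H : ℝ, 1 ≤ A → 1 ≤ B → 0 ≤ H →
    (∑ a ∈ Ioc ⌊A⌋₊ ⌊2 * A⌋₊, ∑ a' ∈ (Ioc ⌊A⌋₊ ⌊2 * A⌋₊).filter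
        (fun a' : ℕ => |(a' : ℝ) - a| ≤ H),
      (∑ b ∈ Icc 1 ⌊B⌋₊, lam ((a : ℤ) * b + c) * lam ((a' : ℤ) * b + c)) ^ 2) ≤
      (2 * H + 1) * (A + 1) * B ^ 2

/-- VERBATIM from `SketchIdeator1.lean` (the card's residual transfer target). -/
def PairFamilyLevel : Prop :=
  ∀ c : ℤ, c ≠ 0 → ∀ δ : ℝ, 0 < δ → δ ≤ 1 / 12 → ∀ C : ℝ, 0 < C → ∃ x₀ : ℝ, ∀ x : ℝ, x₀ ≤ x →
    ∀ A : ℝ, x ^ δ ≤ A → A ≤ x ^ (1 / 3 + δ) →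
    (∑ a ∈ Ioc ⌊A⌋₊ ⌊2 * A⌋₊, ∑ a' ∈ (Ioc ⌊A⌋₊ ⌊2 * A⌋₊).filter
        (fun a' : ℕ => Real.log x ^ (2 * C) < |(a' : ℝ) - a|),
      (∑ b ∈ Icc 1 ⌊x / A⌋₊,
        lam ((a : ℤ) * a' * b + a' * c) * lam ((a : ℤ) * a' * b + a * c)) ^ 2) ≤
      x ^ 2 / Real.log x ^ C

/-- VERBATIM from `SketchIdeator1.lean`. -/
def PivotAssembly : Prop :=
  Alignment → NearDiagonalNegligible → PairFamilyLevel →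
    Summit.Parity.GeneralizedHardyLittlewood.Theses.LiouvilleShiftedTables.TableChowla

/-- VERBATIM from `SketchIdeator1.lean` (the ℓ² transposed shadow). -/
def ColumnFirstMoment : Prop :=
  ∀ c : ℤ, c ≠ 0 → ∀ δ : ℝ, 0 < δ → δ ≤ 1 / 12 → ∀ C : ℝ, 0 < C → ∃ x₀ : ℝ, ∀ x : ℝ, x₀ ≤ x →
    ∀ A : ℝ, x ^ δ ≤ A → A ≤ x ^ (1 / 3 + δ) →
    (∑ b ∈ Icc 1 ⌊x / A⌋₊, (∑ a ∈ Ioc ⌊A⌋₊ ⌊2 * A⌋₊, lam ((a : ℤ) * b + c)) ^ 2) ≤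
      A * x / Real.log x ^ C

/-- VERBATIM from `SketchIdeator1.lean`. -/
def ShadowOfTable : Prop :=
  Summit.Parity.GeneralizedHardyLittlewood.Theses.LiouvilleShiftedTables.TableChowla →
    ColumnFirstMoment

/-- The card's `lam` at a shifted-product argument is this file's table entry (definitionally). -/
theorem lam_eq (z : ℤ) : lam z = Disproof.lam (Int.toNat z) := rfl

/-- `Alignment` HOLDS (complete multiplicativity; `Int.toNat` is harmless at positive arguments). -/
theorem alignment_holds : Alignment := by
  intro a a' b c _ _ _ hpos
  have hnn : 0 ≤ (a : ℤ) * b + c := by linarith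
  have e1 : ((a : ℤ) * a' * b + a' * c) = (a' : ℤ) * ((a : ℤ) * b + c) := by ring
  have e2 : (a' : ℤ) * ((a : ℤ) * b + c) = ((a' * Int.toNat ((a : ℤ) * b + c) : ℕ) : ℤ) := by
    push_cast; rw [Int.toNat_of_nonneg hnn]
  rw [e1, e2]
  simp only [lam, Int.toNat_natCast]
  rw [liouville_apply_mul]
  push_cast
  ring

/-- Row-neighbourhood count: at most `2H + 1` rows `a'` with `|a' − a| ≤ H`. -/
theorem card_near_le (S : Finset ℕ) (a : ℕ) {H : ℝ} (hH : 0 ≤ H) :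
    ((S.filter (fun a' : ℕ => |(a' : ℝ) - a| ≤ H)).card : ℝ) ≤ 2 * H + 1 := by
  have hsub : S.filter (fun a' : ℕ => |(a' : ℝ) - a| ≤ H) ⊆ Icc (a - ⌊H⌋₊) (a + ⌊H⌋₊) := by
    intro a' ha'
    rw [mem_filter] at ha'
    obtain ⟨h1, h2⟩ := abs_le.mp ha'.2
    rw [mem_Icc]
    constructor
    · -- a ≤ a' + ⌊H⌋
      by_cases hle : a ≤ a'
      · omega
      · have hlt : a' < a := lt_of_not_ge hle
        have hd : ((a - a' : ℕ) : ℝ) ≤ H := by push_cast [hlt.le]; linarith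
        have := Nat.le_floor hd
        omega
    · by_cases hle : a' ≤ a
      · omega
      · have hlt : a < a' := lt_of_not_ge hle
        have hd : ((a' - a : ℕ) : ℝ) ≤ H := by push_cast [hlt.le]; linarith
        have := Nat.le_floor hd
        omega
  have hfl : (⌊H⌋₊ : ℝ) ≤ H := Nat.floor_le hH
  calc ((S.filter (fun a' : ℕ => |(a' : ℝ) - a| ≤ H)).card : ℝ)
      ≤ ((Icc (a - ⌊H⌋₊) (a + ⌊H⌋₊)).card : ℝ) := by exact_mod_cast card_le_card hsub
    _ ≤ 2 * ⌊H⌋₊ + 1 := by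
        rw [Nat.card_Icc]
        have : a + ⌊H⌋₊ + 1 - (a - ⌊H⌋₊) ≤ 2 * ⌊H⌋₊ + 1 := by omega
        exact_mod_cast this
    _ ≤ 2 * H + 1 := by linarith

/-- `NearDiagonalNegligible` HOLDS (trivial bound `S² ≤ B²`, `≤ 2H+1` neighbours, `≤ A+1` rows). -/
theorem nearDiagonalNegligible_holds : NearDiagonalNegligible := by
  intro c A B H hA hB hH
  have hApos : 0 < A := by linarith
  have hrows : ((Ioc ⌊A⌋₊ ⌊2 * A⌋₊).card : ℝ) ≤ A + 1 := by
    rw [Nat.card_Ioc, Nat.cast_sub (Nat.floor_le_floor (by linarith : A ≤ 2 * A))]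
    have h1 : (⌊2 * A⌋₊ : ℝ) ≤ 2 * A := Nat.floor_le (by linarith)
    have h2 : A - 1 < (⌊A⌋₊ : ℝ) := by have := Nat.lt_floor_add_one A; linarith
    linarith
  have hBfl : (⌊B⌋₊ : ℝ) ≤ B := Nat.floor_le (by linarith)
  have hterm : ∀ a a' : ℕ, (∑ b ∈ Icc 1 ⌊B⌋₊, lam ((a : ℤ) * b + c) * lam ((a' : ℤ) * b + c)) ^ 2 ≤ B ^ 2 := by
    intro a a'
    have hb := abs_rowCorr_le (c := c) (B := ⌊B⌋₊) abs_lam_le_one a a'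
    have hS : (∑ b ∈ Icc 1 ⌊B⌋₊, lam ((a : ℤ) * b + c) * lam ((a' : ℤ) * b + c)) =
        rowCorr Disproof.lam c ⌊B⌋₊ a a' := rfl
    rw [hS]
    have h1 := (abs_le.mp hb).1
    have h2 := (abs_le.mp hb).2
    exact sq_le_sq' (by linarith) (by linarith)
  calc (∑ a ∈ Ioc ⌊A⌋₊ ⌊2 * A⌋₊, ∑ a' ∈ (Ioc ⌊A⌋₊ ⌊2 * A⌋₊).filter
          (fun a' : ℕ => |(a' : ℝ) - a| ≤ H),
        (∑ b ∈ Icc 1 ⌊B⌋₊, lam ((a : ℤ) * b + c) * lam ((a' : ℤ) * b + c)) ^ 2)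
      ≤ ∑ a ∈ Ioc ⌊A⌋₊ ⌊2 * A⌋₊, ∑ _a' ∈ (Ioc ⌊A⌋₊ ⌊2 * A⌋₊).filter
          (fun a' : ℕ => |(a' : ℝ) - a| ≤ H), B ^ 2 :=
        sum_le_sum fun a _ => sum_le_sum fun a' _ => hterm a a'
    _ ≤ ∑ _a ∈ Ioc ⌊A⌋₊ ⌊2 * A⌋₊, (2 * H + 1) * B ^ 2 := by
        refine sum_le_sum fun a _ => ?_
        rw [sum_const, nsmul_eq_mul]
        exact mul_le_mul_of_nonneg_right (card_near_le _ a hH) (sq_nonneg _)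
    _ = ((Ioc ⌊A⌋₊ ⌊2 * A⌋₊).card : ℝ) * ((2 * H + 1) * B ^ 2) := by rw [sum_const, nsmul_eq_mul]
    _ ≤ (A + 1) * ((2 * H + 1) * B ^ 2) := mul_le_mul_of_nonneg_right hrows (by positivity)
    _ = (2 * H + 1) * (A + 1) * B ^ 2 := by ring

/-- In the window with `|c| + 1 ≤ A`, the card's aligned pair sum squared is `S(a,a')²`. -/
theorem aligned_sq_eq {c : ℤ} {A : ℝ} (hcA : (|c| : ℝ) + 1 ≤ A) {a a' : ℕ}
    (ha : a ∈ Ioc ⌊A⌋₊ ⌊2 * A⌋₊) (ha' : a' ∈ Ioc ⌊A⌋₊ ⌊2 * A⌋₊) (Bn : ℕ) :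
    (∑ b ∈ Icc 1 Bn, lam ((a : ℤ) * a' * b + a' * c) * lam ((a : ℤ) * a' * b + a * c)) ^ 2 =
      rowCorr Disproof.lam c Bn a a' ^ 2 := by
  have ha1 : 1 ≤ a := by rw [mem_Ioc] at ha; omega
  have ha'1 : 1 ≤ a' := by rw [mem_Ioc] at ha'; omega
  have hal := alignment_holds
  have hsum : (∑ b ∈ Icc 1 Bn, lam ((a : ℤ) * a' * b + a' * c) * lam ((a : ℤ) * a' * b + a * c)) =
      lam a' * lam a * rowCorr Disproof.lam c Bn a a' := by
    unfold rowCorr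
    rw [mul_sum]
    refine sum_congr rfl fun b hb => ?_
    have hb1 : 1 ≤ b := (mem_Icc.mp hb).1
    have hpos : 1 ≤ (a : ℤ) * b + c := one_le_arg_of_window (A₂ := ⌊2 * A⌋₊) hcA ha hb
    have hpos' : 1 ≤ (a' : ℤ) * b + c := one_le_arg_of_window (A₂ := ⌊2 * A⌋₊) hcA ha' hb
    rw [← hal a a' b c ha1 ha'1 hb1 hpos, show ((a : ℤ) * a' * b + a * c) = ((a' : ℤ) * a * b + a * c) by ring,
      ← hal a' a b c ha'1 ha1 hb1 hpos']
    simp only [lam_eq, Int.toNat_natCast]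
    ring
  rw [hsum, mul_pow, mul_pow]
  have h1 : lam a' ^ 2 = 1 := by rw [lam_eq, Int.toNat_natCast]; exact lam_sq (by omega)
  have h2 : lam a ^ 2 = 1 := by rw [lam_eq, Int.toNat_natCast]; exact lam_sq (by omega)
  rw [h1, h2, one_mul, one_mul]

/-- `TableChowla → PairFamilyLevel` (same `C`: drop the near pairs, align). -/
theorem pairFamilyLevel_of_tableChowla (h : LiouvilleShiftedTables.TableChowla) : PairFamilyLevel := by
  intro c hc δ hδ hδ' C hC
  obtain ⟨x₀, hx₀⟩ := (tableChowla_iff.mp h) c hc δ hδ hδ' C hC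
  -- beyond x₁, x^δ ≥ |c| + 1
  refine ⟨max x₀ (max 1 (((|c| : ℝ) + 1) ^ (1 / δ))), fun x hx A hA hA' => ?_⟩
  have hx₀x : x₀ ≤ x := le_trans (le_max_left _ _) hx
  have hx1 : 1 ≤ x := le_trans (le_trans (le_max_left _ _) (le_max_right _ _)) hx
  have hxc : ((|c| : ℝ) + 1) ^ (1 / δ) ≤ x := le_trans (le_trans (le_max_right _ _) (le_max_right _ _)) hx
  have hcA : (|c| : ℝ) + 1 ≤ A := by
    refine le_trans ?_ hA
    calc (|c| : ℝ) + 1 = (((|c| : ℝ) + 1) ^ (1 / δ)) ^ δ := by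
          rw [← Real.rpow_mul (by positivity), one_div_mul_cancel hδ.ne', Real.rpow_one]
      _ ≤ x ^ δ := Real.rpow_le_rpow (by positivity) hxc hδ.le
  have key := hx₀ x hx₀x A hA hA'
  refine le_trans ?_ key
  show _ ≤ momentN Disproof.lam c ⌊A⌋₊ ⌊2 * A⌋₊ ⌊x / A⌋₊
  unfold momentN
  refine sum_le_sum fun a ha => ?_
  rw [sum_filter]
  refine sum_le_sum fun a' ha' => ?_
  split_ifs
  · rw [aligned_sq_eq hcA ha ha']
  · exact sq_nonneg _

/-- `PairFamilyLevel → TableChowla` (level `C + 1` for the far pairs; the near band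
`|a − a'| ≤ (log x)^{2C+2}` costs `≤ (2(log x)^{2C+2} + 1)(A+1)(x/A)² ≤ x²/(2(log x)^C)` eventually). -/
theorem tableChowla_of_pairFamilyLevel (h : PairFamilyLevel) : LiouvilleShiftedTables.TableChowla := by
  rw [tableChowla_iff]
  intro c hc δ hδ hδ' C hC
  obtain ⟨x₀, hx₀⟩ := h c hc δ hδ hδ' (C + 1) (by linarith)
  obtain ⟨X₁, hX₁⟩ := eventually_log_rpow_le hδ (3 * C + 3)
  refine ⟨max (max x₀ (((|c| : ℝ) + 1) ^ (1 / δ))) (max X₁ (Real.exp 3)), fun x hx A hA hA' => ?_⟩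
  have hx₀x : x₀ ≤ x := le_trans (le_trans (le_max_left _ _) (le_max_left _ _)) hx
  have hxc : ((|c| : ℝ) + 1) ^ (1 / δ) ≤ x := le_trans (le_trans (le_max_right _ _) (le_max_left _ _)) hx
  have hxX₁ : X₁ ≤ x := le_trans (le_trans (le_max_left _ _) (le_max_right _ _)) hx
  have hxe : Real.exp 3 ≤ x := le_trans (le_trans (le_max_right _ _) (le_max_right _ _)) hx
  have hxpos : 0 < x := (Real.exp_pos 3).trans_le hxe
  have hx1 : 1 ≤ x := by have := Real.add_one_le_exp (3 : ℝ); linarith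
  have hlog3 : (3 : ℝ) ≤ Real.log x := (Real.le_log_iff_exp_le hxpos).mpr hxe
  obtain ⟨h4, hlog2⟩ := hX₁ x hxX₁
  have hlogpos : 0 < Real.log x := by linarith
  have hAone : 1 ≤ A := le_trans (Real.one_le_rpow hx1 hδ.le) hA
  have hApos : 0 < A := by linarith
  have hcA : (|c| : ℝ) + 1 ≤ A := by
    refine le_trans ?_ hA
    calc (|c| : ℝ) + 1 = (((|c| : ℝ) + 1) ^ (1 / δ)) ^ δ := by
          rw [← Real.rpow_mul (by positivity), one_div_mul_cancel hδ.ne', Real.rpow_one]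
      _ ≤ x ^ δ := Real.rpow_le_rpow (by positivity) hxc hδ.le
  set S : Finset ℕ := Ioc ⌊A⌋₊ ⌊2 * A⌋₊ with hS
  set Bn : ℕ := ⌊x / A⌋₊ with hBn
  set Hr : ℝ := Real.log x ^ (2 * (C + 1)) with hHr
  have hHr0 : 0 ≤ Hr := by positivity
  -- far part from the hypothesis
  have hfar := hx₀ x hx₀x A hA hA'
  rw [← hHr, ← hS, ← hBn] at hfar
  have hfar' : ∑ a ∈ S, ∑ a' ∈ S.filter (fun a' : ℕ => Hr < |(a' : ℝ) - a|), rowCorr Disproof.lam c Bn a a' ^ 2 ≤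
      x ^ 2 / Real.log x ^ (C + 1) := by
    refine le_trans (le_of_eq ?_) hfar
    refine sum_congr rfl fun a ha => sum_congr rfl fun a' ha' => ?_
    rw [aligned_sq_eq hcA ha (mem_filter.mp ha').1]
  -- near part, trivially
  have hnear := nearDiagonalNegligible_holds c A (x / A) Hr hAone
    (by rw [le_div_iff₀ hApos, one_mul]; exact hA'.trans (by
      calc x ^ (1 / 3 + δ) ≤ x ^ (1 : ℝ) := Real.rpow_le_rpow_of_exponent_le hx1 (by linarith)
        _ = x := Real.rpow_one x)) hHr0
  rw [← hS, ← hBn] at hnear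
  have hnear' : ∑ a ∈ S, ∑ a' ∈ S.filter (fun a' : ℕ => |(a' : ℝ) - a| ≤ Hr), rowCorr Disproof.lam c Bn a a' ^ 2 ≤
      (2 * Hr + 1) * (A + 1) * (x / A) ^ 2 := hnear
  -- split T
  have hT : momentN Disproof.lam c ⌊A⌋₊ ⌊2 * A⌋₊ Bn =
      ∑ a ∈ S, ∑ a' ∈ S.filter (fun a' : ℕ => |(a' : ℝ) - a| ≤ Hr), rowCorr Disproof.lam c Bn a a' ^ 2 +
      ∑ a ∈ S, ∑ a' ∈ S.filter (fun a' : ℕ => Hr < |(a' : ℝ) - a|), rowCorr Disproof.lam c Bn a a' ^ 2 := by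
    unfold momentN
    rw [← hS, ← sum_add_distrib]
    refine sum_congr rfl fun a _ => ?_
    rw [← sum_filter_add_sum_filter_not S (fun a' : ℕ => |(a' : ℝ) - a| ≤ Hr)]
    congr 1
    refine sum_congr ?_ fun _ _ => rfl
    ext a'; simp only [mem_filter, not_le]
  -- sizes: (2Hr+1)(A+1)(x/A)² ≤ 3Hr · 2A · x²/A² = 6 Hr x²/A ≤ 6 Hr x²/x^δ, and Hr·(stuff) vs h4
  have hHr1 : 1 ≤ Hr := by rw [hHr]; exact Real.one_le_rpow (by linarith) (by positivity)
  have hnearbound : (2 * Hr + 1) * (A + 1) * (x / A) ^ 2 ≤ 6 * Hr * x ^ 2 / x ^ δ := by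
    calc (2 * Hr + 1) * (A + 1) * (x / A) ^ 2 ≤ (3 * Hr) * (2 * A) * (x / A) ^ 2 := by
          apply mul_le_mul_of_nonneg_right _ (sq_nonneg _)
          exact mul_le_mul (by linarith) (by linarith) (by linarith) (by positivity)
      _ = 6 * Hr * x ^ 2 / A := by field_simp; norm_num
      _ ≤ 6 * Hr * x ^ 2 / x ^ δ := div_le_div_of_nonneg_left (by positivity) (by positivity) hA
  -- Hr · log^(C+1) = log^(3C+3); h4 : 4 log^(3C+3) ≤ x^δ
  set L : ℝ := Real.log x ^ C with hL
  have hLpos : 0 < L := Real.rpow_pos_of_pos hlogpos C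
  have hprod : Hr * (L * Real.log x) = Real.log x ^ (3 * C + 3) := by
    rw [hHr, hL, ← Real.rpow_one (Real.log x), ← Real.rpow_mul hlogpos.le, ← Real.rpow_mul hlogpos.le,
      ← Real.rpow_add hlogpos, ← Real.rpow_add hlogpos, Real.rpow_one]
    ring_nf
  have t1 : 6 * Hr * x ^ 2 / x ^ δ ≤ x ^ 2 / (2 * L) := by
    rw [div_le_div_iff₀ (by positivity) (by positivity)]
    -- 6 Hr x² · 2L ≤ x² x^δ  ⟸ 12 Hr L ≤ x^δ ⟸ 12 Hr L ≤ 4 Hr L log x = 4 log^(3C+3) ≤ x^δ (log x ≥ 3)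
    nlinarith [mul_le_mul_of_nonneg_right h4 (sq_nonneg x), hprod, mul_nonneg (mul_nonneg hHr0 hLpos.le) (sq_nonneg x),
      mul_le_mul_of_nonneg_left hlog3 (mul_nonneg (mul_nonneg hHr0 hLpos.le) (sq_nonneg x))]
  have t2 : x ^ 2 / Real.log x ^ (C + 1) ≤ x ^ 2 / (2 * L) := by
    rw [Real.rpow_add hlogpos, Real.rpow_one, ← hL]
    apply div_le_div_of_nonneg_left (by positivity) (by positivity)
    nlinarith
  have t5 : x ^ 2 / (2 * L) + x ^ 2 / (2 * L) = x ^ 2 / L := by field_simp; ring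
  show momentN Disproof.lam c ⌊A⌋₊ ⌊2 * A⌋₊ ⌊x / A⌋₊ ≤ x ^ 2 / L
  rw [← hBn, hT]
  linarith

/-- Hence the card's composition `PivotAssembly` HOLDS — with its first two hypotheses discharged
outright, it is just `PairFamilyLevel → TableChowla`. -/
theorem pivotAssembly_holds : PivotAssembly := fun _ _ h => tableChowla_of_pairFamilyLevel h

/-- **COSTUME, exact**: the card's residual transfer target is EQUIVALENT to the crux. -/
theorem pairFamilyLevel_iff : PairFamilyLevel ↔ LiouvilleShiftedTables.TableChowla :=
  ⟨tableChowla_of_pairFamilyLevel, pairFamilyLevel_of_tableChowla⟩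

/-- `ShadowOfTable` HOLDS (the ℓ² transposed shadow: `Σ_b G(b)² = Σ_{a,a'} S ≤ rows·√T`, crux at
level `2C + 2`). -/
theorem shadowOfTable_holds : ShadowOfTable := by
  intro h c hc δ hδ hδ' C hC
  obtain ⟨x₀, hx₀⟩ := (tableChowla_iff.mp h) c hc δ hδ hδ' (2 * C + 2) (by positivity)
  obtain ⟨X, hX⟩ := eventually_rpow_log_ge hC 0
  refine ⟨max x₀ (max X 1), fun x hx A hA hA' => ?_⟩
  have hx₀x : x₀ ≤ x := le_trans (le_max_left _ _) hx
  have hxX : X ≤ x := le_trans (le_trans (le_max_left _ _) (le_max_right _ _)) hx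
  have hx1 : 1 ≤ x := le_trans (le_trans (le_max_right _ _) (le_max_right _ _)) hx
  have hxpos : 0 < x := by linarith
  obtain ⟨_, hlog2⟩ := hX x hxX
  have hlogpos : 0 < Real.log x := by linarith
  have hAone : 1 ≤ A := le_trans (Real.one_le_rpow hx1 hδ.le) hA
  have hApos : 0 < A := by linarith
  set L : ℝ := Real.log x ^ C with hL
  have hLpos : 0 < L := Real.rpow_pos_of_pos hlogpos C
  have key := hx₀ x hx₀x A hA hA'
  have hpow : Real.log x ^ (2 * C + 2) = (L * Real.log x) ^ 2 := by
    rw [hL, show (2 : ℝ) * C + 2 = (C + 1) + (C + 1) by ring, Real.rpow_add hlogpos,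
      Real.rpow_add hlogpos, Real.rpow_one]
    ring
  have hsqrtT : Real.sqrt (moment Disproof.lam c x A) ≤ x / (L * Real.log x) := by
    rw [hpow] at key
    calc Real.sqrt (moment Disproof.lam c x A) ≤ Real.sqrt (x ^ 2 / (L * Real.log x) ^ 2) :=
          Real.sqrt_le_sqrt key
      _ = x / (L * Real.log x) := by rw [← div_pow, Real.sqrt_sq (by positivity)]
  have hrows : ((Ioc ⌊A⌋₊ ⌊2 * A⌋₊).card : ℝ) ≤ 2 * A := by
    rw [Nat.card_Ioc, Nat.cast_sub (Nat.floor_le_floor (by linarith : A ≤ 2 * A))]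
    have h1 : (⌊2 * A⌋₊ : ℝ) ≤ 2 * A := Nat.floor_le (by linarith)
    have h2 : A - 1 < (⌊A⌋₊ : ℝ) := by have := Nat.lt_floor_add_one A; linarith
    linarith
  -- Σ_b G² = Σ_{a,a'} S ≤ rows √T
  have hG : (∑ b ∈ Icc 1 ⌊x / A⌋₊, (∑ a ∈ Ioc ⌊A⌋₊ ⌊2 * A⌋₊, lam ((a : ℤ) * b + c)) ^ 2) =
      ∑ b ∈ Icc 1 ⌊x / A⌋₊, colSum Disproof.lam c ⌊A⌋₊ ⌊2 * A⌋₊ b ^ 2 := rfl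
  rw [hG, sum_colSum_sq]
  have hT0 : 0 ≤ moment Disproof.lam c x A := momentN_nonneg
  have h3 : (∑ a ∈ Ioc ⌊A⌋₊ ⌊2 * A⌋₊, ∑ a' ∈ Ioc ⌊A⌋₊ ⌊2 * A⌋₊, rowCorr Disproof.lam c ⌊x / A⌋₊ a a') ^ 2 ≤
      (((Ioc ⌊A⌋₊ ⌊2 * A⌋₊).card : ℝ) * Real.sqrt (moment Disproof.lam c x A)) ^ 2 := by
    have hcs := sum_mul_sq_le_sq_mul_sq (Ioc ⌊A⌋₊ ⌊2 * A⌋₊ ×ˢ Ioc ⌊A⌋₊ ⌊2 * A⌋₊) (fun _ => (1 : ℝ))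
      (fun p => rowCorr Disproof.lam c ⌊x / A⌋₊ p.1 p.2)
    have e1 : ∑ p ∈ Ioc ⌊A⌋₊ ⌊2 * A⌋₊ ×ˢ Ioc ⌊A⌋₊ ⌊2 * A⌋₊, (1 : ℝ) * rowCorr Disproof.lam c ⌊x / A⌋₊ p.1 p.2 =
        ∑ a ∈ Ioc ⌊A⌋₊ ⌊2 * A⌋₊, ∑ a' ∈ Ioc ⌊A⌋₊ ⌊2 * A⌋₊, rowCorr Disproof.lam c ⌊x / A⌋₊ a a' := by
      rw [sum_product]; simp
    have e2 : ∑ p ∈ Ioc ⌊A⌋₊ ⌊2 * A⌋₊ ×ˢ Ioc ⌊A⌋₊ ⌊2 * A⌋₊, rowCorr Disproof.lam c ⌊x / A⌋₊ p.1 p.2 ^ 2 =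
        moment Disproof.lam c x A := by
      unfold moment momentN; rw [sum_product]
    have e3 : ∑ _p ∈ Ioc ⌊A⌋₊ ⌊2 * A⌋₊ ×ˢ Ioc ⌊A⌋₊ ⌊2 * A⌋₊, (1 : ℝ) ^ 2 =
        ((Ioc ⌊A⌋₊ ⌊2 * A⌋₊).card : ℝ) ^ 2 := by simp [card_product, sq]
    rw [e1, e2, e3] at hcs
    rw [mul_pow, Real.sq_sqrt hT0]
    exact hcs
  have h4 := (abs_le_of_sq_le_sq' h3 (by positivity)).2
  calc ∑ a ∈ Ioc ⌊A⌋₊ ⌊2 * A⌋₊, ∑ a' ∈ Ioc ⌊A⌋₊ ⌊2 * A⌋₊, rowCorr Disproof.lam c ⌊x / A⌋₊ a a'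
      ≤ ((Ioc ⌊A⌋₊ ⌊2 * A⌋₊).card : ℝ) * Real.sqrt (moment Disproof.lam c x A) := h4
    _ ≤ (2 * A) * (x / (L * Real.log x)) := mul_le_mul hrows hsqrtT (Real.sqrt_nonneg _) (by positivity)
    _ ≤ A * x / L := by
        rw [show (2 * A) * (x / (L * Real.log x)) = A * x / L * (2 / Real.log x) by field_simp]
        apply mul_le_of_le_one_right (by positivity)
        rw [div_le_one hlogpos]; exact hlog2

end Ideator1Copy


/-! ## (k) THE `δ`-PARAMETRISATION IS COSMETIC: the crux is one statement about the full window
`A ∈ [x^σ, x^{5/12}]`, `σ > 0` arbitrary (cover `[σ, 5/12]` by the two `δ`-windows `δ = min σ (1/12)`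
and `δ = 1/12`). Planners may split the crux by ranges of `log A / log x` freely. -/

/-- The crux over the full window `[x^σ, x^{5/12}]` for every `σ > 0`. -/
def TableChowlaFullWindow : Prop :=
  ∀ c : ℤ, c ≠ 0 → ∀ σ : ℝ, 0 < σ → σ ≤ 5 / 12 → ∀ C : ℝ, 0 < C → ∃ x₀ : ℝ, ∀ x : ℝ, x₀ ≤ x →
    ∀ A : ℝ, x ^ σ ≤ A → A ≤ x ^ ((5 : ℝ) / 12) → moment lam c x A ≤ x ^ 2 / Real.log x ^ C

/-- EQUIVALENT FORM 6: `TableChowla ↔ TableChowlaFullWindow`. -/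
theorem tableChowla_iff_fullWindow : LiouvilleShiftedTables.TableChowla ↔ TableChowlaFullWindow := by
  rw [tableChowla_iff]
  constructor
  · intro h c hc σ hσ hσ' C hC
    -- window 1: δ₁ = min σ (1/12); window 2: δ₂ = 1/12
    obtain ⟨x₁, hx₁⟩ := h c hc (min σ (1 / 12)) (lt_min hσ (by norm_num)) (min_le_right _ _) C hC
    obtain ⟨x₂, hx₂⟩ := h c hc (1 / 12) (by norm_num) le_rfl C hC
    refine ⟨max (max x₁ x₂) 1, fun x hx A hA hA' => ?_⟩
    have hxx₁ : x₁ ≤ x := le_trans (le_trans (le_max_left _ _) (le_max_left _ _)) hx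
    have hxx₂ : x₂ ≤ x := le_trans (le_trans (le_max_right _ _) (le_max_left _ _)) hx
    have hx1 : 1 ≤ x := le_trans (le_max_right _ _) hx
    rcases le_or_gt (x ^ ((1 : ℝ) / 12)) A with hbig | hsmall
    · -- A ∈ [x^{1/12}, x^{5/12}]: window 2
      exact hx₂ x hxx₂ A hbig (by rw [show (1 : ℝ) / 3 + 1 / 12 = 5 / 12 by norm_num]; exact hA')
    · -- A < x^{1/12}: then σ < 1/12 effectively; window 1 with δ₁ = min σ (1/12) ≤ σ
      refine hx₁ x hxx₁ A (le_trans (Real.rpow_le_rpow_of_exponent_le hx1 (min_le_left _ _)) hA) ?_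
      refine hsmall.le.trans (Real.rpow_le_rpow_of_exponent_le hx1 ?_)
      have : (0 : ℝ) ≤ min σ (1 / 12) := le_min hσ.le (by norm_num)
      linarith
  · intro h c hc δ hδ hδ' C hC
    obtain ⟨x₀, hx₀⟩ := h c hc δ hδ (by linarith) C hC
    refine ⟨max x₀ 1, fun x hx A hA hA' => hx₀ x (le_trans (le_max_left _ _) hx) A hA ?_⟩
    have hx1 : 1 ≤ x := le_trans (le_max_right _ _) hx
    exact hA'.trans (Real.rpow_le_rpow_of_exponent_le hx1 (by linarith))


/-! ## (c″) THE SIEGEL GHOST IN GENERAL: for EVERY modulus `q ≥ 1` and every real-character-like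
`χ` mod `q` (q-periodic, completely multiplicative, `χ² = 𝟙_{(n,q)=1}` — all real Dirichlet
characters, principal ones included), `TableChowlaFor χ` FAILS at the shift `c = q` (rank-one
table `χ(ab+q) = χ(a)χ(b)`, `T = (φ(q)/q)⁴ x²`). So the crux for `λ` is exactly as strong as the
statement that `λ` does not mimic ANY real character of conductor dividing `c` on the scales of
the table, with a `(log x)^{C}` margin for every `C`: the Landau–Siegel input is unavoidable and
enters at every `q ∣ c`. -/

/-- Unit count in `k` consecutive blocks of length `q`: `Σ_{n ∈ [N, N+qk)} χ(n)² = k·φ(q)`. -/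
theorem sum_unitInd_Ico {q : ℕ} (χ : ℕ → ℝ) (hsq : ∀ n, χ n ^ 2 = if q.Coprime n then 1 else 0)
    (N k : ℕ) : ∑ n ∈ Ico N (N + q * k), χ n ^ 2 = k * Nat.totient q := by
  induction k with
  | zero => simp
  | succ k ih =>
    rw [show N + q * (k + 1) = (N + q * k) + q by ring,
      ← Finset.sum_Ico_consecutive _ (Nat.le_add_right N (q * k)) (Nat.le_add_right _ q), ih]
    have hblock : ∑ n ∈ Ico (N + q * k) (N + q * k + q), χ n ^ 2 = Nat.totient q := by
      simp_rw [hsq]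
      rw [Finset.sum_boole, Nat.filter_coprime_Ico_eq_totient]
    rw [hblock]
    push_cast
    ring

/-- **Every real character-like `χ` mod `q` fails the crux at the shift `c = q`.** -/
theorem not_tableChowlaFor_unitChar {q : ℕ} (hq : 1 ≤ q) (χ : ℕ → ℝ)
    (hper : ∀ n, χ (n + q) = χ n) (hmul : ∀ a b, χ (a * b) = χ a * χ b)
    (hsq : ∀ n, χ n ^ 2 = if q.Coprime n then 1 else 0) : ¬ TableChowlaFor χ := by
  intro h
  have hq0 : (q : ℤ) ≠ 0 := by exact_mod_cast (show q ≠ 0 by omega)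
  obtain ⟨x₀, hx₀⟩ := h q hq0 (1 / 12) (by norm_num) le_rfl 1 one_pos
  obtain ⟨n, hn⟩ := exists_nat_ge (max x₀ (max 2 (Real.exp ((q : ℝ) ^ 4))))
  have hnx : x₀ ≤ n := le_trans (le_max_left _ _) hn
  have hn2 : (2 : ℝ) ≤ n := le_trans (le_trans (le_max_left _ _) (le_max_right _ _)) hn
  have hne : Real.exp ((q : ℝ) ^ 4) ≤ n := le_trans (le_trans (le_max_right _ _) (le_max_right _ _)) hn
  have hnpos : (0 : ℝ) < n := by linarith
  have hq1 : (1 : ℝ) ≤ q := by exact_mod_cast hq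
  set m : ℕ := q * n with hm
  have hm1 : (1 : ℝ) ≤ m := by rw [hm]; push_cast; nlinarith
  have hm1' : 1 ≤ m := by exact_mod_cast hm1
  have hm0 : m ≠ 0 := by omega
  have hmpos : (0 : ℝ) < m := by linarith
  have hnm : (n : ℝ) ≤ m := by rw [hm]; push_cast; nlinarith
  have hxx₀ : x₀ ≤ (m : ℝ) ^ 12 := (hnx.trans hnm).trans (le_self_pow₀ hm1 (by norm_num))
  obtain ⟨hw1, hw2⟩ := window_pow (k := 12) (by norm_num) hm1'
  have key := hx₀ ((m : ℝ) ^ 12) hxx₀ m (by exact_mod_cast hw1) (by exact_mod_cast hw2)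
  rw [moment_pow χ q (by norm_num) hm0, momentN_of_rankOne (f := χ) (c := q) χ χ ?_,
    Real.rpow_one, Real.log_pow] at key
  swap
  · intro a _ b _
    rw [show ((a : ℤ) * (b : ℕ) + (q : ℕ)) = ((a * b + q : ℕ) : ℤ) by push_cast; ring, Int.toNat_natCast,
      hper, hmul]
  -- rows: Ioc m (2m) = Ico (m+1) (m+1 + q*n) ; cols: Icc 1 (m^11) = Ico 1 (1 + q*(q^10 n^11))
  have hrows : ∑ a ∈ Ioc m (2 * m), χ a ^ 2 = n * Nat.totient q := by
    have e : Ioc m (2 * m) = Ico (m + 1) ((m + 1) + q * n) := by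
      ext a; simp only [mem_Ioc, mem_Ico]; rw [← hm]; omega
    rw [e]
    exact sum_unitInd_Ico χ hsq _ _
  have hcols : ∑ b ∈ Icc 1 (m ^ (12 - 1)), χ b ^ 2 = ((q ^ 10 * n ^ 11 : ℕ) : ℝ) * Nat.totient q := by
    have e1 : m ^ (12 - 1) = q * (q ^ 10 * n ^ 11) := by rw [hm]; norm_num; ring
    have e : Icc 1 (m ^ (12 - 1)) = Ico 1 (1 + q * (q ^ 10 * n ^ 11)) := by
      rw [e1]; ext b; simp only [mem_Icc, mem_Ico]; omega
    rw [e]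
    exact_mod_cast sum_unitInd_Ico χ hsq 1 (q ^ 10 * n ^ 11)
  rw [hrows, hcols] at key
  push_cast at key
  -- sizes
  have hφ1 : (1 : ℝ) ≤ Nat.totient q := by exact_mod_cast Nat.totient_pos.mpr (by omega)
  set φr : ℝ := (Nat.totient q : ℝ) with hφr
  have hP : (0 : ℝ) < ((n : ℝ) * φr) ^ 2 * ((q : ℝ) ^ 10 * (n : ℝ) ^ 11 * φr) ^ 2 := by positivity
  refine absurd_of_le_div hP (κ := (q : ℝ) ^ 4 / φr ^ 4) ?_ (by positivity) ?_ key
  · rw [hm, div_mul_eq_mul_div, le_div_iff₀ (by positivity)]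
    push_cast
    apply le_of_eq; ring
  · -- q⁴/φ⁴ ≤ q⁴ < 12 q⁴ ≤ 12 log n ≤ 12 log m
    have hlogn : (q : ℝ) ^ 4 ≤ Real.log n := (Real.le_log_iff_exp_le hnpos).mpr hne
    have hlogm : Real.log n ≤ Real.log m := Real.log_le_log hnpos hnm
    have hκ : (q : ℝ) ^ 4 / φr ^ 4 ≤ (q : ℝ) ^ 4 := div_le_self (by positivity) (one_le_pow₀ hφ1)
    have hq4 : (1 : ℝ) ≤ (q : ℝ) ^ 4 := one_le_pow₀ hq1
    nlinarith

/-- Instance: `χ₄` once more, now from the general theorem (cf. `not_tableChowlaFor_chi4`). -/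
example : ¬ TableChowlaFor chi4 := by
  refine not_tableChowlaFor_unitChar (q := 4) (by norm_num) chi4 (fun n => ?_) (fun a b => ?_) (fun n => ?_)
  · unfold chi4; simp [Nat.add_mod_right]
  · have ha : a % 4 < 4 := Nat.mod_lt a (by norm_num)
    have hb : b % 4 < 4 := Nat.mod_lt b (by norm_num)
    have hab : (a * b) % 4 = (a % 4) * (b % 4) % 4 := Nat.mul_mod _ _ _
    unfold chi4
    rw [hab]
    interval_cases (a % 4) <;> interval_cases (b % 4) <;> norm_num
  · rw [chi4_sq]
    have h4 : n % 4 < 4 := Nat.mod_lt n (by norm_num)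
    have hcop : Nat.Coprime 4 n ↔ n % 2 = 1 := by
      rw [show (4 : ℕ) = 2 ^ 2 by norm_num, Nat.coprime_pow_left_iff (by norm_num), Nat.coprime_two_left,
        Nat.odd_iff]
    by_cases hodd : n % 2 = 1
    · rw [if_pos hodd, if_pos (hcop.mpr hodd)]
    · rw [if_neg hodd, if_neg (fun h => hodd (hcop.mp h))]

/-- Instance: the PRINCIPAL character `𝟙_{(n,q)=1}` for every `q ≥ 1` (`q = 2`: the gen-1
pretender `𝟙_odd`; `q = 1`: the ghost `f ≡ 1`). -/
theorem not_tableChowlaFor_principal {q : ℕ} (hq : 1 ≤ q) :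
    ¬ TableChowlaFor (fun n => if q.Coprime n then 1 else 0) := by
  refine not_tableChowlaFor_unitChar hq _ (fun n => ?_) (fun a b => ?_) (fun n => ?_)
  · simp only [Nat.coprime_add_self_right]
  · by_cases ha : q.Coprime a <;> by_cases hb : q.Coprime b
    · rw [if_pos (Nat.coprime_mul_iff_right.mpr ⟨ha, hb⟩), if_pos ha, if_pos hb, one_mul]
    · rw [if_neg (fun h => hb (Nat.coprime_mul_iff_right.mp h).2), if_pos ha, if_neg hb, mul_zero]
    · rw [if_neg (fun h => ha (Nat.coprime_mul_iff_right.mp h).1), if_neg ha, if_pos hb, zero_mul]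
    · rw [if_neg (fun h => ha (Nat.coprime_mul_iff_right.mp h).1), if_neg ha, if_neg hb, zero_mul]
  · by_cases h : q.Coprime n <;> simp [h]



/-! ## (n) IDEATOR 2's card `helson-kronecker-inverse` (`SketchIdeator2.lean`, the one round-1 card
that PASSED triage): its linear-algebra stubs PROVED elementarily (no spectral theory) —
`Ideator2Copy.operatorNormForm_iff : OperatorNormForm ↔ TableChowla` (the card's FACT 1:
`σ₁⁴ ≤ tr(MMᵀ)² ≤ σ₁²·‖M‖_F²`), `Ideator2Copy.first_lemma_holds : TableChowla → HyperbolicTernary`,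
`Ideator2Copy.cm_necessary_holds : TableChowla → CMTestVectorBound` (for ARBITRARY 1-bounded
complex test vectors — complete multiplicativity is not needed for necessity),
and the typed weakness of `InverseMH` (`∃ C` after `∀ C'`): `Ideator2Copy.inverseMH_of_tableChowla`
— as typed, K1 is a CONSEQUENCE of the crux (its premise `√x/(log x)^C ≤ |uᵀMv|` is eventually
never met), so the line's composition `InverseMH → CMTestVectorBound → OperatorNormForm` cannot be
pure logic; K1 must be re-typed `∀ C ∃ C'` (triage note 1) to carry content. -/

/-- Cauchy–Schwarz in the row variable: `(Σ_{a,b} u_a v_b e_{ab})² ≤ (Σ_a u_a²)·Σ_a (Σ_b v_b e_{ab})²`. -/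
theorem bilinear_sq_le (u v : ℕ → ℝ) :
    (∑ a ∈ Ioc A₁ A₂, ∑ b ∈ Icc 1 B, u a * v b * f (Int.toNat ((a : ℤ) * b + c))) ^ 2 ≤
      (∑ a ∈ Ioc A₁ A₂, u a ^ 2) *
        ∑ a ∈ Ioc A₁ A₂, (∑ b ∈ Icc 1 B, v b * f (Int.toNat ((a : ℤ) * b + c))) ^ 2 := by
  have h := sum_mul_sq_le_sq_mul_sq (Ioc A₁ A₂) u (fun a => ∑ b ∈ Icc 1 B, v b * f (Int.toNat ((a : ℤ) * b + c)))
  refine le_trans (le_of_eq ?_) h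
  congr 1
  refine sum_congr rfl fun a _ => ?_
  rw [mul_sum]
  refine sum_congr rfl fun b _ => ?_
  ring

/-- Two more Cauchy–Schwarz steps and the column form of the moment:
`Σ_a (Σ_b w_b e_{ab})² ≤ (Σ_b w_b²)·√T` — the row Gram form is dominated by `‖w‖²·‖MᵀM‖_F`. -/
theorem rowform_sq_le (w : ℕ → ℝ) :
    ∑ a ∈ Ioc A₁ A₂, (∑ b ∈ Icc 1 B, w b * f (Int.toNat ((a : ℤ) * b + c))) ^ 2 ≤
      (∑ b ∈ Icc 1 B, w b ^ 2) * Real.sqrt (momentN f c A₁ A₂ B) := by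
  set e : ℕ → ℕ → ℝ := fun a b => f (Int.toNat ((a : ℤ) * b + c)) with he
  set G : ℕ → ℕ → ℝ := fun b b' => ∑ a ∈ Ioc A₁ A₂, e a b * e a b' with hG
  set z : ℕ → ℝ := fun b => ∑ b' ∈ Icc 1 B, G b b' * w b' with hz
  -- (1) Σ_a (Σ_b w e)² = Σ_b w_b z_b
  have h1 : ∑ a ∈ Ioc A₁ A₂, (∑ b ∈ Icc 1 B, w b * e a b) ^ 2 = ∑ b ∈ Icc 1 B, w b * z b := by
    simp only [hz, hG]
    simp_rw [sq, sum_mul_sum, mul_sum]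
    rw [sum_comm]
    refine sum_congr rfl fun b _ => ?_
    rw [sum_comm]
    refine sum_congr rfl fun b' _ => ?_
    rw [sum_mul, mul_sum]
    refine sum_congr rfl fun a _ => ?_
    ring
  -- (2) (Σ_b w z)² ≤ (Σ w²)(Σ z²)
  have h2 : (∑ b ∈ Icc 1 B, w b * z b) ^ 2 ≤ (∑ b ∈ Icc 1 B, w b ^ 2) * ∑ b ∈ Icc 1 B, z b ^ 2 :=
    sum_mul_sq_le_sq_mul_sq _ _ _
  -- (3) Σ_b z_b² ≤ (Σ w²) · T  (CS in b' for each b, then the column form of T)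
  have h3 : ∑ b ∈ Icc 1 B, z b ^ 2 ≤ (∑ b ∈ Icc 1 B, w b ^ 2) * momentN f c A₁ A₂ B := by
    have hcol : momentN f c A₁ A₂ B = ∑ b ∈ Icc 1 B, ∑ b' ∈ Icc 1 B, G b b' ^ 2 := by
      rw [momentN_eq_colMoment]
    rw [hcol, mul_sum]
    refine sum_le_sum fun b _ => ?_
    simp only [hz]
    calc (∑ b' ∈ Icc 1 B, G b b' * w b') ^ 2 ≤ (∑ b' ∈ Icc 1 B, G b b' ^ 2) * ∑ b' ∈ Icc 1 B, w b' ^ 2 :=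
          sum_mul_sq_le_sq_mul_sq _ _ _
      _ = (∑ b' ∈ Icc 1 B, w b' ^ 2) * ∑ b' ∈ Icc 1 B, G b b' ^ 2 := by ring
  -- combine: LHS = Σ w z ≤ √((Σw²)(Σz²)) ≤ √((Σw²)² T) = (Σw²) √T
  have hW : 0 ≤ ∑ b ∈ Icc 1 B, w b ^ 2 := sum_nonneg fun _ _ => sq_nonneg _
  have hT : 0 ≤ momentN f c A₁ A₂ B := momentN_nonneg
  rw [h1]
  have h4 : (∑ b ∈ Icc 1 B, w b * z b) ^ 2 ≤ ((∑ b ∈ Icc 1 B, w b ^ 2) * Real.sqrt (momentN f c A₁ A₂ B)) ^ 2 := by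
    calc (∑ b ∈ Icc 1 B, w b * z b) ^ 2 ≤ (∑ b ∈ Icc 1 B, w b ^ 2) * ∑ b ∈ Icc 1 B, z b ^ 2 := h2
      _ ≤ (∑ b ∈ Icc 1 B, w b ^ 2) * ((∑ b ∈ Icc 1 B, w b ^ 2) * momentN f c A₁ A₂ B) :=
          mul_le_mul_of_nonneg_left h3 hW
      _ = ((∑ b ∈ Icc 1 B, w b ^ 2) * Real.sqrt (momentN f c A₁ A₂ B)) ^ 2 := by
          rw [mul_pow, Real.sq_sqrt hT]; ring
  exact (abs_le_of_sq_le_sq' h4 (by positivity)).2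

/-- `σ₁⁴ ≤ tr(MMᵀ)²`, scaled: `(Σ_{a,b} u_a v_b e_{ab})⁴ ≤ (Σu²)²(Σv²)²·T`. -/
theorem bilinear_pow_four_le (u v : ℕ → ℝ) :
    (∑ a ∈ Ioc A₁ A₂, ∑ b ∈ Icc 1 B, u a * v b * f (Int.toNat ((a : ℤ) * b + c))) ^ 4 ≤
      (∑ a ∈ Ioc A₁ A₂, u a ^ 2) ^ 2 * (∑ b ∈ Icc 1 B, v b ^ 2) ^ 2 * momentN f c A₁ A₂ B := by
  have h1 := bilinear_sq_le (f := f) (c := c) (A₁ := A₁) (A₂ := A₂) (B := B) u v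
  have h2 := rowform_sq_le (f := f) (c := c) (A₁ := A₁) (A₂ := A₂) (B := B) v
  have hU : 0 ≤ ∑ a ∈ Ioc A₁ A₂, u a ^ 2 := sum_nonneg fun _ _ => sq_nonneg _
  have hV : 0 ≤ ∑ b ∈ Icc 1 B, v b ^ 2 := sum_nonneg fun _ _ => sq_nonneg _
  have hT : 0 ≤ momentN f c A₁ A₂ B := momentN_nonneg
  have h3 : (∑ a ∈ Ioc A₁ A₂, ∑ b ∈ Icc 1 B, u a * v b * f (Int.toNat ((a : ℤ) * b + c))) ^ 2 ≤
      (∑ a ∈ Ioc A₁ A₂, u a ^ 2) * ((∑ b ∈ Icc 1 B, v b ^ 2) * Real.sqrt (momentN f c A₁ A₂ B)) :=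
    le_trans h1 (mul_le_mul_of_nonneg_left h2 hU)
  have h0 : 0 ≤ (∑ a ∈ Ioc A₁ A₂, ∑ b ∈ Icc 1 B, u a * v b * f (Int.toNat ((a : ℤ) * b + c))) ^ 2 := sq_nonneg _
  calc (∑ a ∈ Ioc A₁ A₂, ∑ b ∈ Icc 1 B, u a * v b * f (Int.toNat ((a : ℤ) * b + c))) ^ 4
      = ((∑ a ∈ Ioc A₁ A₂, ∑ b ∈ Icc 1 B, u a * v b * f (Int.toNat ((a : ℤ) * b + c))) ^ 2) ^ 2 := by ring
    _ ≤ ((∑ a ∈ Ioc A₁ A₂, u a ^ 2) * ((∑ b ∈ Icc 1 B, v b ^ 2) * Real.sqrt (momentN f c A₁ A₂ B))) ^ 2 :=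
        pow_le_pow_left₀ h0 h3 2
    _ = (∑ a ∈ Ioc A₁ A₂, u a ^ 2) ^ 2 * (∑ b ∈ Icc 1 B, v b ^ 2) ^ 2 * momentN f c A₁ A₂ B := by
        rw [mul_pow, mul_pow, Real.sq_sqrt hT]; ring

namespace Ideator2Copy

/-- VERBATIM from `SketchIdeator2.lean`. -/
noncomputable def entry (c : ℤ) (a b : ℕ) : ℝ :=
  (ArithmeticFunction.liouville (Int.toNat ((a : ℤ) * b + c)) : ℝ)

/-- VERBATIM from `SketchIdeator2.lean`. -/
def HyperbolicTernary : Prop :=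
  ∀ c : ℤ, c ≠ 0 → ∀ δ : ℝ, 0 < δ → δ ≤ 1 / 12 → ∀ C : ℝ, 0 < C → ∃ x₀ : ℝ, ∀ x : ℝ, x₀ ≤ x →
    ∀ A : ℝ, x ^ δ ≤ A → A ≤ x ^ (1 / 3 + δ) →
      |∑ a ∈ Finset.Ioc ⌊A⌋₊ ⌊2 * A⌋₊, ∑ b ∈ Finset.Icc 1 ⌊x / A⌋₊,
        (ArithmeticFunction.liouville (a * b) : ℝ) * entry c a b| ≤ x / Real.log x ^ C

/-- VERBATIM from `SketchIdeator2.lean` (K1, as typed: `∀ C' ∃ C`). -/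
def InverseMH : Prop :=
  ∀ c : ℤ, c ≠ 0 → ∀ δ : ℝ, 0 < δ → δ ≤ 1 / 12 → ∀ C' : ℝ, 0 < C' → ∃ C x₀ : ℝ, 0 < C ∧
    ∀ x : ℝ, x₀ ≤ x → ∀ A : ℝ, x ^ δ ≤ A → A ≤ x ^ (1 / 3 + δ) →
    ∀ u v : ℕ → ℝ, (∑ a ∈ Finset.Ioc ⌊A⌋₊ ⌊2 * A⌋₊, u a ^ 2 ≤ 1) →
      (∑ b ∈ Finset.Icc 1 ⌊x / A⌋₊, v b ^ 2 ≤ 1) →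
      x ^ (1 / 2 : ℝ) / Real.log x ^ C ≤
        |∑ a ∈ Finset.Ioc ⌊A⌋₊ ⌊2 * A⌋₊, ∑ b ∈ Finset.Icc 1 ⌊x / A⌋₊, u a * v b * entry c a b| →
      ∃ f g : ℕ → ℂ, (∀ m n, f (m * n) = f m * f n) ∧ (∀ n, ‖f n‖ ≤ 1) ∧
        (∀ m n, g (m * n) = g m * g n) ∧ (∀ n, ‖g n‖ ≤ 1) ∧
        x / Real.log x ^ C' ≤ ‖∑ a ∈ Finset.Ioc ⌊A⌋₊ ⌊2 * A⌋₊, ∑ b ∈ Finset.Icc 1 ⌊x / A⌋₊,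
          f a * g b * (entry c a b : ℂ)‖

/-- VERBATIM from `SketchIdeator2.lean`. -/
def OperatorNormForm : Prop :=
  ∀ c : ℤ, c ≠ 0 → ∀ δ : ℝ, 0 < δ → δ ≤ 1 / 12 → ∀ C : ℝ, 0 < C → ∃ x₀ : ℝ, ∀ x : ℝ, x₀ ≤ x →
    ∀ A : ℝ, x ^ δ ≤ A → A ≤ x ^ (1 / 3 + δ) →
    ∀ u v : ℕ → ℝ, (∑ a ∈ Finset.Ioc ⌊A⌋₊ ⌊2 * A⌋₊, u a ^ 2 ≤ 1) →
      (∑ b ∈ Finset.Icc 1 ⌊x / A⌋₊, v b ^ 2 ≤ 1) →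
      |∑ a ∈ Finset.Ioc ⌊A⌋₊ ⌊2 * A⌋₊, ∑ b ∈ Finset.Icc 1 ⌊x / A⌋₊, u a * v b * entry c a b| ≤
        x ^ (1 / 2 : ℝ) / Real.log x ^ C

/-- The card's `entry` is this file's table entry for `λ`. -/
theorem entry_eq (c : ℤ) (a b : ℕ) : entry c a b = lam (Int.toNat ((a : ℤ) * b + c)) := rfl

/-- `TableChowla → OperatorNormForm` (`|uᵀMv| ≤ T^{1/4}`, crux at level `4C`). -/
theorem operatorNormForm_of_tableChowla (h : LiouvilleShiftedTables.TableChowla) : OperatorNormForm := by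
  intro c hc δ hδ hδ' C hC
  obtain ⟨x₀, hx₀⟩ := (tableChowla_iff.mp h) c hc δ hδ hδ' (4 * C) (by positivity)
  refine ⟨max x₀ 1, fun x hx A hA hA' u v hu hv => ?_⟩
  have hx₀x : x₀ ≤ x := le_trans (le_max_left _ _) hx
  have hx1 : 1 ≤ x := le_trans (le_max_right _ _) hx
  have hxpos : 0 < x := by linarith
  have hlog0 : 0 ≤ Real.log x := Real.log_nonneg hx1
  have key := hx₀ x hx₀x A hA hA'
  set X : ℝ := ∑ a ∈ Finset.Ioc ⌊A⌋₊ ⌊2 * A⌋₊, ∑ b ∈ Finset.Icc 1 ⌊x / A⌋₊, u a * v b * entry c a b with hX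
  have h4 := bilinear_pow_four_le (f := lam) (c := c) (A₁ := ⌊A⌋₊) (A₂ := ⌊2 * A⌋₊) (B := ⌊x / A⌋₊) u v
  simp only [← entry_eq] at h4
  rw [← hX] at h4
  have hmom : momentN lam c ⌊A⌋₊ ⌊2 * A⌋₊ ⌊x / A⌋₊ = moment lam c x A := rfl
  rw [hmom] at h4
  have hU0 : 0 ≤ ∑ a ∈ Finset.Ioc ⌊A⌋₊ ⌊2 * A⌋₊, u a ^ 2 := sum_nonneg fun _ _ => sq_nonneg _
  have hV0 : 0 ≤ ∑ b ∈ Finset.Icc 1 ⌊x / A⌋₊, v b ^ 2 := sum_nonneg fun _ _ => sq_nonneg _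
  have hT0 : 0 ≤ moment lam c x A := momentN_nonneg
  -- X⁴ ≤ 1·1·T ≤ x²/(log x)^{4C} = (√x/(log x)^C)⁴
  have hX4 : X ^ 4 ≤ (x ^ ((1 : ℝ) / 2) / Real.log x ^ C) ^ 4 := by
    calc X ^ 4 ≤ (∑ a ∈ Finset.Ioc ⌊A⌋₊ ⌊2 * A⌋₊, u a ^ 2) ^ 2 * (∑ b ∈ Finset.Icc 1 ⌊x / A⌋₊, v b ^ 2) ^ 2 *
          moment lam c x A := h4
      _ ≤ 1 ^ 2 * 1 ^ 2 * moment lam c x A := by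
          apply mul_le_mul_of_nonneg_right _ hT0
          exact mul_le_mul (pow_le_pow_left₀ hU0 hu 2) (pow_le_pow_left₀ hV0 hv 2) (by positivity) (by positivity)
      _ ≤ x ^ 2 / Real.log x ^ (4 * C) := by rw [one_pow, one_mul, one_mul]; exact key
      _ = (x ^ ((1 : ℝ) / 2) / Real.log x ^ C) ^ 4 := by
          rw [div_pow, ← Real.rpow_natCast (x ^ ((1:ℝ)/2)) 4, ← Real.rpow_mul hxpos.le,
            ← Real.rpow_natCast (Real.log x ^ C) 4, ← Real.rpow_mul hlog0]
          norm_num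
          rw [mul_comm C 4]
  have hR0 : 0 ≤ x ^ ((1 : ℝ) / 2) / Real.log x ^ C := by positivity
  have habs : |X| ^ 4 ≤ (x ^ ((1 : ℝ) / 2) / Real.log x ^ C) ^ 4 := by
    rwa [show |X| ^ 4 = X ^ 4 by rw [show (4 : ℕ) = 2 * 2 by norm_num, pow_mul, pow_mul, sq_abs]]
  exact (pow_le_pow_iff_left₀ (abs_nonneg X) hR0 (by norm_num)).mp habs

/-- `OperatorNormForm → TableChowla` (test vectors `u = S(a,·)/√T_a`, `v = e(a,·)/√B` give
`T_a ≤ B·x/(log x)^{2C}` per row; sum over `≤ 2A` rows). -/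
theorem tableChowla_of_operatorNormForm' (h : OperatorNormForm) : LiouvilleShiftedTables.TableChowla := by
  rw [tableChowla_iff]
  intro c hc δ hδ hδ' C hC
  obtain ⟨x₀, hx₀⟩ := h c hc δ hδ hδ' C hC
  obtain ⟨X₂, hX₂⟩ := eventually_rpow_log_ge hC 2
  refine ⟨max x₀ (max X₂ 1), fun x hx A hA hA' => ?_⟩
  have hx₀x : x₀ ≤ x := le_trans (le_max_left _ _) hx
  have hxX₂ : X₂ ≤ x := le_trans (le_trans (le_max_left _ _) (le_max_right _ _)) hx
  have hx1 : 1 ≤ x := le_trans (le_trans (le_max_right _ _) (le_max_right _ _)) hx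
  have hxpos : 0 < x := by linarith
  obtain ⟨hL2, hlog2⟩ := hX₂ x hxX₂
  have hlogpos : 0 < Real.log x := by linarith
  set L : ℝ := Real.log x ^ C with hL
  have hLpos : 0 < L := Real.rpow_pos_of_pos hlogpos C
  obtain ⟨hRB, _⟩ := rows_mul_cols_le_window hx1 hδ.le (by linarith) hA hA'
  set I : Finset ℕ := Finset.Ioc ⌊A⌋₊ ⌊2 * A⌋₊ with hI
  set Bn : ℕ := ⌊x / A⌋₊ with hBn
  set e : ℕ → ℕ → ℝ := fun a b => entry c a b with he
  -- per-row bound: T_a ≤ Bn · x / L²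
  have hrow : ∀ a ∈ I, ∑ a' ∈ I, rowCorr lam c Bn a a' ^ 2 ≤ (Bn : ℝ) * x / L ^ 2 := by
    intro a ha
    set Ta : ℝ := ∑ a' ∈ I, rowCorr lam c Bn a a' ^ 2 with hTa
    have hTa0 : 0 ≤ Ta := sum_nonneg fun _ _ => sq_nonneg _
    rcases hTa0.eq_or_lt with hzero | hpos
    · rw [← hzero]; positivity
    have hBpos : (0 : ℝ) < Bn := by
      -- if Bn = 0 then every rowCorr is an empty sum, Ta = 0
      by_contra hB
      have hB0 : Bn = 0 := by
        have : (Bn : ℝ) ≤ 0 := le_of_not_gt hB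
        exact_mod_cast le_antisymm (by exact_mod_cast this) (Nat.zero_le _)
      have : Ta = 0 := by
        rw [hTa]; refine sum_eq_zero fun a' _ => ?_
        simp [rowCorr, hB0]
      linarith
    -- test vectors
    set u : ℕ → ℝ := fun a' => rowCorr lam c Bn a a' / Real.sqrt Ta with hu
    set v : ℕ → ℝ := fun b => e a b / Real.sqrt Bn with hv
    have hsqTa : 0 < Real.sqrt Ta := Real.sqrt_pos.mpr hpos
    have hsqB : 0 < Real.sqrt Bn := Real.sqrt_pos.mpr hBpos
    have hu1 : ∑ a' ∈ I, u a' ^ 2 ≤ 1 := by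
      simp only [hu, div_pow, Real.sq_sqrt hTa0]
      rw [← sum_div, ← hTa, div_self hpos.ne']
    have hv1 : ∑ b ∈ Finset.Icc 1 Bn, v b ^ 2 ≤ 1 := by
      simp only [hv, div_pow, Real.sq_sqrt hBpos.le]
      rw [← sum_div, div_le_one hBpos]
      calc ∑ b ∈ Finset.Icc 1 Bn, e a b ^ 2 ≤ ∑ _b ∈ Finset.Icc 1 Bn, (1 : ℝ) :=
            sum_le_sum fun b _ => by simp only [he, entry_eq]; exact lam_sq_le_one _
        _ = Bn := by simp
    have key := hx₀ x hx₀x A hA hA' u v hu1 (by rw [← hBn]; exact hv1)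
    rw [← hI, ← hBn] at key
    -- the bilinear form equals √Ta / √Bn · (1) : Σ_{a',b} u a' v b e a' b = (1/(√Ta √Bn)) Σ_{a'} S(a,a') S(a',a)
    have hform : ∑ a' ∈ I, ∑ b ∈ Finset.Icc 1 Bn, u a' * v b * entry c a' b = Real.sqrt Ta / Real.sqrt Bn := by
      have hS : ∀ a', ∑ b ∈ Finset.Icc 1 Bn, u a' * v b * entry c a' b =
          u a' / Real.sqrt Bn * rowCorr lam c Bn a a' := by
        intro a'
        unfold rowCorr
        rw [mul_sum]
        refine sum_congr rfl fun b _ => ?_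
        simp only [hv, he, entry_eq]
        ring
      simp_rw [hS]
      simp only [hu]
      have : ∑ a' ∈ I, rowCorr lam c Bn a a' / Real.sqrt Ta / Real.sqrt Bn * rowCorr lam c Bn a a' =
          (∑ a' ∈ I, rowCorr lam c Bn a a' ^ 2) / (Real.sqrt Ta * Real.sqrt Bn) := by
        rw [sum_div]; refine sum_congr rfl fun a' _ => ?_; field_simp
      rw [this, ← hTa]
      rw [div_eq_div_iff (by positivity) (by positivity)]
      calc Ta * Real.sqrt Bn = Real.sqrt Ta ^ 2 * Real.sqrt Bn := by rw [Real.sq_sqrt hTa0]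
        _ = Real.sqrt Ta * (Real.sqrt Ta * Real.sqrt Bn) := by ring
    rw [hform, abs_of_nonneg (by positivity)] at key
    -- √Ta/√Bn ≤ √x / L  ⟹ Ta ≤ Bn x / L²
    have hsq : Ta / Bn ≤ x / L ^ 2 := by
      have h1 : (Real.sqrt Ta / Real.sqrt Bn) ^ 2 ≤ (x ^ ((1 : ℝ) / 2) / L) ^ 2 :=
        pow_le_pow_left₀ (by positivity) key 2
      rw [div_pow, div_pow, Real.sq_sqrt hTa0, Real.sq_sqrt hBpos.le, ← Real.rpow_natCast (x ^ ((1:ℝ)/2)) 2,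
        ← Real.rpow_mul hxpos.le] at h1
      norm_num at h1
      exact h1
    rw [div_le_div_iff₀ hBpos (by positivity)] at hsq
    rw [le_div_iff₀ (by positivity)]
    linarith
  -- sum over rows: T ≤ rows · Bn x/L² ≤ 2x · x / L² ≤ x²/L (L ≥ 2)
  have hT : momentN lam c ⌊A⌋₊ ⌊2 * A⌋₊ Bn ≤ (I.card : ℝ) * ((Bn : ℝ) * x / L ^ 2) := by
    unfold momentN
    rw [← hI]
    calc ∑ a ∈ I, ∑ a' ∈ I, rowCorr lam c Bn a a' ^ 2 ≤ ∑ _a ∈ I, (Bn : ℝ) * x / L ^ 2 := sum_le_sum hrow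
      _ = (I.card : ℝ) * ((Bn : ℝ) * x / L ^ 2) := by rw [sum_const, nsmul_eq_mul]
  have hIB : (I.card : ℝ) * Bn ≤ 2 * x := by rw [hI, Nat.card_Ioc]; exact hRB
  show momentN lam c ⌊A⌋₊ ⌊2 * A⌋₊ ⌊x / A⌋₊ ≤ x ^ 2 / L
  rw [← hBn]
  calc momentN lam c ⌊A⌋₊ ⌊2 * A⌋₊ Bn ≤ (I.card : ℝ) * ((Bn : ℝ) * x / L ^ 2) := hT
    _ = ((I.card : ℝ) * Bn) * x / L ^ 2 := by ring
    _ ≤ (2 * x) * x / L ^ 2 := by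
        apply div_le_div_of_nonneg_right _ (by positivity)
        exact mul_le_mul_of_nonneg_right hIB hxpos.le
    _ ≤ x ^ 2 / L := by
        rw [div_le_div_iff₀ (by positivity) hLpos]
        nlinarith [mul_nonneg (sq_nonneg x) hLpos.le]

/-- The card's FACT 1, PROVED: `OperatorNormForm ↔ TableChowla`. -/
theorem operatorNormForm_iff : OperatorNormForm ↔ LiouvilleShiftedTables.TableChowla :=
  ⟨tableChowla_of_operatorNormForm', operatorNormForm_of_tableChowla⟩

/-- The card's `first_lemma : TableChowla → HyperbolicTernary`, PROVED (test vectors `λ|rows`,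
`λ|cols`: `|Σ λ(a)λ(b)λ(ab+c)| ≤ √(rows·B)·T^{1/4} ≤ √2·x/(log x)^{C+1}`). -/
theorem first_lemma_holds (h : LiouvilleShiftedTables.TableChowla) : HyperbolicTernary := by
  intro c hc δ hδ hδ' C hC
  obtain ⟨x₀, hx₀⟩ := (tableChowla_iff.mp h) c hc δ hδ hδ' (4 * C + 4) (by positivity)
  obtain ⟨X₂, hX₂⟩ := eventually_rpow_log_ge hC 0
  refine ⟨max x₀ (max X₂ 1), fun x hx A hA hA' => ?_⟩
  have hx₀x : x₀ ≤ x := le_trans (le_max_left _ _) hx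
  have hxX₂ : X₂ ≤ x := le_trans (le_trans (le_max_left _ _) (le_max_right _ _)) hx
  have hx1 : 1 ≤ x := le_trans (le_trans (le_max_right _ _) (le_max_right _ _)) hx
  have hxpos : 0 < x := by linarith
  obtain ⟨_, hlog2⟩ := hX₂ x hxX₂
  have hlogpos : 0 < Real.log x := by linarith
  set L : ℝ := Real.log x ^ C with hL
  have hLpos : 0 < L := Real.rpow_pos_of_pos hlogpos C
  obtain ⟨hRB, _⟩ := rows_mul_cols_le_window hx1 hδ.le (by linarith) hA hA'
  have key := hx₀ x hx₀x A hA hA'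
  -- rewrite the summand: λ(ab)·entry = λ(a)·λ(b)·e(a,b)
  have hsummand : ∀ a b : ℕ, (ArithmeticFunction.liouville (a * b) : ℝ) * entry c a b =
      lam a * lam b * lam (Int.toNat ((a : ℤ) * b + c)) := by
    intro a b
    rw [entry_eq, show ((ArithmeticFunction.liouville (a * b) : ℤ) : ℝ) = lam (a * b) from rfl, lam_mul]
  simp_rw [hsummand]
  set X : ℝ := ∑ a ∈ Finset.Ioc ⌊A⌋₊ ⌊2 * A⌋₊, ∑ b ∈ Finset.Icc 1 ⌊x / A⌋₊,
    lam a * lam b * lam (Int.toNat ((a : ℤ) * b + c)) with hX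
  have h4 := bilinear_pow_four_le (f := lam) (c := c) (A₁ := ⌊A⌋₊) (A₂ := ⌊2 * A⌋₊) (B := ⌊x / A⌋₊) lam lam
  rw [← hX] at h4
  have hmom : momentN lam c ⌊A⌋₊ ⌊2 * A⌋₊ ⌊x / A⌋₊ = moment lam c x A := rfl
  rw [hmom] at h4
  -- Σ λ² ≤ card
  have hU : ∑ a ∈ Finset.Ioc ⌊A⌋₊ ⌊2 * A⌋₊, lam a ^ 2 ≤ ((⌊2 * A⌋₊ - ⌊A⌋₊ : ℕ) : ℝ) := by
    calc ∑ a ∈ Finset.Ioc ⌊A⌋₊ ⌊2 * A⌋₊, lam a ^ 2 ≤ ∑ _a ∈ Finset.Ioc ⌊A⌋₊ ⌊2 * A⌋₊, (1 : ℝ) :=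
          sum_le_sum fun a _ => lam_sq_le_one a
      _ = _ := by simp
  have hV : ∑ b ∈ Finset.Icc 1 ⌊x / A⌋₊, lam b ^ 2 ≤ (⌊x / A⌋₊ : ℝ) := by
    calc ∑ b ∈ Finset.Icc 1 ⌊x / A⌋₊, lam b ^ 2 ≤ ∑ _b ∈ Finset.Icc 1 ⌊x / A⌋₊, (1 : ℝ) :=
          sum_le_sum fun b _ => lam_sq_le_one b
      _ = _ := by simp
  have hU0 : 0 ≤ ∑ a ∈ Finset.Ioc ⌊A⌋₊ ⌊2 * A⌋₊, lam a ^ 2 := sum_nonneg fun _ _ => sq_nonneg _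
  have hV0 : 0 ≤ ∑ b ∈ Finset.Icc 1 ⌊x / A⌋₊, lam b ^ 2 := sum_nonneg fun _ _ => sq_nonneg _
  have hT0 : 0 ≤ moment lam c x A := momentN_nonneg
  -- X⁴ ≤ (rows·B)² · T ≤ (2x)² · x²/(log x)^{4C+4}
  have hpow : Real.log x ^ (4 * C + 4) = (L * Real.log x) ^ 4 := by
    rw [hL, show (4 : ℝ) * C + 4 = (C + 1) + (C + 1) + ((C + 1) + (C + 1)) by ring,
      Real.rpow_add hlogpos, Real.rpow_add hlogpos, Real.rpow_add hlogpos, Real.rpow_one]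
    ring
  have hX4 : X ^ 4 ≤ (2 * x) ^ 2 * (x ^ 2 / (L * Real.log x) ^ 4) := by
    calc X ^ 4 ≤ (∑ a ∈ Finset.Ioc ⌊A⌋₊ ⌊2 * A⌋₊, lam a ^ 2) ^ 2 * (∑ b ∈ Finset.Icc 1 ⌊x / A⌋₊, lam b ^ 2) ^ 2 *
          moment lam c x A := h4
      _ ≤ (((⌊2 * A⌋₊ - ⌊A⌋₊ : ℕ) : ℝ)) ^ 2 * ((⌊x / A⌋₊ : ℝ)) ^ 2 * (x ^ 2 / Real.log x ^ (4 * C + 4)) := by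
          apply mul_le_mul _ key hT0 (by positivity)
          exact mul_le_mul (pow_le_pow_left₀ hU0 hU 2) (pow_le_pow_left₀ hV0 hV 2) (by positivity) (by positivity)
      _ = (((⌊2 * A⌋₊ - ⌊A⌋₊ : ℕ) : ℝ) * (⌊x / A⌋₊ : ℝ)) ^ 2 * (x ^ 2 / (L * Real.log x) ^ 4) := by rw [hpow]; ring
      _ ≤ (2 * x) ^ 2 * (x ^ 2 / (L * Real.log x) ^ 4) := by
          apply mul_le_mul_of_nonneg_right _ (by positivity)
          exact pow_le_pow_left₀ (by positivity) hRB 2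
  -- (2x)² x²/(L log x)⁴ ≤ (x/L)⁴ when (log x)⁴ ≥ 4, i.e. log x ≥ 2 suffices (2⁴ = 16 ≥ 4)
  have hX4' : X ^ 4 ≤ (x / L) ^ 4 := by
    refine le_trans hX4 ?_
    have hl4 : (4 : ℝ) ≤ Real.log x ^ 4 := by
      have := pow_le_pow_left₀ (by norm_num : (0 : ℝ) ≤ 2) hlog2 4
      norm_num at this
      linarith
    rw [show (2 * x) ^ 2 * (x ^ 2 / (L * Real.log x) ^ 4) = (x / L) ^ 4 * (4 / Real.log x ^ 4) by
      field_simp; ring]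
    apply mul_le_of_le_one_right (by positivity)
    rw [div_le_one (by positivity)]
    exact hl4
  have habs : |X| ^ 4 ≤ (x / L) ^ 4 := by
    rwa [show |X| ^ 4 = X ^ 4 by rw [show (4 : ℕ) = 2 * 2 by norm_num, pow_mul, pow_mul, sq_abs]]
  exact (pow_le_pow_iff_left₀ (abs_nonneg X) (by positivity) (by norm_num)).mp habs

/-- K1 AS TYPED is a consequence of the crux (its premise is eventually never met: take `C := 1`;
the crux gives `|uᵀMv| ≤ √x/(log x)²`), so it cannot feed a non-circular proof of
`OperatorNormForm` — re-type it `∀ C ∃ C'`. -/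
theorem inverseMH_of_tableChowla (h : LiouvilleShiftedTables.TableChowla) : InverseMH := by
  intro c hc δ hδ hδ' C' _
  obtain ⟨x₀, hx₀⟩ := operatorNormForm_of_tableChowla h c hc δ hδ hδ' 2 (by norm_num)
  refine ⟨1, max x₀ (Real.exp 2), one_pos, fun x hx A hA hA' u v hu hv hbig => ?_⟩
  exfalso
  have hx₀x : x₀ ≤ x := le_trans (le_max_left _ _) hx
  have hxe : Real.exp 2 ≤ x := le_trans (le_max_right _ _) hx
  have hxpos : 0 < x := (Real.exp_pos 2).trans_le hxe
  have hlog2 : 2 ≤ Real.log x := (Real.le_log_iff_exp_le hxpos).mpr hxe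
  have hsmall := hx₀ x hx₀x A hA hA' u v hu hv
  rw [Real.rpow_one] at hbig
  -- √x / log x ≤ |uᵀMv| ≤ √x / (log x)^2 < √x / log x
  have hsqrt : 0 < x ^ ((1 : ℝ) / 2) := Real.rpow_pos_of_pos hxpos _
  have hlt : x ^ ((1 : ℝ) / 2) / Real.log x ^ (2 : ℝ) < x ^ ((1 : ℝ) / 2) / Real.log x := by
    apply div_lt_div_of_pos_left hsqrt (by linarith)
    rw [Real.rpow_two]; nlinarith
  linarith

/-- VERBATIM from `SketchIdeator2.lean`. -/
def CMTestVectorBound : Prop :=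
  ∀ c : ℤ, c ≠ 0 → ∀ δ : ℝ, 0 < δ → δ ≤ 1 / 12 → ∀ C : ℝ, 0 < C → ∃ x₀ : ℝ, ∀ x : ℝ, x₀ ≤ x →
    ∀ A : ℝ, x ^ δ ≤ A → A ≤ x ^ (1 / 3 + δ) →
    ∀ f g : ℕ → ℂ, (∀ m n, f (m * n) = f m * f n) → (∀ n, ‖f n‖ ≤ 1) →
      (∀ m n, g (m * n) = g m * g n) → (∀ n, ‖g n‖ ≤ 1) →
      ‖∑ a ∈ Finset.Ioc ⌊A⌋₊ ⌊2 * A⌋₊, ∑ b ∈ Finset.Icc 1 ⌊x / A⌋₊,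
        f a * g b * (entry c a b : ℂ)‖ ≤ x / Real.log x ^ C

/-- The card's `cm_necessary : TableChowla → CMTestVectorBound`, PROVED — indeed for ARBITRARY
1-bounded complex test vectors (complete multiplicativity is not used): `‖fᵀMg‖² ≤ rows·B·√T`. -/
theorem cm_necessary_holds (h : LiouvilleShiftedTables.TableChowla) : CMTestVectorBound := by
  intro c hc δ hδ hδ' C hC
  obtain ⟨x₀, hx₀⟩ := (tableChowla_iff.mp h) c hc δ hδ hδ' (4 * C + 4) (by positivity)
  obtain ⟨X₂, hX₂⟩ := eventually_rpow_log_ge hC 0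
  refine ⟨max x₀ (max X₂ 1), fun x hx A hA hA' f g _ hf _ hg => ?_⟩
  have hx₀x : x₀ ≤ x := le_trans (le_max_left _ _) hx
  have hxX₂ : X₂ ≤ x := le_trans (le_trans (le_max_left _ _) (le_max_right _ _)) hx
  have hx1 : 1 ≤ x := le_trans (le_trans (le_max_right _ _) (le_max_right _ _)) hx
  have hxpos : 0 < x := by linarith
  obtain ⟨_, hlog2⟩ := hX₂ x hxX₂
  have hlogpos : 0 < Real.log x := by linarith
  set L : ℝ := Real.log x ^ C with hL
  have hLpos : 0 < L := Real.rpow_pos_of_pos hlogpos C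
  obtain ⟨hRB, _⟩ := rows_mul_cols_le_window hx1 hδ.le (by linarith) hA hA'
  have key := hx₀ x hx₀x A hA hA'
  set I : Finset ℕ := Finset.Ioc ⌊A⌋₊ ⌊2 * A⌋₊ with hI
  set J : Finset ℕ := Finset.Icc 1 ⌊x / A⌋₊ with hJ
  set e : ℕ → ℕ → ℝ := fun a b => entry c a b with he
  set y : ℕ → ℂ := fun a => ∑ b ∈ J, g b * (e a b : ℂ) with hy
  -- (1) ‖X‖ ≤ Σ_a ‖y a‖
  have h1 : ‖∑ a ∈ I, ∑ b ∈ J, f a * g b * (entry c a b : ℂ)‖ ≤ ∑ a ∈ I, ‖y a‖ := by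
    have hX : ∑ a ∈ I, ∑ b ∈ J, f a * g b * (entry c a b : ℂ) = ∑ a ∈ I, f a * y a := by
      refine sum_congr rfl fun a _ => ?_
      simp only [hy, he, mul_sum]
      refine sum_congr rfl fun b _ => ?_
      ring
    rw [hX]
    refine le_trans (norm_sum_le _ _) (sum_le_sum fun a _ => ?_)
    rw [norm_mul]
    exact mul_le_of_le_one_left (norm_nonneg _) (hf a)
  -- (2) ‖y a‖² = (Σ_b g₁ e)² + (Σ_b g₂ e)²
  have h2 : ∀ a, ‖y a‖ ^ 2 = (∑ b ∈ J, (g b).re * e a b) ^ 2 + (∑ b ∈ J, (g b).im * e a b) ^ 2 := by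
    intro a
    rw [← Complex.normSq_eq_norm_sq, Complex.normSq_apply]
    have hre : (y a).re = ∑ b ∈ J, (g b).re * e a b := by
      simp only [hy, Complex.re_sum, Complex.mul_re, Complex.ofReal_re, Complex.ofReal_im, mul_zero, sub_zero]
    have him : (y a).im = ∑ b ∈ J, (g b).im * e a b := by
      simp only [hy, Complex.im_sum, Complex.mul_im, Complex.ofReal_re, Complex.ofReal_im, mul_zero, zero_add]
    rw [hre, him]; ring
  -- (3) Σ_a ‖y a‖² ≤ B √T
  have hT0 : 0 ≤ moment lam c x A := momentN_nonneg
  have h3 : ∑ a ∈ I, ‖y a‖ ^ 2 ≤ (⌊x / A⌋₊ : ℝ) * Real.sqrt (moment lam c x A) := by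
    simp_rw [h2]
    rw [sum_add_distrib]
    have hr := rowform_sq_le (f := lam) (c := c) (A₁ := ⌊A⌋₊) (A₂ := ⌊2 * A⌋₊) (B := ⌊x / A⌋₊) (fun b => (g b).re)
    have hi := rowform_sq_le (f := lam) (c := c) (A₁ := ⌊A⌋₊) (A₂ := ⌊2 * A⌋₊) (B := ⌊x / A⌋₊) (fun b => (g b).im)
    simp only [← entry_eq] at hr hi
    rw [← hI, ← hJ] at hr hi
    have hmom : momentN lam c ⌊A⌋₊ ⌊2 * A⌋₊ ⌊x / A⌋₊ = moment lam c x A := rfl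
    rw [hmom] at hr hi
    have hg2 : ∑ b ∈ J, ((g b).re ^ 2 + (g b).im ^ 2) ≤ (⌊x / A⌋₊ : ℝ) := by
      calc ∑ b ∈ J, ((g b).re ^ 2 + (g b).im ^ 2) ≤ ∑ _b ∈ J, (1 : ℝ) := by
            refine sum_le_sum fun b _ => ?_
            have hgb := hg b
            have hn : ‖g b‖ ^ 2 ≤ 1 := by nlinarith [norm_nonneg (g b)]
            rw [← Complex.normSq_eq_norm_sq, Complex.normSq_apply] at hn
            nlinarith
        _ = (⌊x / A⌋₊ : ℝ) := by rw [sum_const, nsmul_eq_mul, mul_one, hJ, Nat.card_Icc, Nat.add_sub_cancel]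
    calc ∑ a ∈ I, (∑ b ∈ J, (g b).re * e a b) ^ 2 + ∑ a ∈ I, (∑ b ∈ J, (g b).im * e a b) ^ 2
        ≤ (∑ b ∈ J, (g b).re ^ 2) * Real.sqrt (moment lam c x A) +
          (∑ b ∈ J, (g b).im ^ 2) * Real.sqrt (moment lam c x A) := add_le_add hr hi
      _ = (∑ b ∈ J, ((g b).re ^ 2 + (g b).im ^ 2)) * Real.sqrt (moment lam c x A) := by
          rw [sum_add_distrib]; ring
      _ ≤ (⌊x / A⌋₊ : ℝ) * Real.sqrt (moment lam c x A) := mul_le_mul_of_nonneg_right hg2 (Real.sqrt_nonneg _)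
  -- (4) CS: (Σ ‖y‖)² ≤ |I| Σ ‖y‖² ≤ rows·B·√T ≤ 2x · x/(L log x)²
  have h4 : (∑ a ∈ I, ‖y a‖) ^ 2 ≤ (I.card : ℝ) * ∑ a ∈ I, ‖y a‖ ^ 2 := by
    have := sum_mul_sq_le_sq_mul_sq I (fun _ => (1 : ℝ)) (fun a => ‖y a‖)
    simpa using this
  have hpow : Real.log x ^ (4 * C + 4) = ((L * Real.log x) ^ 2) ^ 2 := by
    rw [hL, show (4 : ℝ) * C + 4 = (C + 1) + (C + 1) + ((C + 1) + (C + 1)) by ring,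
      Real.rpow_add hlogpos, Real.rpow_add hlogpos, Real.rpow_add hlogpos, Real.rpow_one]
    ring
  have hsqrtT : Real.sqrt (moment lam c x A) ≤ x / (L * Real.log x) ^ 2 := by
    rw [hpow] at key
    calc Real.sqrt (moment lam c x A) ≤ Real.sqrt (x ^ 2 / ((L * Real.log x) ^ 2) ^ 2) := Real.sqrt_le_sqrt key
      _ = x / (L * Real.log x) ^ 2 := by rw [← div_pow, Real.sqrt_sq (by positivity)]
  have hIB : (I.card : ℝ) * (⌊x / A⌋₊ : ℝ) ≤ 2 * x := by rw [hI, Nat.card_Ioc]; exact hRB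
  have hfinal : (∑ a ∈ I, ‖y a‖) ^ 2 ≤ (x / L) ^ 2 := by
    calc (∑ a ∈ I, ‖y a‖) ^ 2 ≤ (I.card : ℝ) * ∑ a ∈ I, ‖y a‖ ^ 2 := h4
      _ ≤ (I.card : ℝ) * ((⌊x / A⌋₊ : ℝ) * Real.sqrt (moment lam c x A)) :=
          mul_le_mul_of_nonneg_left h3 (Nat.cast_nonneg _)
      _ = ((I.card : ℝ) * (⌊x / A⌋₊ : ℝ)) * Real.sqrt (moment lam c x A) := by ring
      _ ≤ (2 * x) * (x / (L * Real.log x) ^ 2) :=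
          mul_le_mul hIB hsqrtT (Real.sqrt_nonneg _) (by positivity)
      _ = (x / L) ^ 2 * (2 / Real.log x ^ 2) := by field_simp
      _ ≤ (x / L) ^ 2 := by
          apply mul_le_of_le_one_right (by positivity)
          rw [div_le_one (by positivity)]; nlinarith
  have hnn : 0 ≤ ∑ a ∈ I, ‖y a‖ := sum_nonneg fun _ _ => norm_nonneg _
  have h5 : ∑ a ∈ I, ‖y a‖ ≤ x / L := (pow_le_pow_iff_left₀ hnn (by positivity) two_ne_zero).mp hfinal
  exact le_trans h1 h5

end Ideator2Copy


/-! ## (d′) THE DUAL RESISTANCE THEOREM (short sums): the crux also follows from uniform binary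
Chowla for the SHORT two-form sums over the rows — `|Σ_{a ∈ (A,2A]} λ(ab+c)λ(ab'+c)| ≤ rows/(log x)^C`
uniformly for distinct columns `b ≠ b' ≤ x` (length `≍ A ≥ x^δ`; a Chowla-in-short-ranges
conjecture, believed for every fixed `δ > 0`). With (d): a counterexample to the crux would refute
BOTH the long-sum (Elliott-type) and the short-sum (Matomäki–Radziwiłł-type) uniform conjectures. -/

/-- Column correlation (SHORT sum over the rows) `G(b,b') = Σ_{a ∈ (A₁,A₂]} f(ab+c) f(ab'+c)`
(same as `DisproofBands.colCorr`). -/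
def colCorrS (f : ℕ → ℝ) (c : ℤ) (A₁ A₂ b b' : ℕ) : ℝ :=
  ∑ a ∈ Ioc A₁ A₂, f (Int.toNat ((a : ℤ) * b + c)) * f (Int.toNat ((a : ℤ) * b' + c))

/-- HYPOTHESIS — uniform binary Chowla for SHORT two-form sums over the rows of the window. -/
def UniformShortBinaryChowla : Prop :=
  ∀ c : ℤ, c ≠ 0 → ∀ δ : ℝ, 0 < δ → ∀ C : ℝ, 0 < C → ∃ x₀ : ℝ, ∀ x : ℝ, x₀ ≤ x →
    ∀ A : ℝ, x ^ δ ≤ A → A ≤ x → ∀ b b' : ℕ, b ≠ b' → (b : ℝ) ≤ x → (b' : ℝ) ≤ x →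
      |colCorrS lam c ⌊A⌋₊ ⌊2 * A⌋₊ b b'| ≤ ((⌊2 * A⌋₊ - ⌊A⌋₊ : ℕ) : ℝ) / Real.log x ^ C

/-- Trivial bound `|G(b,b')| ≤ rows` for `|f| ≤ 1`. -/
theorem abs_colCorrS_le (hf : ∀ n, |f n| ≤ 1) (b b' : ℕ) :
    |colCorrS f c A₁ A₂ b b'| ≤ ((A₂ - A₁ : ℕ) : ℝ) := by
  unfold colCorrS
  calc |∑ a ∈ Ioc A₁ A₂, f (Int.toNat ((a : ℤ) * b + c)) * f (Int.toNat ((a : ℤ) * b' + c))|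
        ≤ ∑ a ∈ Ioc A₁ A₂, |f (Int.toNat ((a : ℤ) * b + c)) * f (Int.toNat ((a : ℤ) * b' + c))| :=
          abs_sum_le_sum_abs _ _
    _ ≤ ∑ _a ∈ Ioc A₁ A₂, (1 : ℝ) := by
          refine sum_le_sum fun a _ => ?_
          rw [abs_mul]
          exact mul_le_one₀ (hf _) (abs_nonneg _) (hf _)
    _ = ((A₂ - A₁ : ℕ) : ℝ) := by simp

/-- COMBINATORIAL CORE (columns): if every OFF-diagonal column correlation is `≤ ε·rows` then
`T ≤ B·rows² + B²·(ε·rows)²`. -/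
theorem momentN_le_of_offDiag_cols (hf : ∀ n, |f n| ≤ 1) {ε : ℝ}
    (hoff : ∀ b ∈ Icc 1 B, ∀ b' ∈ Icc 1 B, b ≠ b' → |colCorrS f c A₁ A₂ b b'| ≤ ε * ((A₂ - A₁ : ℕ) : ℝ)) :
    momentN f c A₁ A₂ B ≤ (B : ℝ) * ((A₂ - A₁ : ℕ) : ℝ) ^ 2 + (B : ℝ) ^ 2 * (ε * ((A₂ - A₁ : ℕ) : ℝ)) ^ 2 := by
  rw [momentN_eq_colMoment]
  have hG : ∀ b b' : ℕ, (∑ a ∈ Ioc A₁ A₂, f (Int.toNat ((a : ℤ) * b + c)) * f (Int.toNat ((a : ℤ) * b' + c))) =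
      colCorrS f c A₁ A₂ b b' := fun _ _ => rfl
  simp_rw [hG]
  have hrow : ∀ b ∈ Icc 1 B, ∑ b' ∈ Icc 1 B, colCorrS f c A₁ A₂ b b' ^ 2 ≤
      ((A₂ - A₁ : ℕ) : ℝ) ^ 2 + B * (ε * ((A₂ - A₁ : ℕ) : ℝ)) ^ 2 := by
    intro b hb
    rw [← Finset.add_sum_erase _ _ hb]
    have hdiag : colCorrS f c A₁ A₂ b b ^ 2 ≤ ((A₂ - A₁ : ℕ) : ℝ) ^ 2 := by
      have h1 := abs_colCorrS_le (c := c) (A₁ := A₁) (A₂ := A₂) hf b b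
      exact sq_le_sq' (by linarith [(abs_le.mp h1).1]) (abs_le.mp h1).2
    have hoffsum : ∑ b' ∈ (Icc 1 B).erase b, colCorrS f c A₁ A₂ b b' ^ 2 ≤ B * (ε * ((A₂ - A₁ : ℕ) : ℝ)) ^ 2 := by
      calc ∑ b' ∈ (Icc 1 B).erase b, colCorrS f c A₁ A₂ b b' ^ 2
          ≤ ∑ _b' ∈ (Icc 1 B).erase b, (ε * ((A₂ - A₁ : ℕ) : ℝ)) ^ 2 := by
            refine sum_le_sum fun b' hb' => ?_
            have hne : b ≠ b' := (Finset.ne_of_mem_erase hb').symm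
            have hmem : b' ∈ Icc 1 B := Finset.mem_of_mem_erase hb'
            have h1 := hoff b hb b' hmem hne
            exact sq_le_sq' (by linarith [(abs_le.mp h1).1]) (abs_le.mp h1).2
        _ ≤ ∑ _b' ∈ Icc 1 B, (ε * ((A₂ - A₁ : ℕ) : ℝ)) ^ 2 :=
            sum_le_sum_of_subset_of_nonneg (erase_subset _ _) (fun _ _ _ => sq_nonneg _)
        _ = B * (ε * ((A₂ - A₁ : ℕ) : ℝ)) ^ 2 := by simp
    linarith
  calc ∑ b ∈ Icc 1 B, ∑ b' ∈ Icc 1 B, colCorrS f c A₁ A₂ b b' ^ 2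
      ≤ ∑ _b ∈ Icc 1 B, (((A₂ - A₁ : ℕ) : ℝ) ^ 2 + B * (ε * ((A₂ - A₁ : ℕ) : ℝ)) ^ 2) := sum_le_sum hrow
    _ = _ := by simp only [sum_const, Nat.card_Icc, Nat.add_sub_cancel, nsmul_eq_mul]; ring

/-- DUAL RESISTANCE THEOREM: `UniformShortBinaryChowla → TableChowla` (diagonal `B·rows² ≤ 4x·x^{5/12}
≤ x²/(2(log x)^C)` once `8(log x)^C ≤ x^{7/12}`; off-diagonal `(rows·B)²/(log x)^{2C} ≤ 4x²/(log x)^{2C}`). -/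
theorem tableChowla_of_uniformShortBinaryChowla (h : UniformShortBinaryChowla) :
    LiouvilleShiftedTables.TableChowla := by
  rw [tableChowla_iff]
  intro c hc δ hδ hδ' C hC
  obtain ⟨x₁, hx₁⟩ := h c hc δ hδ C hC
  obtain ⟨X₁, hX₁⟩ := eventually_log_rpow_le (show (0 : ℝ) < 7 / 12 by norm_num) (C + 1)
  obtain ⟨X₂, hX₂⟩ := eventually_rpow_log_ge hC 8
  refine ⟨max (max x₁ 1) (max X₁ X₂), fun x hx A hA hA' => ?_⟩
  have hxx₁ : x₁ ≤ x := le_trans (le_trans (le_max_left _ _) (le_max_left _ _)) hx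
  have hx1 : 1 ≤ x := le_trans (le_trans (le_max_right _ _) (le_max_left _ _)) hx
  have hxX₁ : X₁ ≤ x := le_trans (le_trans (le_max_left _ _) (le_max_right _ _)) hx
  have hxX₂ : X₂ ≤ x := le_trans (le_trans (le_max_right _ _) (le_max_right _ _)) hx
  have hxpos : 0 < x := by linarith
  obtain ⟨hL8, hlog2⟩ := hX₂ x hxX₂
  obtain ⟨h4, _⟩ := hX₁ x hxX₁
  have hlogpos : 0 < Real.log x := by linarith
  set L : ℝ := Real.log x ^ C with hL
  have hLpos : 0 < L := Real.rpow_pos_of_pos hlogpos C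
  have hL' : Real.log x ^ (C + 1) = L * Real.log x := by rw [hL, Real.rpow_add hlogpos, Real.rpow_one]
  rw [hL'] at h4
  have h8L : 8 * L ≤ x ^ ((7 : ℝ) / 12) := by nlinarith
  have hAone : 1 ≤ A := le_trans (Real.one_le_rpow hx1 hδ.le) hA
  have hApos : 0 < A := by linarith
  have hAx : A ≤ x := hA'.trans (by
    calc x ^ (1 / 3 + δ) ≤ x ^ (1 : ℝ) := Real.rpow_le_rpow_of_exponent_le hx1 (by linarith)
      _ = x := Real.rpow_one x)
  have hA512 : A ≤ x ^ ((5 : ℝ) / 12) := hA'.trans (Real.rpow_le_rpow_of_exponent_le hx1 (by linarith))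
  set S : ℕ := ⌊2 * A⌋₊ - ⌊A⌋₊ with hS
  set Bn : ℕ := ⌊x / A⌋₊ with hBn
  have hrows : (S : ℝ) ≤ 2 * A := by
    rw [hS, Nat.cast_sub (Nat.floor_le_floor (by linarith : A ≤ 2 * A))]
    have h1 : (⌊2 * A⌋₊ : ℝ) ≤ 2 * A := Nat.floor_le (by linarith)
    have h2 : A - 1 < (⌊A⌋₊ : ℝ) := by have := Nat.lt_floor_add_one A; linarith
    linarith
  have hBle : (Bn : ℝ) ≤ x / A := Nat.floor_le (by positivity)
  have hBx : (Bn : ℝ) ≤ x := hBle.trans (div_le_self hxpos.le hAone)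
  have hRB : (S : ℝ) * Bn ≤ 2 * x := by
    calc (S : ℝ) * Bn ≤ (2 * A) * (x / A) := mul_le_mul hrows hBle (by positivity) (by positivity)
      _ = 2 * x := by field_simp
  have hbcol : ∀ b ∈ Icc 1 Bn, (b : ℝ) ≤ x := by
    intro b hb; rw [mem_Icc] at hb
    exact le_trans (by exact_mod_cast hb.2) hBx
  have hoff : ∀ b ∈ Icc 1 Bn, ∀ b' ∈ Icc 1 Bn, b ≠ b' →
      |colCorrS lam c ⌊A⌋₊ ⌊2 * A⌋₊ b b'| ≤ 1 / L * ((⌊2 * A⌋₊ - ⌊A⌋₊ : ℕ) : ℝ) := by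
    intro b hb b' hb' hne
    have := hx₁ x hxx₁ A hA hAx b b' hne (hbcol b hb) (hbcol b' hb')
    rw [hL, one_div_mul_eq_div]; exact this
  have hT := momentN_le_of_offDiag_cols (f := lam) (c := c) (A₁ := ⌊A⌋₊) (A₂ := ⌊2 * A⌋₊) (B := Bn)
    abs_lam_le_one hoff
  rw [← hS] at hT
  -- diagonal: Bn S² ≤ (S Bn) S ≤ 2x · 2A ≤ 4 x · x^{5/12} ≤ x²/(2L)
  have hx712 : x ^ ((5 : ℝ) / 12) * x ^ ((7 : ℝ) / 12) = x := by
    rw [← Real.rpow_add hxpos]; norm_num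
  have t1 : (Bn : ℝ) * (S : ℝ) ^ 2 ≤ x ^ 2 / (2 * L) := by
    have hstep : (Bn : ℝ) * (S : ℝ) ^ 2 ≤ 4 * x * x ^ ((5 : ℝ) / 12) := by
      calc (Bn : ℝ) * (S : ℝ) ^ 2 = ((S : ℝ) * Bn) * S := by ring
        _ ≤ (2 * x) * (2 * A) := mul_le_mul hRB hrows (Nat.cast_nonneg _) (by positivity)
        _ = 4 * x * A := by ring
        _ ≤ 4 * x * x ^ ((5 : ℝ) / 12) := mul_le_mul_of_nonneg_left hA512 (by positivity)
    refine le_trans hstep ?_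
    rw [le_div_iff₀ (by positivity)]
    -- 4 x x^{5/12} · 2L = x^{5/12} x · 8L ≤ x^{5/12} · x · x^{7/12} = x²
    have hx512pos : 0 < x ^ ((5 : ℝ) / 12) := Real.rpow_pos_of_pos hxpos _
    nlinarith [mul_le_mul_of_nonneg_left h8L (le_of_lt (mul_pos hxpos hx512pos)), hx712]
  -- off-diagonal: Bn² (S/L)² = (S Bn)²/L² ≤ 4x²/L² ≤ x²/(2L)
  have t2 : (Bn : ℝ) ^ 2 * (1 / L * (S : ℝ)) ^ 2 ≤ x ^ 2 / (2 * L) := by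
    have e1 : (Bn : ℝ) ^ 2 * (1 / L * (S : ℝ)) ^ 2 = ((S : ℝ) * Bn) ^ 2 / L ^ 2 := by field_simp
    rw [e1, div_le_div_iff₀ (by positivity) (by positivity)]
    have hsb : ((S : ℝ) * Bn) ^ 2 ≤ (2 * x) ^ 2 := pow_le_pow_left₀ (by positivity) hRB 2
    nlinarith [mul_nonneg (sq_nonneg x) hLpos.le]
  have t5 : x ^ 2 / (2 * L) + x ^ 2 / (2 * L) = x ^ 2 / L := by field_simp; ring
  show momentN lam c ⌊A⌋₊ ⌊2 * A⌋₊ ⌊x / A⌋₊ ≤ x ^ 2 / L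
  rw [← hBn]
  linarith

end

end Summit.Parity.GeneralizedHardyLittlewood.Cruxes.TableChowla.Disproof
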